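import Literature.Analysis.FluidPDE.BiotSavartCurlPair
import Literature.Analysis.FluidPDE.AxisymGradientField
import Literature.Analysis.FluidPDE.SwirlTransportProofs
import Literature.Analysis.FluidPDE.AxisymHouLiVariables
import Literature.Analysis.FluidPDE.TaoEnstrophyLocalisationProofs
import Literature.Analysis.FluidPDE.HouLeiLiEstimate
import Literature.Analysis.FluidPDE.AxisymOuterBounds
import Literature.Analysis.FluidPDE.AxisymQuotientEquationsJ
import Literature.Analysis.FluidPDE.AxisymPoloidalMoments
import Literature.Analysis.FluidPDE.AxisymPoloidalCutoff
import Literature.Analysis.FluidPDE.TaoEnstrophyLocalisation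
import Literature.Analysis.FluidPDE.RusinSverakCompactness
import Literature.Analysis.FluidPDE.SqIntegralBalance
import Literature.Analysis.FluidPDE.Wei2016PoloidalCurl
import Literature.Analysis.FluidPDE.CollapseDebris
import Literature.Analysis.FluidPDE.SereginSverakAxisymmetric
import Literature.Analysis.Calculus.HardyLogarithmic
import Literature.Analysis.Calculus.PlanarPolarIntegral
import Literature.Analysis.FluidPDE.SuitableWeakProofs
import Literature.Analysis.FluidPDE.HouLiSpaceTime
import Literature.Analysis.FluidPDE.Seregin2022LogSwirlOriginCutoffTools
import HarnessLib

/-!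
# Seregin 2022 local regularity of axisymmetric solutions, file 2 of 6: the stream form and the `Φ`-source bound of Step 3, Lemma 2.1 (localised and cut-off), the unconditional key estimate, the Step-1 pointwise constants (re-homed proofs)

**G. Seregin, *A note on local regularity of axisymmetric solutions to the Navier–Stokes equations*, J. Math. Fluid Mech. 24
(2022), Paper 27 = arXiv:2201.00153, Theorem 1.2 via §2 from the swirl decay (2.2) [Seregin2022LocalAxisym]: for a suitable weak
solution in the unit parabolic cylinder `Q = 𝒞 × ]-1,0[`, axisymmetric, with `v ∈ L_{2,∞}(Q)`, `∇v ∈ L₂(Q)`, `q ∈ L_{3/2}(Q)` and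
`|v_θ(x,t)| ≤ C₁ |x'|⁻¹ / ln³(e/|x'|)` off the axis, the origin is a regular point.**  The named fact
`Literature.Analysis.FluidPDE.seregin2022_logSwirl_regularAtOrigin` (`Seregin2022LogSwirlCriterion.lean`) is PROVED in the tree by
the Navier–Stokes cell's `AxisymmetricKatoGlobal` line (Steps 1–4 of §2: reduction to a first singular time and a clean slab with a
smooth axisymmetric representative, the product cut-off, the Leray logarithmic Hardy inequality (Lemma 2.2), Lemma 2.1 and the
Chen–Fang–Zhang / Lei–Zhang elliptic bounds for `u_r/r`, the `η⁶`-weighted energy estimates of `Γ = ω_θ/r` and `Φ = ω_r/r` with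
the swirl source absorbed through (2.2), the key estimate, the Step-4 assembly `C(R) ≤ C R^{3/2} → 0` and ε-regularity) — until now
Summits-side only (`Summits/NavierStokesRegularity/NavierStokesRegularity/Theorems/AxisymmetricExtremalityAxisymmetricKatoGlobalStubSereginLogSwirlOrigin.lean`,
`seregin2022_logSwirl_regularAtOrigin_holds := stub_sereginLogSwirlOrigin`).  RE-HOMED into `Literature/` by the Hodge foundations
lane (`lit-hodgefound`, prover p20, generation 39) as SIX files: verbatim DECLARATION-LEVEL ports (the 312 declarations the
discharge needs, in dependency order; each Part header lists the declarations of its source module that are NOT carried) of 55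
Summits modules `Summits/NavierStokesRegularity/NavierStokesRegularity/Theorems/AxisymmetricExtremalityAxisymmetricKatoGlobalStub*.lean`,
namespaces `Summit.NavierStokesRegularity.NavierStokesRegularity.Theorems.AxisymmetricKatoGlobal{.EulerScaling,.Registered}` re-rooted
to `Literature.Analysis.SereginLogSwirlOrigin{.EulerScaling,.Registered}` (a root outside `Literature.Analysis.FluidPDE` on purpose:
namespace-prefix resolution would otherwise shadow the cone's lemmas by same-named `FluidPDE` lemmas); the sources' `local notation`
`ℝ³` is expanded textually; imports from `Literature/` and Mathlib only; no `sorry`, no new axiom, NO named fact (D-0026).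
PROVENANCE CONVENTION: docstrings are carried byte-for-byte; declarations the cell cites keep their cites; `[folklore]`-tagged and
untagged declarations (the cell's own lemmas) carry the Part's tag `[cite: <Key>, <loc> (source of the ARGUMENT this module
implements; this declaration is the cell's own lemma or plumbing, NOT a printed statement)]`, because the gate does not admit a
public Literature theorem without a cite tag.

THIS FILE (2 of 6) ports: …StubSereginLogSwirlOriginStep3StreamForm, …StubSereginLogSwirlOriginStep3SourcePhi, …StubSereginLogSwirlOriginLemma21LocalIdentity, …StubSereginLogSwirlOriginLemma21Local, …StubSereginLogSwirlOriginLemma21LocalCutoff, …StubSereginLogSwirlOriginStep3KeyUnconditional, …StubSereginLogSwirlOriginStep1CutoffPointwise, …StubSereginLogSwirlOriginStep1CutoffConstants.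
-/

noncomputable section

/-!
## Part 1 — port of `Summits/NavierStokesRegularity/NavierStokesRegularity/Theorems/AxisymmetricExtremalityAxisymmetricKatoGlobalStubSereginLogSwirlOriginStep3StreamForm.lean` (16 declarations kept)

# Seregin 2022, §2 Step 3: the stream form `A₃ = ∫⟪v, ∇(η⁶Φ) × ∇(v_r/r)⟫` of the source term of the
# `Φ`-equation, and the axisymmetric cross-product bound `|⟪v, ∇p × ∇q⟫| ≤ |v_θ| |∇p| |∇q|` —
# crux stmt-NavierStokesRegularity-15453 (`AxisymmetricExtremality.AxisymmetricKatoGlobal`), line registered, support for stub `stub_sereginLogSwirlOrigin`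

Support file (`--supports stmt-NavierStokesRegularity-15453`; theorems only, everything proved)
toward the registered stub `stub_sereginLogSwirlOrigin` = the named fact
`Literature.Analysis.FluidPDE.seregin2022_logSwirl_regularAtOrigin` (G. Seregin, J. Math. Fluid
Mech. 24 (2022), Paper 27 = arXiv:2201.00153, §2). In Step 3 (arXiv p. 6) the source
`ω·∇(v_r/r)` of the `Φ`-equation, paired with `Φη⁶`, is integrated by parts into
"`A₃ = ∫(v_θ(v_r/r),₃(Φη⁶),ᵣ − v_θ(v_r/r),ᵣ(Φη⁶),₃)dx`": only the azimuthal velocity `v_θ`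
survives, which is what makes the swirl condition (2.2) effective. This file gives the Cartesian
form of that computation:

* `integral_mul_fderiv_apply_curl_eq` (registered sub-goal) — **the stream form**: for `v ∈ C¹`,
  `f ∈ C¹_c`, `W ∈ C²`, `∫ f · DW[curl v] = ∫ ⟪v, ∇f × ∇W⟫` (the curl is self-adjoint,
  `integral_inner_curl_eq_integral_inner_curl`, and `curl (f∇W) = ∇f × ∇W`, `curl_smul_gradient'`);
* `abs_inner_cross_le_of_orthogonal_rotGen`, `abs_inner_cross_gradient_le` (registered sub-goal) —
  **only `v_θ` pairs with `∇p × ∇q`**: for axisymmetric scalars `p, q` (so `∇p, ∇q ⊥ Jx`,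
  `IsAxisymmetricScalar.fderiv_rotGen`) and any `u`, off the axis
  `|⟪u, ∇p × ∇q⟫| ≤ (|x₀u₁ − x₁u₀|/r)‖∇p‖‖∇q‖ = |u_θ|‖∇p‖‖∇q‖` (the polynomial identity
  `r²⟪u, a × b⟫ = ⟪Jx, u⟫⟪Jx, a × b⟫` for `a, b ⊥ Jx`, and `|⟪Jx, c⟫| ≤ r‖c‖`, `‖a × b‖ ≤ ‖a‖‖b‖`);
* tools: `det_gradient_eq_zero_of_isAxisymmetricScalar`, `contDiff_one_gradient'`,
  `curl_smul_gradient'`, and the real-arithmetic lemmas `near_axis_scalar`, `pointwise_scalar`,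
  `final_scalar` used by the `A₃` bound (`…Step3SourcePhi`); private copies of folklore
  coordinates/norm facts (`cross` coordinates, `⟪u,w⟫ = Σuᵢwᵢ`, `‖a × b‖ ≤ ‖a‖‖b‖`, Young).

## Mathlib / tree search

Tree: `integral_inner_curl_eq_integral_inner_curl`, `curl_smul`, `contDiff_curl`
(`VorticityCalculus`), `curl_gradient_eq_zero_holds`, `cross`, `norm_cross`, `crossCLM`
(`VectorCalculus`), `fderiv_eq_innerSL_gradient` (`BiotSavartCurlPair`), `curlCLM_smulRight_innerSL`
(`BiotSavartNewtonKernel`), `gradient_apply_eq_fderiv_single`, `norm_gradient_sq`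
(`AxisymGradientField`), `IsAxisymmetricScalar.fderiv_rotGen`, `rotGen_eq_sub_single`,
`swirl_eq_cylRadius_mul_swirlVelocity` (`SwirlTransportProofs`, `AxisymmetricEuler`); the
Lei–Zhang 2011 analogue `integral_mul_inner_gradient_eq_integral_inner_sub_cross`,
`curl_smul_gradient`, `abs_inner_sub_cross_gradient_le` (`LeiZhang2011Proofs`, there with a
compactly supported `ψ` and without axisymmetry). `lean search 'inner_cross_gradient|fderiv_apply_curl_eq'`:
no matches in this namespace (2026-08-17).

## References

* G. Seregin, J. Math. Fluid Mech. 24 (2022), Paper No. 27 = arXiv:2201.00153, §2 Step 3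
  (arXiv p. 6, the term `A₃`). [`Seregin2022LocalAxisym`]
-/

section Part1

open _root_.MeasureTheory _root_.Set _root_.Filter _root_.Topology _root_.Function _root_.Metric
open scoped _root_.ENNReal _root_.ContDiff RealInnerProductSpace
open Literature.Analysis.FluidPDE

namespace Literature.Analysis.SereginLogSwirlOrigin.EulerScaling

/-! ### The stream form of `A₃` -/

section Stream

variable {v : EuclideanSpace ℝ (Fin 3) → EuclideanSpace ℝ (Fin 3)} {f W : EuclideanSpace ℝ (Fin 3) → ℝ}

/-- `∇W ∈ C¹` for `W ∈ C²` (Riesz isometry after `D`). [folklore]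
[cite: Seregin2022LocalAxisym, §2 proof of Thm. 1.2, Step 3 (arXiv:2201.00153 pp. 4–7) (source of the ARGUMENT this module implements; this declaration is the cell’s own lemma or plumbing, NOT a printed statement)] -/
theorem contDiff_one_gradient' (hW : ContDiff ℝ 2 W) : ContDiff ℝ 1 (gradient W) :=
  (InnerProductSpace.toDual ℝ (EuclideanSpace ℝ (Fin 3))).symm.contDiff.comp
    (hW.fderiv_right (m := 1) (by norm_num))

/-- `DW(x) w = ⟪∇W(x), w⟫`. [folklore] -/
private theorem fderiv_apply_eq_inner_gradient (W : EuclideanSpace ℝ (Fin 3) → ℝ) (x w : EuclideanSpace ℝ (Fin 3)) :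
    fderiv ℝ W x w = ⟪gradient W x, w⟫ := by
  rw [fderiv_eq_innerSL_gradient]; rfl

/-- **`curl (f ∇W) = ∇f × ∇W`** at every point, for `f` differentiable and `W ∈ C²`
(`curl (φ F) = φ curl F + ∇φ × F`, `curl ∇W = 0`). [folklore]
[cite: Seregin2022LocalAxisym, §2 proof of Thm. 1.2, Step 3 (arXiv:2201.00153 pp. 4–7) (source of the ARGUMENT this module implements; this declaration is the cell’s own lemma or plumbing, NOT a printed statement)] -/
theorem curl_smul_gradient' (hf : Differentiable ℝ f) (hW : ContDiff ℝ 2 W) (x : EuclideanSpace ℝ (Fin 3)) :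
    curl (fun y => f y • gradient W y) x = cross (gradient f x) (gradient W x) := by
  have hgW : DifferentiableAt ℝ (gradient W) x :=
    ((contDiff_one_gradient' hW).differentiable one_ne_zero) x
  rw [curl_smul (hf x) hgW, curl_gradient_eq_zero_holds W hW x, smul_zero, zero_add,
    fderiv_eq_innerSL_gradient, curlCLM_smulRight_innerSL]

/-- **The stream form of Seregin's `A₃`** (arXiv:2201.00153 p. 6: the source `ω·∇(v_r/r)` of the
`Φ`-equation paired with `Φη⁶` becomes
`A₃ = ∫(v_θ(v_r/r),₃(Φη⁶),ᵣ − v_θ(v_r/r),ᵣ(Φη⁶),₃)dx` after integration by parts). Cartesian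
form: for `v ∈ C¹`, `f ∈ C¹_c` (`f = η⁶Φ`) and `W ∈ C²` (`W = v_r/r`),
`∫ f · DW[curl v] = ∫ ⟪v, ∇f × ∇W⟫` (the curl is self-adjoint,
`integral_inner_curl_eq_integral_inner_curl`, and `curl (f∇W) = ∇f × ∇W`).
[cite: Seregin2022LocalAxisym, §2 Step 3 (arXiv:2201.00153 p. 6, the term A₃)] -/
theorem integral_mul_fderiv_apply_curl_eq : ∀ (v : EuclideanSpace ℝ (Fin 3) → EuclideanSpace ℝ (Fin 3)) (f W : EuclideanSpace ℝ (Fin 3) → ℝ), ContDiff ℝ 1 v → ContDiff ℝ 1 f → HasCompactSupport f → ContDiff ℝ 2 W → ∫ x, f x * fderiv ℝ W x (curl v x) = ∫ x, inner ℝ (v x) (cross (gradient f x) (gradient W x)) := by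
  intro v f W hv hf hfc hW
  have hΨ : ContDiff ℝ 1 fun y => f y • gradient W y := hf.smul (contDiff_one_gradient' hW)
  have hΨc : HasCompactSupport fun y => f y • gradient W y := hfc.smul_right
  have h := integral_inner_curl_eq_integral_inner_curl hv hΨ hΨc
  have hL : ∫ x, f x * fderiv ℝ W x (curl v x) = ∫ x, ⟪curl v x, f x • gradient W x⟫ :=
    integral_congr_ae (Eventually.of_forall fun x => by
      simp only
      rw [real_inner_smul_right, fderiv_apply_eq_inner_gradient, real_inner_comm])
  rw [hL, h]
  exact integral_congr_ae (Eventually.of_forall fun x => by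
    simp only
    rw [curl_smul_gradient' (hf.differentiable one_ne_zero) hW x])

end Stream

/-! ### The axisymmetric cross product: only `v_θ` pairs with `∇p × ∇q` -/

section Cross

/-- Coordinates of the cross product. [folklore] -/
private theorem cross_apply_coords (a b : EuclideanSpace ℝ (Fin 3)) :
    cross a b 0 = a 1 * b 2 - a 2 * b 1 ∧ cross a b 1 = a 2 * b 0 - a 0 * b 2 ∧
      cross a b 2 = a 0 * b 1 - a 1 * b 0 := by
  refine ⟨?_, ?_, ?_⟩ <;> simp [cross, cross_apply]

/-- `⟪u, w⟫ = u₀w₀ + u₁w₁ + u₂w₂` on `ℝ³`. [folklore] -/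
private theorem real_inner_eq_sum_three (u w : EuclideanSpace ℝ (Fin 3)) :
    ⟪u, w⟫ = u 0 * w 0 + u 1 * w 1 + u 2 * w 2 := by
  simp only [PiLp.inner_apply, Fin.sum_univ_three, RCLike.inner_apply, conj_trivial]
  ring

/-- `‖a × b‖ ≤ ‖a‖‖b‖`. [folklore] -/
private theorem norm_cross_le (a b : EuclideanSpace ℝ (Fin 3)) : ‖cross a b‖ ≤ ‖a‖ * ‖b‖ := by
  rw [norm_cross]
  exact mul_le_of_le_one_right (mul_nonneg (norm_nonneg _) (norm_nonneg _)) (Real.sin_le_one _)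

/-- `‖w‖² = w₀² + w₁² + w₂²` on `ℝ³`. [folklore] -/
private theorem norm_sq_eq_sum_three' (w : EuclideanSpace ℝ (Fin 3)) :
    ‖w‖ ^ 2 = w 0 ^ 2 + w 1 ^ 2 + w 2 ^ 2 := by
  rw [EuclideanSpace.norm_eq, Real.sq_sqrt (by positivity), Fin.sum_univ_three]
  simp only [Real.norm_eq_abs, sq_abs]

/-- `|x₀w₁ − x₁w₀| ≤ r ‖w‖` (planar Cauchy–Schwarz, `r = cylRadius x`). [folklore] -/
private theorem abs_det_le_cylRadius_mul_norm (x w : EuclideanSpace ℝ (Fin 3)) :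
    |x 0 * w 1 - x 1 * w 0| ≤ cylRadius x * ‖w‖ := by
  have hw : w 0 ^ 2 + w 1 ^ 2 ≤ ‖w‖ ^ 2 := by
    rw [norm_sq_eq_sum_three']; nlinarith [sq_nonneg (w 2)]
  have hr : cylRadius x ^ 2 = x 0 ^ 2 + x 1 ^ 2 := (sq_add_sq_eq_cylRadius_sq x).symm
  have h2 : (x 0 * w 1 - x 1 * w 0) ^ 2 ≤ (x 0 ^ 2 + x 1 ^ 2) * (w 0 ^ 2 + w 1 ^ 2) := by
    nlinarith [sq_nonneg (x 0 * w 0 + x 1 * w 1)]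
  have hnn : 0 ≤ cylRadius x * ‖w‖ := mul_nonneg (cylRadius_nonneg x) (norm_nonneg w)
  have h3 : (x 0 * w 1 - x 1 * w 0) ^ 2 ≤ (cylRadius x * ‖w‖) ^ 2 := by
    rw [mul_pow, hr]
    exact h2.trans (mul_le_mul_of_nonneg_left hw (by positivity))
  exact abs_le.2 (abs_le_of_sq_le_sq' h3 hnn)

/-- **Only the azimuthal component pairs with `∇p × ∇q`.** If `a, b ∈ ℝ³` are orthogonal to the
rotation generator `Jx = (−x₁, x₀, 0)` (`x₀a₁ − x₁a₀ = 0`, likewise `b`; e.g. gradients of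
axisymmetric scalars, `IsAxisymmetricScalar.fderiv_rotGen`), then `a × b ∥ Jx`, so for every `u`,
`r²⟪u, a × b⟫ = ⟪Jx, u⟫⟪Jx, a × b⟫` and hence, off the axis,
`|⟪u, a × b⟫| ≤ (|x₀u₁ − x₁u₀|/r) ‖a‖‖b‖ = |u_θ| ‖a‖‖b‖`. [folklore]
[cite: Seregin2022LocalAxisym, §2 proof of Thm. 1.2, Step 3 (arXiv:2201.00153 pp. 4–7) (source of the ARGUMENT this module implements; this declaration is the cell’s own lemma or plumbing, NOT a printed statement)] -/
theorem abs_inner_cross_le_of_orthogonal_rotGen (u a b x : EuclideanSpace ℝ (Fin 3))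
    (hr : cylRadius x ≠ 0) (ha : x 0 * a 1 - x 1 * a 0 = 0) (hb : x 0 * b 1 - x 1 * b 0 = 0) :
    |⟪u, cross a b⟫| ≤ |x 0 * u 1 - x 1 * u 0| / cylRadius x * (‖a‖ * ‖b‖) := by
  obtain ⟨hc0, hc1, hc2⟩ := cross_apply_coords a b
  set c := cross a b with hc
  have hrpos : 0 < cylRadius x := lt_of_le_of_ne (cylRadius_nonneg x) (Ne.symm hr)
  have hr2 : cylRadius x ^ 2 = x 0 ^ 2 + x 1 ^ 2 := (sq_add_sq_eq_cylRadius_sq x).symm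
  -- the key polynomial identity
  have hkey : (x 0 ^ 2 + x 1 ^ 2) * ⟪u, c⟫ = (x 0 * u 1 - x 1 * u 0) * (x 0 * c 1 - x 1 * c 0) := by
    rw [real_inner_eq_sum_three, hc0, hc1, hc2]
    linear_combination ((x 0 * u 0 + x 1 * u 1) * b 2 - u 2 * (x 0 * b 0 + x 1 * b 1)) * ha +
      (-(x 0 * u 0 + x 1 * u 1) * a 2 + u 2 * (x 0 * a 0 + x 1 * a 1)) * hb
  have hdet := abs_det_le_cylRadius_mul_norm x c
  have hcn : ‖c‖ ≤ ‖a‖ * ‖b‖ := norm_cross_le a b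
  have h1 : cylRadius x ^ 2 * |⟪u, c⟫| ≤ |x 0 * u 1 - x 1 * u 0| * (cylRadius x * (‖a‖ * ‖b‖)) := by
    have := congrArg (fun z => |z|) hkey
    simp only [abs_mul] at this
    rw [← hr2, abs_of_nonneg (sq_nonneg _)] at this
    rw [this]
    exact mul_le_mul_of_nonneg_left (hdet.trans (mul_le_mul_of_nonneg_left hcn hrpos.le)) (abs_nonneg _)
  rw [div_mul_eq_mul_div, le_div_iff₀ hrpos]
  nlinarith [h1, hrpos, abs_nonneg ⟪u, c⟫]

/-- For an axisymmetric scalar `p` differentiable at `x`, `∇p(x) ⊥ Jx`: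
`x₀ ∂₁p − x₁ ∂₀p = 0`. [folklore]
[cite: Seregin2022LocalAxisym, §2 proof of Thm. 1.2, Step 3 (arXiv:2201.00153 pp. 4–7) (source of the ARGUMENT this module implements; this declaration is the cell’s own lemma or plumbing, NOT a printed statement)] -/
theorem det_gradient_eq_zero_of_isAxisymmetricScalar {p : EuclideanSpace ℝ (Fin 3) → ℝ}
    (hp : IsAxisymmetricScalar p) {x : EuclideanSpace ℝ (Fin 3)} (hd : DifferentiableAt ℝ p x) :
    x 0 * gradient p x 1 - x 1 * gradient p x 0 = 0 := by
  have h := hp.fderiv_rotGen hd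
  rw [rotGen_eq_sub_single, map_sub, map_smul, map_smul, smul_eq_mul, smul_eq_mul] at h
  rw [gradient_apply_eq_fderiv_single, gradient_apply_eq_fderiv_single]
  linarith

/-- **The pointwise bound for the `A₃`-type integrands**: for axisymmetric scalars `p, q`
differentiable at an off-axis point `x` and any field value `u`,
`|⟪u, ∇p(x) × ∇q(x)⟫| ≤ (|swirl|/r) ‖∇p(x)‖ ‖∇q(x)‖` (`swirl = x₀u₁ − x₁u₀ = r u_θ`). [folklore]
[cite: Seregin2022LocalAxisym, §2 proof of Thm. 1.2, Step 3 (arXiv:2201.00153 pp. 4–7) (source of the ARGUMENT this module implements; this declaration is the cell’s own lemma or plumbing, NOT a printed statement)] -/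
theorem abs_inner_cross_gradient_le : ∀ (p q : EuclideanSpace ℝ (Fin 3) → ℝ) (x u : EuclideanSpace ℝ (Fin 3)), IsAxisymmetricScalar p → IsAxisymmetricScalar q → cylRadius x ≠ 0 → DifferentiableAt ℝ p x → DifferentiableAt ℝ q x → |inner ℝ u (cross (gradient p x) (gradient q x))| ≤ |x 0 * u 1 - x 1 * u 0| / cylRadius x * (‖gradient p x‖ * ‖gradient q x‖) :=
  fun _ _ x u hp hq hr hpd hqd => abs_inner_cross_le_of_orthogonal_rotGen u _ _ x hr
    (det_gradient_eq_zero_of_isAxisymmetricScalar hp hpd)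
    (det_gradient_eq_zero_of_isAxisymmetricScalar hq hqd)

end Cross

/-! ### The real arithmetic of the `A₃` bound -/

section Scalars

variable {u : EuclideanSpace ℝ (Fin 3) → EuclideanSpace ℝ (Fin 3)} {ζ : EuclideanSpace ℝ (Fin 3) → ℝ}

/-- Young: `P a ≤ ε a² + P²/(4ε)` for `ε > 0`. [folklore] -/
private theorem mul_le_eps_sq_add (P a : ℝ) {ε : ℝ} (hε : 0 < ε) : P * a ≤ ε * a ^ 2 + P ^ 2 / (4 * ε) := by
  have h : 0 ≤ ε * (a - P / (2 * ε)) ^ 2 := by positivity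
  have h2 : ε * (a - P / (2 * ε)) ^ 2 = ε * a ^ 2 - P * a + P ^ 2 / (4 * ε) := by
    field_simp
    ring
  linarith [h, h2]

/-- The near-axis scalar step: `|v_θ| ≤ C₁/(rL³)`, `L ≥ L₁` give
`|v_θ| a b ≤ (C₁/(2L₁²))(a² + (b/(rL))²)`. [folklore]
[cite: Seregin2022LocalAxisym, §2 proof of Thm. 1.2, Step 3 (arXiv:2201.00153 pp. 4–7) (source of the ARGUMENT this module implements; this declaration is the cell’s own lemma or plumbing, NOT a printed statement)] -/
theorem near_axis_scalar {s a b C₁ r L L₁ : ℝ} (hs : s ≤ C₁ / (r * L ^ 3)) (hr : 0 < r)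
    (hL₁ : 0 < L₁) (hLL : L₁ ≤ L) (hC : 0 ≤ C₁) (ha : 0 ≤ a) (hb : 0 ≤ b) :
    s * (a * b) ≤ C₁ / (2 * L₁ ^ 2) * a ^ 2 + C₁ / (2 * L₁ ^ 2) * (b / (r * L)) ^ 2 := by
  have hL : 0 < L := by linarith
  have step1 : s * (a * b) ≤ C₁ / (r * L ^ 3) * (a * b) :=
    mul_le_mul_of_nonneg_right hs (by positivity)
  have step2 : C₁ / (r * L ^ 3) * (a * b) = (C₁ / L ^ 2) * (a * (b / (r * L))) := by
    field_simp
  have step3 : C₁ / L ^ 2 ≤ C₁ / L₁ ^ 2 :=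
    div_le_div_of_nonneg_left hC (by positivity) (pow_le_pow_left₀ hL₁.le hLL 2)
  have step4 : a * (b / (r * L)) ≤ (a ^ 2 + (b / (r * L)) ^ 2) / 2 := by
    nlinarith [sq_nonneg (a - b / (r * L))]
  calc s * (a * b) ≤ C₁ / (r * L ^ 3) * (a * b) := step1
    _ = (C₁ / L ^ 2) * (a * (b / (r * L))) := step2
    _ ≤ (C₁ / L₁ ^ 2) * ((a ^ 2 + (b / (r * L)) ^ 2) / 2) :=
        mul_le_mul step3 step4 (by positivity) (by positivity)
    _ = _ := by ring

/-- The pointwise combination of the three `A₃`-terms (pure real arithmetic). [folklore]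
[cite: Seregin2022LocalAxisym, §2 proof of Thm. 1.2, Step 3 (arXiv:2201.00153 pp. 4–7) (source of the ARGUMENT this module implements; this declaration is the cell’s own lemma or plumbing, NOT a printed statement)] -/
theorem pointwise_scalar {t0 t1 t2 s a b nz nw w z P₀ P₁ P₂ K q ε : ℝ}
    (h0 : |t0| ≤ s * (a * b)) (h1 : |t1| ≤ s * (a * nz)) (h2 : |t2| ≤ s * (nz * nw))
    (hP1 : |w| * s * nz ≤ P₁) (hP2 : |z| * s * (nz * nw) ≤ P₂) (hε : 0 < ε) (ha : 0 ≤ a)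
    (hK : 0 ≤ K) (hq : 0 ≤ q)
    (hcase : s * (a * b) ≤ K * a ^ 2 + K * q ∨ s * b ≤ P₀) :
    |t0 - w * t1 + z * t2| ≤ (K + 2 * ε) * a ^ 2 + K * q + ((P₀ ^ 2 + P₁ ^ 2) / (4 * ε) + P₂) := by
  have hY1 : P₁ * a ≤ ε * a ^ 2 + P₁ ^ 2 / (4 * ε) := mul_le_eps_sq_add P₁ a hε
  have hY0 : P₀ * a ≤ ε * a ^ 2 + P₀ ^ 2 / (4 * ε) := mul_le_eps_sq_add P₀ a hε
  have hwt1 : |w * t1| ≤ P₁ * a := by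
    rw [abs_mul]
    calc |w| * |t1| ≤ |w| * (s * (a * nz)) := mul_le_mul_of_nonneg_left h1 (abs_nonneg _)
      _ = (|w| * s * nz) * a := by ring
      _ ≤ P₁ * a := mul_le_mul_of_nonneg_right hP1 ha
  have hzt2 : |z * t2| ≤ P₂ := by
    rw [abs_mul]
    calc |z| * |t2| ≤ |z| * (s * (nz * nw)) := mul_le_mul_of_nonneg_left h2 (abs_nonneg _)
      _ = |z| * s * (nz * nw) := by ring
      _ ≤ P₂ := hP2
  have ht0 : |t0| ≤ (K + ε) * a ^ 2 + K * q + P₀ ^ 2 / (4 * ε) := by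
    rcases hcase with hnear | hfar
    · have : 0 ≤ ε * a ^ 2 := by positivity
      have : 0 ≤ P₀ ^ 2 / (4 * ε) := by positivity
      nlinarith [h0, hnear]
    · have hfa : s * (a * b) ≤ P₀ * a := by
        calc s * (a * b) = (s * b) * a := by ring
          _ ≤ P₀ * a := mul_le_mul_of_nonneg_right hfar ha
      have : 0 ≤ K * a ^ 2 := by positivity
      have : 0 ≤ K * q := by positivity
      linarith [h0, hfa, hY0]
  have htri : |t0 - w * t1 + z * t2| ≤ |t0| + |w * t1| + |z * t2| := by
    have := abs_add_le (t0 - w * t1) (z * t2)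
    have := abs_sub t0 (w * t1)
    linarith
  have hP0nn : 0 ≤ P₀ ^ 2 / (4 * ε) := by positivity
  have hsplit : (P₀ ^ 2 + P₁ ^ 2) / (4 * ε) = P₀ ^ 2 / (4 * ε) + P₁ ^ 2 / (4 * ε) := add_div _ _ _
  linarith [htri, ht0, hwt1, hzt2, hY1, hsplit]

/-- The final combination of the integrated bounds (pure real arithmetic). [folklore]
[cite: Seregin2022LocalAxisym, §2 proof of Thm. 1.2, Step 3 (arXiv:2201.00153 pp. 4–7) (source of the ARGUMENT this module implements; this declaration is the cell’s own lemma or plumbing, NOT a printed statement)] -/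
theorem final_scalar {I J DΦ DΓ Qs V C₁ L₁ ε cL CL P₀ P₁ P₂ : ℝ}
    (hJI : J ≤ I)
    (hI : I ≤ (C₁ / (2 * L₁ ^ 2) + 2 * ε) * DΦ + C₁ / (2 * L₁ ^ 2) * Qs +
      ((P₀ ^ 2 + P₁ ^ 2) / (4 * ε) + P₂) * V)
    (hQs : Qs ≤ 4 * (cL * DΓ + CL)) (hC : 0 ≤ C₁) (hL₁ : 0 < L₁) (hε : 0 < ε) (hcL : 0 ≤ cL)
    (hDΦ : 0 ≤ DΦ) (hDΓ : 0 ≤ DΓ) :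
    2 * J ≤ (C₁ * (1 + 4 * cL) / L₁ ^ 2 + 4 * ε) * (DΓ + DΦ) +
      (4 * C₁ * CL / L₁ ^ 2 + ((P₀ ^ 2 + P₁ ^ 2) / (2 * ε) + 2 * P₂) * V) := by
  have hK : 0 ≤ C₁ / (2 * L₁ ^ 2) := by positivity
  have h1 : C₁ / (2 * L₁ ^ 2) * Qs ≤ C₁ / (2 * L₁ ^ 2) * (4 * (cL * DΓ + CL)) :=
    mul_le_mul_of_nonneg_left hQs hK
  have h2 : 2 * ((C₁ / (2 * L₁ ^ 2) + 2 * ε) * DΦ) ≤ (C₁ * (1 + 4 * cL) / L₁ ^ 2 + 4 * ε) * DΦ := by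
    have : 2 * (C₁ / (2 * L₁ ^ 2) + 2 * ε) ≤ C₁ * (1 + 4 * cL) / L₁ ^ 2 + 4 * ε := by
      have : 0 ≤ C₁ * cL / L₁ ^ 2 := by positivity
      have e1 : 2 * (C₁ / (2 * L₁ ^ 2) + 2 * ε) = C₁ / L₁ ^ 2 + 4 * ε := by field_simp; ring
      have e2 : C₁ * (1 + 4 * cL) / L₁ ^ 2 = C₁ / L₁ ^ 2 + 4 * (C₁ * cL / L₁ ^ 2) := by
        field_simp
      rw [e1, e2]; linarith
    calc 2 * ((C₁ / (2 * L₁ ^ 2) + 2 * ε) * DΦ) = (2 * (C₁ / (2 * L₁ ^ 2) + 2 * ε)) * DΦ := by ring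
      _ ≤ _ := mul_le_mul_of_nonneg_right this hDΦ
  have h3 : 2 * (C₁ / (2 * L₁ ^ 2) * (4 * (cL * DΓ + CL))) =
      4 * (C₁ * cL / L₁ ^ 2) * DΓ + 4 * C₁ * CL / L₁ ^ 2 := by
    field_simp
  have h4 : 4 * (C₁ * cL / L₁ ^ 2) * DΓ ≤ (C₁ * (1 + 4 * cL) / L₁ ^ 2 + 4 * ε) * DΓ := by
    have : 4 * (C₁ * cL / L₁ ^ 2) ≤ C₁ * (1 + 4 * cL) / L₁ ^ 2 + 4 * ε := by
      have e2 : C₁ * (1 + 4 * cL) / L₁ ^ 2 = C₁ / L₁ ^ 2 + 4 * (C₁ * cL / L₁ ^ 2) := by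
        field_simp
      have : 0 ≤ C₁ / L₁ ^ 2 := by positivity
      rw [e2]; linarith
    exact mul_le_mul_of_nonneg_right this hDΓ
  have h5 : 2 * (((P₀ ^ 2 + P₁ ^ 2) / (4 * ε) + P₂) * V) = ((P₀ ^ 2 + P₁ ^ 2) / (2 * ε) + 2 * P₂) * V := by
    field_simp; ring
  nlinarith [hJI, hI, h1, h2, h3, h4, h5]

end Scalars

end Literature.Analysis.SereginLogSwirlOrigin.EulerScaling

end Part1

/-!
## Part 2 — port of `Summits/NavierStokesRegularity/NavierStokesRegularity/Theorems/AxisymmetricExtremalityAxisymmetricKatoGlobalStubSereginLogSwirlOriginStep3SourcePhi.lean` (3 declarations kept)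

# Seregin 2022, §2 Step 3: the bound of `A₃ = ∫ η⁶Φ ω·∇(v_r/r)` by the swirl decay (2.2), the
# log-Hardy inequality (Lemma 2.2) and Lemma 2.1 (ii) (numeric), with explicit constants —
# crux stmt-NavierStokesRegularity-15453 (`AxisymmetricExtremality.AxisymmetricKatoGlobal`), line registered, support for stub `stub_sereginLogSwirlOrigin`

Support file (`--supports stmt-NavierStokesRegularity-15453`; theorems only, everything proved)
toward the registered stub `stub_sereginLogSwirlOrigin` = the named fact
`Literature.Analysis.FluidPDE.seregin2022_logSwirl_regularAtOrigin` (G. Seregin, J. Math. Fluid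
Mech. 24 (2022), Paper 27 = arXiv:2201.00153, §2). Step 3, arXiv pp. 6–7: `A₃ = A₃₁ + A₃₂`,
`A₃₁ = A₀ + A'₃₁` with `A₀ = ∫(v_θ(η³v_r/r),₃(η³Φ),ᵣ − v_θ(η³v_r/r),ᵣ(η³Φ),₃)`,
"`A'₃₁ ≤ C(v,η)‖∇(η³Φ)‖`", "`A₀ ≤ cC₁²(∫ (1/(r²ln⁶(e/|x'|)))(|(η³v_r/r),₃|² + |(η³v_r/r),ᵣ|²))^{1/2}
‖∇(η³Φ)‖ ≤ (cC₁²/ln⁴(e/|r₁|))(∫(1/(r²ln²))(…))^{1/2}‖∇(η³Φ)‖ + C(v,η,r₁)` … we again apply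
Lemma 2.2 … It remains to take into account the statement of Lemma 2.1 and conclude
`A₀ ≤ (cC₁²/ln⁴(e/|r₁|))‖η³∇Γ‖‖η³∇Φ‖ + C(v,η,r₁)(‖η³∇Γ‖ + ‖η³∇Φ‖) + C(v,η,r₁)`",
"`A₃₂ ≤ C(v,η)`".

* `two_mul_integral_sourcePhi_le` (registered sub-goal) — **the `A₃` bound** at a fixed time, for an
  axisymmetric `u ∈ C⁴` (`W = v_r/r = radVelQuot u`, `Φ = ω_r/r = radVelQuot (curl u)`,
  `Γ = ω_θ/r = angVortQuot u`, `v_θ = swirlVelocity u`) and an axisymmetric cut-off `ζ = η³ ∈ C²`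
  supported in `𝒞 = spaceCyl 0 1`, in the form consumed by `cutoff_energy_apriori`
  (`…Step3Absorb`): for every `ε > 0`,
  `2∫ζ²Φ DW[ω] ≤ (C₁(1 + 4c_L)/ln²(e/r₁) + 4ε)(∫|∇(ζΓ)|² + ∫|∇(ζΦ)|²)
    + 4C₁C_L/ln²(e/r₁) + ((P₀² + P₁²)/(2ε) + 2P₂)|B(0,2)|`.
  Route: the stream form `∫ζ²Φ DW[ω] = ∫⟪u, ∇(ζ·ζΦ) × ∇W⟫` (`…Step3StreamForm`) and the
  decomposition `∇(ζ·ζΦ) × ∇W = ∇(ζΦ) × ∇(ζW) − W ∇(ζΦ) × ∇ζ + (ζΦ) ∇ζ × ∇W` (`A₀, A'₃₁, A₃₂`);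
  a.e. (off the axis) only `v_θ` pairs with each cross product (`abs_inner_cross_gradient_le`);
  near the axis (2.2) gives `|v_θ| ≤ C₁/(r ln³(e/r))` (`abs_swirlVelocity_le_of_swirl_le`), so
  `|v_θ||∇(ζΦ)||∇(ζW)| ≤ (C₁/(2ln²(e/r₁)))(|∇(ζΦ)|² + |∇(ζW)|²/(r²ln²(e/r)))`; away from it and on
  `supp ∇ζ` the pointwise bounds `P₀ ≥ |v_θ||∇(ζW)|` (`r ≥ r₁`), `P₁ ≥ |W||v_θ||∇ζ|`,
  `P₂ ≥ |ζΦ||v_θ||∇ζ||∇W|` (the paper's `C(v,η,r₁)`) and Young; Lemma 2.2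
  (`integrable_and_integral_sq_div_logWeight_le`) on the components `∂ᵢ(ζW)` gives
  `∫|∇(ζW)|²/(r²ln²) ≤ 4∫|∇²(ζW)|²`, and Lemma 2.1 (ii) enters as the numeric hypothesis
  `∫|∇²(ζW)|² ≤ c_L∫|∇(ζΓ)|² + C_L` (its printed form `‖∇̄²(η³v_r/r)‖ ≤ c‖η³Γ,₃‖ + C`, squared;
  global core `eLpNorm_fderiv_fderiv_radVelQuot_le_eLpNorm_fderiv_angVortQuot`, `…CFZBounds`).

With `…Step3Absorb` this closes Step 3 up to the two elementary constants `Bcut`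
(cut-off terms) and `P₀, P₁, P₂` and Lemma 2.1 (ii) in localised form.

## Mathlib / tree search

Tree: `integral_mul_fderiv_apply_curl_eq`, `abs_inner_cross_gradient_le`, `near_axis_scalar`,
`pointwise_scalar`, `final_scalar` (`…Step3StreamForm`), private copies of `‖∇g‖ = ‖Dg‖`,
`∇(pq) = p∇q + q∇p` (`norm_gradient_eq_norm_fderiv`, `Seregin2020.gradient_mul_apply'` in the tree), `log_exp_div_eq` (`…Step3SwirlSource`),
`integrable_and_integral_sq_div_logWeight_le`, `spaceCyl_subset_closedBall` (`…LerayLogHardy`),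
`abs_swirlVelocity_le_of_swirl_le` (`…Step13Tools`), `hasCompactSupport_of_eq_zero`,
`continuous_fderiv_apply_of_contDiff` (`…Step3CutoffCalculus`), `norm_gradient_sq`,
`contDiff_radVelQuot / angVortQuot`, `IsAxisymmetric.isAxisymmetricScalar_radVelQuot`, `.curl`,
`volume_setOf_cylRadius_eq_zero`. Mathlib: `integral_mono_ae`, `abs_integral_le_integral_abs`,
`integral_indicator_one`, `tsupport_fderiv_apply_subset`, `tsupport_mul_subset_left`,
`fderiv_of_notMem_tsupport`. `lean search 'sourcePhi'`: no matches (2026-08-17).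

## References

* G. Seregin, J. Math. Fluid Mech. 24 (2022), Paper No. 27 = arXiv:2201.00153, §2 Step 3
  (arXiv pp. 6–7, the estimates of `A₀`, `A'₃₁`, `A₃₂`). [`Seregin2022LocalAxisym`]
-/

section Part2

open _root_.MeasureTheory _root_.Set _root_.Filter _root_.Topology _root_.Function _root_.Metric
open scoped _root_.ENNReal _root_.ContDiff RealInnerProductSpace
open Literature.Analysis.FluidPDE

namespace Literature.Analysis.SereginLogSwirlOrigin.EulerScaling

section A3

/-- `‖∇g(x)‖ = ‖Dg(x)‖`. [folklore] -/
private theorem norm_gradient_eq_norm_fderiv' (g : EuclideanSpace ℝ (Fin 3) → ℝ) (x : EuclideanSpace ℝ (Fin 3)) :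
    ‖gradient g x‖ = ‖fderiv ℝ g x‖ := by
  rw [gradient, LinearIsometryEquiv.norm_map]

/-- `∇(pq) = p∇q + q∇p`. [folklore] -/
private theorem gradient_mul_apply {p q : EuclideanSpace ℝ (Fin 3) → ℝ} {x : EuclideanSpace ℝ (Fin 3)}
    (hp : DifferentiableAt ℝ p x) (hq : DifferentiableAt ℝ q x) :
    gradient (fun y => p y * q y) x = p x • gradient q x + q x • gradient p x := by
  simp only [gradient, fderiv_fun_mul hp hq, map_add, map_smul]

set_option maxHeartbeats 800000 in
/-- **Seregin 2022, §2 Step 3, the bound of `A₃`** (arXiv pp. 6–7: `A₃ = A₃₁ + A₃₂`,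
`A₃₁ = A₀ + A'₃₁`, "`A₀ ≤ (cC₁²/ln⁴(e/r₁))(‖∇_{x'}(η³v_r/r),₃‖² + ‖∇_{x'}(η³v_r/r),ᵣ‖²)^{1/2}
‖∇(η³Φ)‖ + C(v,η,r₁)` … It remains to take into account the statement of Lemma 2.1 and conclude
`A₃ ≤ (cC₁²/ln⁴(e/r₁))‖η³∇Γ‖‖η³∇Φ‖ + C(v,η,r₁)(‖η³∇Γ‖ + ‖η³∇Φ‖) + C(v,η,r₁)`"), at a fixed
time, with explicit constants, in the form consumed by `cutoff_energy_apriori`. For an axisymmetric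
`u ∈ C⁴` (`W = v_r/r = radVelQuot u`, `Φ = ω_r/r = radVelQuot (curl u)`, `Γ = ω_θ/r = angVortQuot u`,
`v_θ = swirlVelocity u`) and an axisymmetric cut-off `ζ = η³ ∈ C²` supported in `𝒞`:
by the stream form `A₃ = ∫⟪u, ∇(ζ²Φ) × ∇W⟫` and `∇(ζ²Φ) × ∇W = ∇(ζΦ) × ∇(ζW) − W∇(ζΦ) × ∇ζ
+ (ζΦ)∇ζ × ∇W` (`= A₀ + A'₃₁ + A₃₂`), where only `v_θ` pairs with each cross product
(`abs_inner_cross_gradient_le`); near the axis (2.2) gives `|v_θ| ≤ C₁/(r ln³(e/r))` and Lemma 2.2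
applied to the components of `∇(ζW)` brings in `∫|∇²(ζW)|²`, bounded by Lemma 2.1 (ii) taken as
the numeric hypothesis `∫|∇²(ζW)|² ≤ c_L ∫|∇(ζΓ)|² + C_L` (its printed form
`‖∇̄²(η³v_r/r)‖ ≤ c‖η³Γ,₃‖ + C`, squared); away from the axis and on `supp ∇ζ` the pointwise
bounds `P₀, P₁, P₂` (the paper's `C(v,η,r₁)`: boundedness of `v, ∇v, ∇²v` there). Result:
`2A₃ ≤ (C₁(1 + 4c_L)/ln²(e/r₁) + 4ε)(∫|∇(ζΓ)|² + ∫|∇(ζΦ)|²)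
  + 4C₁C_L/ln²(e/r₁) + ((P₀² + P₁²)/(2ε) + 2P₂)|B(0,2)|` for every `ε > 0`.
[cite: Seregin2022LocalAxisym, §2 Step 3 (arXiv:2201.00153 pp. 6–7, the estimates of A₀, A'₃₁, A₃₂)] -/
theorem two_mul_integral_sourcePhi_le : ∀ (u : EuclideanSpace ℝ (Fin 3) → EuclideanSpace ℝ (Fin 3)) (ζ : EuclideanSpace ℝ (Fin 3) → ℝ) (C₁ r₁ ε P₀ P₁ P₂ cL CL : ℝ), IsAxisymmetric u → ContDiff ℝ 4 u → ContDiff ℝ 2 ζ → IsAxisymmetricScalar ζ → tsupport ζ ⊆ SereginSverak2009.spaceCyl 0 1 → 0 ≤ C₁ → 0 < r₁ → r₁ < 1 → 0 < ε → 0 ≤ P₂ → 0 ≤ cL → (∀ x, 0 < cylRadius x → cylRadius x < r₁ → |swirl u x| ≤ C₁ / Real.log (Real.exp 1 / cylRadius x) ^ 3) → (∀ x, r₁ ≤ cylRadius x → |swirlVelocity u x| * ‖fderiv ℝ (fun y => ζ y * radVelQuot u y) x‖ ≤ P₀) → (∀ x, |radVelQuot u x| * |swirlVelocity u x| * ‖fderiv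 ℝ ζ x‖ ≤ P₁) → (∀ x, |ζ x * radVelQuot (curl u) x| * |swirlVelocity u x| * (‖fderiv ℝ ζ x‖ * ‖fderiv ℝ (radVelQuot u) x‖) ≤ P₂) → (∫ x, ∑ i : Fin 3, ∑ j : Fin 3, (fderiv ℝ (fun y => fderiv ℝ (fun y => ζ y * radVelQuot u y) y (EuclideanSpace.single i 1)) x (EuclideanSpace.single j 1)) ^ 2) ≤ cL * (∫ x, (fderiv ℝ (fun y => ζ y * angVortQuot u y) x (EuclideanSpace.single 0 1) ^ 2 + fderiv ℝ (fun y => ζ y * angVortQuot u y) x (EuclideanSpace.single 1 1) ^ 2 + fderiv ℝ (fun y => ζ y * angVortQuot u y) x (EuclideanSpace.single 2 1) ^ 2)) + CL → 2 * ∫ x, ζ x ^ 2 * radVelQuot (curl u) x * fderiv ℝ (radVelQuot u) x (curl u x) ≤ (C₁ * (1 + 4 * cL) / Real.log (Real.exp 1 / r₁) ^ 2 + 4 * ε) * ((∫ x, (fderiv ℝ (fun y => ζ y * angVortQuot u y) x (EuclideanSpace.single 0 1) ^ 2 + fderiv ℝ (fun y => ζ y * angVortQuot u y) x (EuclideanSpace.single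 1 1) ^ 2 + fderiv ℝ (fun y => ζ y * angVortQuot u y) x (EuclideanSpace.single 2 1) ^ 2)) + (∫ x, (fderiv ℝ (fun y => ζ y * radVelQuot (curl u) y) x (EuclideanSpace.single 0 1) ^ 2 + fderiv ℝ (fun y => ζ y * radVelQuot (curl u) y) x (EuclideanSpace.single 1 1) ^ 2 + fderiv ℝ (fun y => ζ y * radVelQuot (curl u) y) x (EuclideanSpace.single 2 1) ^ 2))) + (4 * C₁ * CL / Real.log (Real.exp 1 / r₁) ^ 2 + ((P₀ ^ 2 + P₁ ^ 2) / (2 * ε) + 2 * P₂) * volume.real (closedBall (0 : EuclideanSpace ℝ (Fin 3)) 2)) := by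
  intro u ζ C₁ r₁ ε P₀ P₁ P₂ cL CL hax hu hζ hζax hζs hC₁ hr₁ hr₁1 hε hP₂ hcL hσ hfar hP1 hP2 hL21
  -- regularity
  have hu1 : ContDiff ℝ 1 u := hu.of_le (by norm_num)
  have hu2 : ContDiff ℝ 2 u := hu.of_le (by norm_num)
  have hω : ContDiff ℝ 3 (curl u) := contDiff_curl (n := 3) (by exact_mod_cast hu)
  have hW : ContDiff ℝ 2 (radVelQuot u) := contDiff_radVelQuot (n := 2) (by exact_mod_cast hu)
  have hΦ : ContDiff ℝ 1 (radVelQuot (curl u)) := contDiff_radVelQuot (n := 1) (by exact_mod_cast hω)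
  have hΓ : ContDiff ℝ 1 (angVortQuot u) := contDiff_angVortQuot (n := 1) (by exact_mod_cast hu.of_le (by norm_num))
  have hWax : IsAxisymmetricScalar (radVelQuot u) := hax.isAxisymmetricScalar_radVelQuot hu2
  have haxω : IsAxisymmetric (curl u) := hax.curl (hu1.differentiable one_ne_zero)
  have hΦax : IsAxisymmetricScalar (radVelQuot (curl u)) :=
    haxω.isAxisymmetricScalar_radVelQuot (hω.of_le (by norm_num))
  have hζ1 : ContDiff ℝ 1 ζ := hζ.of_le (by norm_num)
  have hζd : Differentiable ℝ ζ := hζ1.differentiable one_ne_zero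
  have hWd : Differentiable ℝ (radVelQuot u) := hW.differentiable two_ne_zero
  have hΦd : Differentiable ℝ (radVelQuot (curl u)) := hΦ.differentiable one_ne_zero
  have hζc : HasCompactSupport ζ :=
    IsCompact.of_isClosed_subset (isCompact_closedBall (0 : EuclideanSpace ℝ (Fin 3)) 2)
      (isClosed_tsupport ζ) (hζs.trans spaceCyl_subset_closedBall)
  have hζzero : ∀ x, x ∉ closedBall (0 : EuclideanSpace ℝ (Fin 3)) 2 → ζ x = 0 := fun x hx =>
    image_eq_zero_of_notMem_tsupport fun h => hx (spaceCyl_subset_closedBall (hζs h))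
  -- the three product functions
  have hF : ContDiff ℝ 2 (fun y => ζ y * radVelQuot u y) := hζ.mul hW
  have hF1 : ContDiff ℝ 1 (fun y => ζ y * radVelQuot u y) := hF.of_le (by norm_num)
  have hH : ContDiff ℝ 1 (fun y => ζ y * radVelQuot (curl u) y) := hζ1.mul hΦ
  have hG1 : ContDiff ℝ 1 (fun y => ζ y * angVortQuot u y) := hζ1.mul hΓ
  have hFax : IsAxisymmetricScalar (fun y => ζ y * radVelQuot u y) := hζax.mul hWax
  have hHax : IsAxisymmetricScalar (fun y => ζ y * radVelQuot (curl u) y) := hζax.mul hΦax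
  have hFd : Differentiable ℝ (fun y => ζ y * radVelQuot u y) := hF1.differentiable one_ne_zero
  have hHd : Differentiable ℝ (fun y => ζ y * radVelQuot (curl u) y) := hH.differentiable one_ne_zero
  have hHc : HasCompactSupport (fun y => ζ y * radVelQuot (curl u) y) := hζc.mul_right
  have hFc : HasCompactSupport (fun y => ζ y * radVelQuot u y) := hζc.mul_right
  -- the stream form, with `f = ζ²Φ = ζ · (ζΦ)`
  have hf1 : ContDiff ℝ 1 fun y => ζ y * (ζ y * radVelQuot (curl u) y) := hζ1.mul hH
  have hfc : HasCompactSupport fun y => ζ y * (ζ y * radVelQuot (curl u) y) := hζc.mul_right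
  have hstream := integral_mul_fderiv_apply_curl_eq u _ _ hu1 hf1 hfc hW
  have hLHS : ∫ x, ζ x ^ 2 * radVelQuot (curl u) x * fderiv ℝ (radVelQuot u) x (curl u x) =
      ∫ x, ζ x * (ζ x * radVelQuot (curl u) x) * fderiv ℝ (radVelQuot u) x (curl u x) :=
    integral_congr_ae (Eventually.of_forall fun x => by ring)
  rw [hLHS, hstream]
  -- the pointwise decomposition `∇(ζ·ζΦ) × ∇W = c₀ − W c₁ + (ζΦ) c₂`
  have hdec : ∀ x, ⟪u x, cross (gradient (fun y => ζ y * (ζ y * radVelQuot (curl u) y)) x)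
      (gradient (radVelQuot u) x)⟫ =
      ⟪u x, cross (gradient (fun y => ζ y * radVelQuot (curl u) y) x) (gradient (fun y => ζ y * radVelQuot u y) x)⟫ -
        radVelQuot u x * ⟪u x, cross (gradient (fun y => ζ y * radVelQuot (curl u) y) x) (gradient ζ x)⟫ +
        (ζ x * radVelQuot (curl u) x) * ⟪u x, cross (gradient ζ x) (gradient (radVelQuot u) x)⟫ := by
    intro x
    rw [gradient_mul_apply (hζd x) (hHd x), gradient_mul_apply (hζd x) (hWd x)]
    simp only [← crossCLM_apply, map_add, map_smul, _root_.add_apply,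
      _root_.FunLike.coe_smul, Pi.smul_apply, inner_add_right, inner_smul_right]
    ring
  -- abbreviations
  set T : EuclideanSpace ℝ (Fin 3) → ℝ := fun x => ⟪u x, cross
    (gradient (fun y => ζ y * (ζ y * radVelQuot (curl u) y)) x) (gradient (radVelQuot u) x)⟫ with hT
  set L₁ : ℝ := Real.log (Real.exp 1 / r₁) with hL₁
  have hL₁1 : 1 < L₁ := by
    rw [hL₁, log_exp_div_eq r₁ hr₁]; linarith [Real.log_neg hr₁ hr₁1]
  have hL₁0 : 0 < L₁ := by linarith
  set χ : EuclideanSpace ℝ (Fin 3) → ℝ := (closedBall (0 : EuclideanSpace ℝ (Fin 3)) 2).indicator 1 with hχ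
  have hχi : Integrable χ := by
    rw [hχ]
    exact (integrable_indicator_iff measurableSet_closedBall).2
      ((integrableOn_const_iff).2 (Or.inr (isCompact_closedBall _ _).measure_lt_top))
  have hχ0 : ∀ x, 0 ≤ χ x := fun x => by rw [hχ]; exact indicator_nonneg (fun _ _ => zero_le_one) x
  have hχint : ∫ x, χ x = volume.real (closedBall (0 : EuclideanSpace ℝ (Fin 3)) 2) := by rw [hχ]; exact integral_indicator_one measurableSet_closedBall
  -- the components `gᵢ = ∂ᵢ(ζW)` and Lemma 2.2 for them
  obtain ⟨g, hg⟩ : ∃ g : Fin 3 → EuclideanSpace ℝ (Fin 3) → ℝ,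
      g = fun i x => fderiv ℝ (fun y => ζ y * radVelQuot u y) x (EuclideanSpace.single i 1) := ⟨_, rfl⟩
  have hgx : ∀ i x, g i x = fderiv ℝ (fun y => ζ y * radVelQuot u y) x (EuclideanSpace.single i 1) :=
    fun i x => by rw [hg]
  have hgi : ∀ i, ContDiff ℝ 1 (g i) := fun i => by
    rw [hg]; exact contDiff_fderiv_apply_const_succ (n := 1) (by exact_mod_cast hF) _
  have hFs : tsupport (fun y => ζ y * radVelQuot u y) ⊆ tsupport ζ := tsupport_mul_subset_left
  have hgs : ∀ i, tsupport (g i) ⊆ SereginSverak2009.spaceCyl 0 1 := fun i => by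
    have h1 : tsupport (fun x => fderiv ℝ (fun y => ζ y * radVelQuot u y) x (EuclideanSpace.single i 1)) ⊆
        tsupport (fun y => ζ y * radVelQuot u y) :=
      tsupport_fderiv_apply_subset ℝ (EuclideanSpace.single i 1)
    rw [hg]
    exact (h1.trans hFs).trans hζs
  have hL22 := fun i => integrable_and_integral_sq_div_logWeight_le (hgi i) (hgs i)
  obtain ⟨Q, hQ⟩ : ∃ Q : Fin 3 → EuclideanSpace ℝ (Fin 3) → ℝ,
      Q = fun i x => g i x ^ 2 / (cylRadius x ^ 2 * Real.log (Real.exp 1 / cylRadius x) ^ 2) := ⟨_, rfl⟩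
  have hQx : ∀ i x, Q i x = g i x ^ 2 / (cylRadius x ^ 2 * Real.log (Real.exp 1 / cylRadius x) ^ 2) :=
    fun i x => by rw [hQ]
  have hQi : ∀ i, Integrable (Q i) := fun i => by rw [hQ]; exact (hL22 i).1
  have hQle : ∀ i, ∫ x, Q i x ≤ 4 * ∫ x, (fderiv ℝ (g i) x (EuclideanSpace.single 0 1) ^ 2 +
      fderiv ℝ (g i) x (EuclideanSpace.single 1 1) ^ 2) := fun i => by rw [hQ]; exact (hL22 i).2
  have hQ0 : ∀ i x, 0 ≤ Q i x := fun i x => by rw [hQx]; positivity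
  -- the full gradient squared of `ζΦ`
  obtain ⟨A, hA⟩ : ∃ A : EuclideanSpace ℝ (Fin 3) → ℝ, A = fun x =>
      (fderiv ℝ (fun y => ζ y * radVelQuot (curl u) y) x (EuclideanSpace.single 0 1) ^ 2 +
        fderiv ℝ (fun y => ζ y * radVelQuot (curl u) y) x (EuclideanSpace.single 1 1) ^ 2 +
        fderiv ℝ (fun y => ζ y * radVelQuot (curl u) y) x (EuclideanSpace.single 2 1) ^ 2) := ⟨_, rfl⟩
  have hAi : Integrable A := by
    have hi : ∀ i : Fin 3, Integrable (fun x => fderiv ℝ (fun y => ζ y * radVelQuot (curl u) y) x (EuclideanSpace.single i 1) ^ 2) := fun i =>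
      ((continuous_fderiv_apply_of_contDiff hH _).pow 2).integrable_of_hasCompactSupport
        (hasCompactSupport_of_eq_zero (hHc.fderiv_apply ℝ (EuclideanSpace.single i 1)) fun x hx => by simp [hx])
    rw [hA]; exact ((hi 0).add (hi 1)).add (hi 2)
  have hA0 : ∀ x, 0 ≤ A x := fun x => by rw [hA]; positivity
  have hAeq : ∀ x, ‖gradient (fun y => ζ y * radVelQuot (curl u) y) x‖ ^ 2 = A x := fun x => by
    rw [hA, norm_gradient_sq]
  have hBeq : ∀ x, ‖gradient (fun y => ζ y * radVelQuot u y) x‖ ^ 2 = g 0 x ^ 2 + g 1 x ^ 2 + g 2 x ^ 2 := fun x => by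
    rw [norm_gradient_sq, hgx, hgx, hgx]
  -- `T` vanishes off the ball
  have hfzero : ∀ x, x ∉ closedBall (0 : EuclideanSpace ℝ (Fin 3)) 2 →
      gradient (fun y => ζ y * (ζ y * radVelQuot (curl u) y)) x = 0 := by
    intro x hx
    have hfs : tsupport (fun y => ζ y * (ζ y * radVelQuot (curl u) y)) ⊆ tsupport ζ :=
      tsupport_mul_subset_left
    have h1 : fderiv ℝ (fun y => ζ y * (ζ y * radVelQuot (curl u) y)) x = 0 :=
      fderiv_of_notMem_tsupport ℝ fun h => hx (spaceCyl_subset_closedBall (hζs (hfs h)))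
    simp [gradient, h1]
  have hTzero : ∀ x, x ∉ closedBall (0 : EuclideanSpace ℝ (Fin 3)) 2 → T x = 0 := fun x hx => by
    rw [hT]; simp only; rw [hfzero x hx]; simp [cross]
  -- `T` is integrable (continuous with compact support)
  have hTc : Continuous T := by
    have hgf : Continuous (gradient fun y => ζ y * (ζ y * radVelQuot (curl u) y)) :=
      (InnerProductSpace.toDual ℝ (EuclideanSpace ℝ (Fin 3))).symm.continuous.comp
        (hf1.continuous_fderiv one_ne_zero)
    have hgW : Continuous (gradient (radVelQuot u)) := (contDiff_one_gradient' hW).continuous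
    have : Continuous fun x => ⟪u x, crossCLM (gradient (fun y => ζ y * (ζ y * radVelQuot (curl u) y)) x)
        (gradient (radVelQuot u) x)⟫ :=
      hu1.continuous.inner (crossCLM.continuous₂.comp (hgf.prodMk hgW))
    exact this
  have hTi : Integrable T :=
    hTc.integrable_of_hasCompactSupport (HasCompactSupport.intro (isCompact_closedBall _ _) hTzero)
  -- the pointwise a.e. bound
  have hK0 : 0 ≤ C₁ / (2 * L₁ ^ 2) := by positivity
  have hae : ∀ᵐ x ∂(volume : Measure (EuclideanSpace ℝ (Fin 3))), cylRadius x ≠ 0 := by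
    rw [ae_iff]; simp only [ne_eq, not_not]; exact volume_setOf_cylRadius_eq_zero
  have hTx : ∀ x, T x = ⟪u x, cross (gradient (fun y => ζ y * radVelQuot (curl u) y) x) (gradient (fun y => ζ y * radVelQuot u y) x)⟫ -
      radVelQuot u x * ⟪u x, cross (gradient (fun y => ζ y * radVelQuot (curl u) y) x) (gradient ζ x)⟫ +
      (ζ x * radVelQuot (curl u) x) * ⟪u x, cross (gradient ζ x) (gradient (radVelQuot u) x)⟫ := fun x => by
    rw [hT]; exact hdec x
  have hbound : ∀ᵐ x ∂(volume : Measure (EuclideanSpace ℝ (Fin 3))),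
      |T x| ≤ (C₁ / (2 * L₁ ^ 2) + 2 * ε) * A x + C₁ / (2 * L₁ ^ 2) * (Q 0 x + Q 1 x + Q 2 x) +
        ((P₀ ^ 2 + P₁ ^ 2) / (4 * ε) + P₂) * χ x := by
    filter_upwards [hae] with x hx0
    have hr : 0 < cylRadius x := lt_of_le_of_ne (cylRadius_nonneg x) (Ne.symm hx0)
    have hQsum : 0 ≤ Q 0 x + Q 1 x + Q 2 x := add_nonneg (add_nonneg (hQ0 0 x) (hQ0 1 x)) (hQ0 2 x)
    by_cases hxB : x ∈ closedBall (0 : EuclideanSpace ℝ (Fin 3)) 2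
    swap
    · rw [hTzero x hxB, abs_zero]
      exact add_nonneg (add_nonneg (mul_nonneg (by positivity) (hA0 x)) (mul_nonneg hK0 hQsum))
        (mul_nonneg (by positivity) (hχ0 x))
    have hχx : χ x = 1 := by rw [hχ]; exact indicator_of_mem hxB _
    rw [hχx, mul_one]
    -- `|v_θ| = |swirl|/r`
    have hvθ : |x 0 * u x 1 - x 1 * u x 0| / cylRadius x = |swirlVelocity u x| := by
      have h := swirl_eq_cylRadius_mul_swirlVelocity u hr.ne'
      rw [swirl] at h
      rw [h, abs_mul, abs_of_pos hr, mul_div_cancel_left₀ _ hr.ne']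
    -- the three cross-product bounds
    have h0 := abs_inner_cross_gradient_le _ _ x (u x) hHax hFax hx0 (hHd x) (hFd x)
    have h1 := abs_inner_cross_gradient_le _ _ x (u x) hHax hζax hx0 (hHd x) (hζd x)
    have h2 := abs_inner_cross_gradient_le _ _ x (u x) hζax hWax hx0 (hζd x) (hWd x)
    rw [hvθ] at h0 h1 h2
    rw [norm_gradient_eq_norm_fderiv' ζ] at h1 h2
    rw [norm_gradient_eq_norm_fderiv' (radVelQuot u)] at h2
    -- near / far
    have hcase : |swirlVelocity u x| * (‖gradient (fun y => ζ y * radVelQuot (curl u) y) x‖ * ‖gradient (fun y => ζ y * radVelQuot u y) x‖) ≤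
        C₁ / (2 * L₁ ^ 2) * ‖gradient (fun y => ζ y * radVelQuot (curl u) y) x‖ ^ 2 + C₁ / (2 * L₁ ^ 2) * (Q 0 x + Q 1 x + Q 2 x) ∨
        |swirlVelocity u x| * ‖gradient (fun y => ζ y * radVelQuot u y) x‖ ≤ P₀ := by
      by_cases hnear : cylRadius x < r₁
      · left
        have hsv := abs_swirlVelocity_le_of_swirl_le u x C₁ hr (hσ x hr hnear)
        have hLL : L₁ ≤ Real.log (Real.exp 1 / cylRadius x) := by
          rw [hL₁, log_exp_div_eq _ hr, log_exp_div_eq r₁ hr₁]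
          linarith [Real.log_le_log hr hnear.le]
        have hQxx : Q 0 x + Q 1 x + Q 2 x =
            (‖gradient (fun y => ζ y * radVelQuot u y) x‖ / (cylRadius x * Real.log (Real.exp 1 / cylRadius x))) ^ 2 := by
          rw [hQx, hQx, hQx, ← add_div, ← add_div, ← hBeq x, div_pow, mul_pow]
        rw [hQxx]
        exact near_axis_scalar hsv hr hL₁0 hLL hC₁ (norm_nonneg _) (norm_nonneg _)
      · right
        push Not at hnear
        have := hfar x hnear
        rwa [← norm_gradient_eq_norm_fderiv'] at this
    have hmain := pointwise_scalar h0 h1 h2 (hP1 x) (hP2 x) hε (norm_nonneg _) hK0 hQsum hcase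
    rw [hTx x, ← hAeq x]
    exact hmain
  -- integrate the pointwise bound
  have hQ012 : Integrable (fun x => Q 0 x + Q 1 x + Q 2 x) := ((hQi 0).add (hQi 1)).add (hQi 2)
  have i1 : Integrable (fun x => (C₁ / (2 * L₁ ^ 2) + 2 * ε) * A x) := hAi.const_mul _
  have i2 : Integrable (fun x => C₁ / (2 * L₁ ^ 2) * (Q 0 x + Q 1 x + Q 2 x)) := hQ012.const_mul _
  have i3 : Integrable (fun x => ((P₀ ^ 2 + P₁ ^ 2) / (4 * ε) + P₂) * χ x) := hχi.const_mul _
  have i12 : Integrable (fun x => (C₁ / (2 * L₁ ^ 2) + 2 * ε) * A x +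
      C₁ / (2 * L₁ ^ 2) * (Q 0 x + Q 1 x + Q 2 x)) := i1.add i2
  have hQ01 : Integrable (fun x => Q 0 x + Q 1 x) := (hQi 0).add (hQi 1)
  have i123 : Integrable (fun x => (C₁ / (2 * L₁ ^ 2) + 2 * ε) * A x +
      C₁ / (2 * L₁ ^ 2) * (Q 0 x + Q 1 x + Q 2 x) + ((P₀ ^ 2 + P₁ ^ 2) / (4 * ε) + P₂) * χ x) := i12.add i3
  have hint : ∫ x, |T x| ≤ (C₁ / (2 * L₁ ^ 2) + 2 * ε) * (∫ x, A x) +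
      C₁ / (2 * L₁ ^ 2) * ((∫ x, Q 0 x) + (∫ x, Q 1 x) + ∫ x, Q 2 x) +
      ((P₀ ^ 2 + P₁ ^ 2) / (4 * ε) + P₂) * volume.real (closedBall (0 : EuclideanSpace ℝ (Fin 3)) 2) := by
    have h := integral_mono_ae hTi.abs i123 hbound
    rw [integral_add i12 i3, integral_add i1 i2, MeasureTheory.integral_const_mul,
      MeasureTheory.integral_const_mul, MeasureTheory.integral_const_mul,
      integral_add hQ01 (hQi 2), integral_add (hQi 0) (hQi 1), hχint] at h
    exact h
  -- Lemma 2.2 on the components and Lemma 2.1 (ii)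
  have hgc : ∀ i : Fin 3, HasCompactSupport (g i) := fun i => by rw [hg]; exact hFc.fderiv_apply ℝ _
  have hij : ∀ i j : Fin 3, Integrable (fun x => fderiv ℝ (g i) x (EuclideanSpace.single j 1) ^ 2) := fun i j =>
    ((continuous_fderiv_apply_of_contDiff (hgi i) _).pow 2).integrable_of_hasCompactSupport
      (hasCompactSupport_of_eq_zero ((hgc i).fderiv_apply ℝ (EuclideanSpace.single j 1)) fun x hx => by simp [hx])
  have hR : ∀ i : Fin 3, (∫ x, (fderiv ℝ (g i) x (EuclideanSpace.single 0 1) ^ 2 + fderiv ℝ (g i) x (EuclideanSpace.single 1 1) ^ 2)) ≤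
      ∫ x, ∑ j : Fin 3, (fderiv ℝ (g i) x (EuclideanSpace.single j 1)) ^ 2 := by
    intro i
    refine integral_mono ((hij i 0).add (hij i 1)) (integrable_finsetSum _ fun j _ => hij i j) fun x => ?_
    simp only [Fin.sum_univ_three]
    nlinarith [sq_nonneg (fderiv ℝ (g i) x (EuclideanSpace.single 2 1))]
  have hHessSplit : (∫ x, ∑ i : Fin 3, ∑ j : Fin 3,
      (fderiv ℝ (fun y => fderiv ℝ (fun y => ζ y * radVelQuot u y) y (EuclideanSpace.single i 1)) x (EuclideanSpace.single j 1)) ^ 2) =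
      (∫ x, ∑ j : Fin 3, (fderiv ℝ (g 0) x (EuclideanSpace.single j 1)) ^ 2) +
      (∫ x, ∑ j : Fin 3, (fderiv ℝ (g 1) x (EuclideanSpace.single j 1)) ^ 2) +
      ∫ x, ∑ j : Fin 3, (fderiv ℝ (g 2) x (EuclideanSpace.single j 1)) ^ 2 := by
    have hi : ∀ i : Fin 3, Integrable (fun x => ∑ j : Fin 3, (fderiv ℝ (g i) x (EuclideanSpace.single j 1)) ^ 2) :=
      fun i => integrable_finsetSum _ fun j _ => hij i j
    have hi01 : Integrable (fun x => ∑ j : Fin 3, (fderiv ℝ (g 0) x (EuclideanSpace.single j 1)) ^ 2 +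
        ∑ j : Fin 3, (fderiv ℝ (g 1) x (EuclideanSpace.single j 1)) ^ 2) := (hi 0).add (hi 1)
    rw [← integral_add (hi 0) (hi 1), ← integral_add hi01 (hi 2)]
    refine integral_congr_ae (Eventually.of_forall fun x => ?_)
    rw [hg]
    simp only [Fin.sum_univ_three]
  have hQsum' : (∫ x, Q 0 x) + (∫ x, Q 1 x) + (∫ x, Q 2 x) ≤ 4 * (cL * (∫ x, (fderiv ℝ (fun y => ζ y * angVortQuot u y) x (EuclideanSpace.single 0 1) ^ 2 + fderiv ℝ (fun y => ζ y * angVortQuot u y) x (EuclideanSpace.single 1 1) ^ 2 + fderiv ℝ (fun y => ζ y * angVortQuot u y) x (EuclideanSpace.single 2 1) ^ 2)) + CL) := by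
    have h0 := hQle 0; have h1 := hQle 1; have h2 := hQle 2
    have hR0 := hR 0; have hR1 := hR 1; have hR2 := hR 2
    linarith [hHessSplit, hL21]
  -- assemble
  have hDΦ : (∫ x, A x) = (∫ x, (fderiv ℝ (fun y => ζ y * radVelQuot (curl u) y) x (EuclideanSpace.single 0 1) ^ 2 + fderiv ℝ (fun y => ζ y * radVelQuot (curl u) y) x (EuclideanSpace.single 1 1) ^ 2 + fderiv ℝ (fun y => ζ y * radVelQuot (curl u) y) x (EuclideanSpace.single 2 1) ^ 2)) := by rw [hA]
  have habs : (∫ x, T x) ≤ ∫ x, |T x| := (le_abs_self _).trans abs_integral_le_integral_abs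
  have hDΓ0 : 0 ≤ (∫ x, (fderiv ℝ (fun y => ζ y * angVortQuot u y) x (EuclideanSpace.single 0 1) ^ 2 + fderiv ℝ (fun y => ζ y * angVortQuot u y) x (EuclideanSpace.single 1 1) ^ 2 + fderiv ℝ (fun y => ζ y * angVortQuot u y) x (EuclideanSpace.single 2 1) ^ 2)) := integral_nonneg fun x => by positivity
  have hDΦ0 : 0 ≤ (∫ x, (fderiv ℝ (fun y => ζ y * radVelQuot (curl u) y) x (EuclideanSpace.single 0 1) ^ 2 + fderiv ℝ (fun y => ζ y * radVelQuot (curl u) y) x (EuclideanSpace.single 1 1) ^ 2 + fderiv ℝ (fun y => ζ y * radVelQuot (curl u) y) x (EuclideanSpace.single 2 1) ^ 2)) := integral_nonneg fun x => by positivity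
  rw [hDΦ] at hint
  exact final_scalar habs hint hQsum' hC₁ hL₁0 hε hcL hDΦ0 hDΓ0

end A3

end Literature.Analysis.SereginLogSwirlOrigin.EulerScaling

end Part2

/-!
## Part 3 — port of `Summits/NavierStokesRegularity/NavierStokesRegularity/Theorems/AxisymmetricExtremalityAxisymmetricKatoGlobalStubSereginLogSwirlOriginLemma21LocalIdentity.lean` (4 declarations kept)

# The elliptic identity `Δ(u_r/r) + (2/r)∂ᵣ(u_r/r) = ∂₃(ω_θ/r) + (1/r)∂ᵣ(div u)` for axisymmetric
# fields that are NOT divergence free — crux stmt-NavierStokesRegularity-15453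
# (`AxisymmetricExtremality.AxisymmetricKatoGlobal`), line registered, support for stub
# `stub_sereginLogSwirlOrigin` (Seregin 2022, Lemma 2.1, localisation step)

Support file (`--supports stmt-NavierStokesRegularity-15453`; theorems only, everything proved)
toward the registered stub `stub_sereginLogSwirlOrigin` = the named fact
`Literature.Analysis.FluidPDE.seregin2022_logSwirl_regularAtOrigin` (G. Seregin, J. Math. Fluid
Mech. 24 (2022), Paper 27 = arXiv:2201.00153, §2). Lemma 2.1 there bounds `∇(η³v_r/r)` and
`∇̄²(η³v_r/r)` by `η³Γ`, `(η³Γ),₃` (`Γ = ω_θ/r`) plus `C(v, η)`; its proof localises the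
div–curl system to `ζv̄` (`ζ = η³`): "`div (ζv̄) = v̄·∇ζ`, `curl (ζv̄) = ζω_θe_θ + ∇ζ × v̄`"
(arXiv p. 5) — the localised field is compactly supported but no longer divergence free. The
global (divergence-free) core of the lemma is in the tree
(`eLpNorm_fderiv_radVelQuot_le_eLpNorm_angVortQuot`, sibling file `…CFZBounds`), resting on the
pointwise identity `Δρ + 2q_ρ = ∂₂Γ` of `AxisymHouLiVariables`
(`IsAxisymmetric.laplacian_radVelQuot_add`; `ρ = radVelQuot u = u_r/r`,
`Γ = angVortQuot u = ω_θ/r`, `q_F = radDerivQuot F = (∂ᵣF)/r`), whose proof uses `div u = 0`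
exactly once, through `∂₀(div u) = 0` at meridian points.

This file removes the divergence-free hypothesis and keeps the source term: for every
axisymmetric `u ∈ C⁴(ℝ³; ℝ³)` and every `x ∈ ℝ³`,

  `Δ(radVelQuot u) x + 2 radDerivQuot (radVelQuot u) x
      = ∂₂(angVortQuot u) x + radDerivQuot (div u) x`

(`laplacian_radVelQuot_add_eq`; registered sub-goal), i.e. in cylindrical components
(`u = u_r e_r + u_θ e_θ + u₃e₃`, `div u = ∂ᵣu_r + u_r/r + ∂₃u₃`, `rΓ = ∂₃u_r − ∂ᵣu₃`):
`(∂ᵣ² + (3/r)∂ᵣ + ∂₃²)(u_r/r) = ∂₃Γ + (1/r)∂ᵣ(div u)` — indeed with `u_r = rρ`,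
`(1/r)∂ᵣ(div u) = ∂ᵣ²ρ + (3/r)∂ᵣρ + (1/r)∂ᵣ∂₃u₃` and `∂₃Γ = ∂₃²ρ − (1/r)∂₃∂ᵣu₃`. The proof is
the tree's meridian computation verbatim (`laplacian_radVelQuot_add_eq_of_meridian`, adapted
from `IsAxisymmetric.laplacian_radVelQuot_add_of_meridian`) with `∂₀(div u)(x)` kept
(`fderiv_divergence_components`) and identified with `x₀ · radDerivQuot (div u) x`
(`mul_radDerivQuot_eq_fderiv_zero`, `div u` being an axisymmetric `C³` scalar,
`isAxisymmetricScalar_divergence`), followed by the same passage from meridian points to all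
of `ℝ³` (axisymmetry and continuity of both sides, density of `{x₀ ≠ 0}`). The two integrations
by parts that turn it into Seregin's localised `L²` bounds are in the sibling file
`…Lemma21Local`.

## Mathlib / tree search

Tree inputs: `IsAxisymmetric.laplacian_radVelQuot_add_of_meridian` (model, div-free),
`mul_radVelQuot_of_meridian`, `mul_angVortQuot_of_meridian`, `mul_fderiv_fderiv_one_one`,
`mul_fderiv_single_one_apply_one`, `divergence_eq_sum_three`, `hasDerivAt_along_line`,
`line_single_apply`, `IsAxisymmetricScalar.laplacian`, `fderiv_apply_single_two`
(`AxisymHouLiVariables`); `mul_radDerivQuot_eq_fderiv_zero`, `isAxisymmetricScalar_radDerivQuot`,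
`continuous_radDerivQuot` (`AxisymRadialQuotient`); `IsAxisymmetricScalar.mul_fderiv_fderiv_single_one`,
`eq_of_eq_off_ker`, `eq_comp_meridian` (`AxisymmetricLiftR5`, `CylindricalIntegration`);
`contDiff_divergence` (`TaoEnstrophyLocalisationProofs`); `divergence_conj_linearIsometryEquiv`
(`IsometryInvariance`). `lean search 'laplacian_radVelQuot_add_eq|isAxisymmetricScalar_divergence|fderiv_divergence_components '`:
no matches (2026-08-17).

## References

* G. Seregin, J. Math. Fluid Mech. 24 (2022), Paper No. 27 = arXiv:2201.00153, §2, Lemma 2.1,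
  proof ("derive from (1.1) the non-homogeneous system `div(ζv̄) = v̄·∇ζ`, …", arXiv p. 5).
  [`Seregin2022LocalAxisym`]
* Z. Lei, Q. S. Zhang, Pacific J. Math. 289 (2017) 169–187 = arXiv:1505.02628, Lemma 2.1 (the
  relation between `v^r/r` and `Ω` in the divergence-free case). [`LeiZhang2017`]
-/

section Part3

open _root_.MeasureTheory _root_.Set _root_.Filter _root_.Topology _root_.Function
open scoped _root_.ContDiff Laplacian
open Literature.Analysis.FluidPDE

namespace Literature.Analysis.SereginLogSwirlOrigin.EulerScaling

variable {u : EuclideanSpace ℝ (Fin 3) → EuclideanSpace ℝ (Fin 3)}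

/-! ### The divergence of an axisymmetric field -/

/-- **Derivatives of `div u` in components**: `∂ᵥ∂₀u₀ + ∂ᵥ∂₁u₁ + ∂ᵥ∂₂u₂ = ∂ᵥ(div u)` for
`u ∈ C²` (the tree's `fderiv_divergence_components_eq_zero` without `div u = 0`). [folklore]
[cite: Seregin2022LocalAxisym, §2 proof of Thm. 1.2 (arXiv:2201.00153 pp. 4–7) (source of the ARGUMENT this module implements; this declaration is the cell’s own lemma or plumbing, NOT a printed statement)] -/
theorem fderiv_divergence_components (hu : ContDiff ℝ 2 u) (x v : EuclideanSpace ℝ (Fin 3)) :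
    fderiv ℝ (fun y => fderiv ℝ u y (EuclideanSpace.single 0 1) 0) x v +
      fderiv ℝ (fun y => fderiv ℝ u y (EuclideanSpace.single 1 1) 1) x v +
      fderiv ℝ (fun y => fderiv ℝ u y (EuclideanSpace.single 2 1) 2) x v =
      fderiv ℝ (VectorCalculus.divergence u) x v := by
  have hdi : ∀ i : Fin 3, Differentiable ℝ fun y => fderiv ℝ u y (EuclideanSpace.single i 1) i :=
    fun i => (contDiff_apply_coord_vec3 (contDiff_fderiv_apply_const_succ (n := 1)
      (by exact_mod_cast hu) _) i).differentiable one_ne_zero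
  have hfun : VectorCalculus.divergence u = fun y => fderiv ℝ u y (EuclideanSpace.single 0 1) 0 +
      fderiv ℝ u y (EuclideanSpace.single 1 1) 1 + fderiv ℝ u y (EuclideanSpace.single 2 1) 2 :=
    funext fun y => divergence_eq_sum_three u y
  rw [hfun, fderiv_fun_add ((hdi 0 x).fun_add (hdi 1 x)) (hdi 2 x), fderiv_fun_add (hdi 0 x) (hdi 1 x)]
  rfl

/-- **The divergence of an axisymmetric field is an axisymmetric scalar** (`div` commutes with
the conjugation `u ↦ R_θ ∘ u ∘ R_θ⁻¹`, which fixes an axisymmetric `u`). [folklore]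
[cite: Seregin2022LocalAxisym, §2 proof of Thm. 1.2 (arXiv:2201.00153 pp. 4–7) (source of the ARGUMENT this module implements; this declaration is the cell’s own lemma or plumbing, NOT a printed statement)] -/
theorem isAxisymmetricScalar_divergence (hax : IsAxisymmetric u) :
    IsAxisymmetricScalar (VectorCalculus.divergence u) := by
  intro θ x
  have hfun : (fun y => rotZLIE θ (u ((rotZLIE θ).symm y))) = u := funext fun y => by
    have hy : rotZ θ (rotZ (-θ) y) = y := by simpa using rotZ_neg_apply_rotZ (-θ) y
    rw [rotZLIE_symm_apply, rotZLIE_apply, ← hax θ (rotZ (-θ) y), hy]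
  have h := divergence_conj_linearIsometryEquiv (rotZLIE θ) u (rotZ θ x)
  rw [hfun, rotZLIE_symm_apply, rotZ_neg_apply_rotZ] at h
  exact h

/-! ### The identity at meridian points off the axis -/

/-- **The identity at meridian points off the axis, with the divergence kept.** For an
axisymmetric `u ∈ C⁴` (not necessarily divergence free) and `x` with `x₁ = 0`, `x₀ ≠ 0`:
`Δ(u_r/r)(x) + 2 radDerivQuot (u_r/r)(x) = ∂₂(ω_θ/r)(x) + radDerivQuot (div u)(x)`.
The computation is the tree's (`IsAxisymmetric.laplacian_radVelQuot_add_of_meridian`: restrict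
`x₀ · (u_r/r) = u₀` to the lines through `x` along `e₀`, `e₂`; cylindrical Laplacian
`∂₀² + (1/x₀)∂₀ + ∂₂²` of axisymmetric scalars; `x₀ · (ω_θ/r) = ∂₂u₀ − ∂₀u₂`; `∂₁u₁ = u₀/x₀`,
`x₀∂₀∂₁u₁ = ∂₀u₀ − ∂₁u₁` on the meridian plane), the only change being that the difference of
the two sides, `(1/x₀) ∂₀(∂₀u₀ + ∂₁u₁ + ∂₂u₂) = (1/x₀)∂₀(div u)`, is now `radDerivQuot (div u) x`
instead of `0`. [cite: Seregin2022LocalAxisym, §2 Lemma 2.1, proof (arXiv:2201.00153 p. 5: div(ζv̄) = v̄·∇ζ)] -/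
theorem laplacian_radVelQuot_add_eq_of_meridian (hax : IsAxisymmetric u)
    (hu : ContDiff ℝ 4 u) {x : EuclideanSpace ℝ (Fin 3)} (hx1 : x 1 = 0) (hx0 : x 0 ≠ 0) :
    (Δ (radVelQuot u)) x + 2 * radDerivQuot (radVelQuot u) x =
      fderiv ℝ (angVortQuot u) x (EuclideanSpace.single 2 1) +
        radDerivQuot (VectorCalculus.divergence u) x := by
  -- regularity
  have hu2 : ContDiff ℝ 2 u := hu.of_le (by norm_num)
  have hu3 : ContDiff ℝ 3 u := hu.of_le (by norm_num)
  have hud : Differentiable ℝ u := hu.differentiable (by norm_num)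
  have hρ2 : ContDiff ℝ 2 (radVelQuot u) :=
    contDiff_radVelQuot (n := 2) (by exact_mod_cast hu)
  have hρd : Differentiable ℝ (radVelQuot u) := hρ2.differentiable two_ne_zero
  have hρax : IsAxisymmetricScalar (radVelQuot u) := hax.isAxisymmetricScalar_radVelQuot hu2
  have hω1 : ContDiff ℝ 1 (angVortQuot u) :=
    contDiff_angVortQuot (n := 1) (by exact_mod_cast hu)
  have hωd : Differentiable ℝ (angVortQuot u) := hω1.differentiable one_ne_zero
  have hdρ0 : Differentiable ℝ fun y => fderiv ℝ (radVelQuot u) y (EuclideanSpace.single 0 1) :=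
    (contDiff_fderiv_apply_const_succ (n := 1) (by exact_mod_cast hρ2) _).differentiable
      one_ne_zero
  have hdρ2 : Differentiable ℝ fun y => fderiv ℝ (radVelQuot u) y (EuclideanSpace.single 2 1) :=
    (contDiff_fderiv_apply_const_succ (n := 1) (by exact_mod_cast hρ2) _).differentiable
      one_ne_zero
  have hdu : ∀ (v : EuclideanSpace ℝ (Fin 3)) (i : Fin 3),
      Differentiable ℝ fun y => fderiv ℝ u y v i := fun v i =>
    (contDiff_apply_coord_vec3 (contDiff_fderiv_apply_const_succ (n := 1) (by exact_mod_cast hu2) v)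
      i).differentiable one_ne_zero
  have hdu0 : ∀ i : Fin 3, Differentiable ℝ fun y => u y i := fun i =>
    (contDiff_apply_coord_vec3 hu2 i).differentiable two_ne_zero
  -- coordinates on the two lines through `x`
  have l0_0 : ∀ s : ℝ, (x + s • EuclideanSpace.single (0 : Fin 3) (1 : ℝ)) 0 = x 0 + s :=
    fun s => by rw [line_single_apply]; simp
  have l0_1 : ∀ s : ℝ, (x + s • EuclideanSpace.single (0 : Fin 3) (1 : ℝ)) 1 = 0 :=
    fun s => by rw [line_single_apply, hx1]; simp
  have l2_0 : ∀ s : ℝ, (x + s • EuclideanSpace.single (2 : Fin 3) (1 : ℝ)) 0 = x 0 :=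
    fun s => by rw [line_single_apply]; simp
  have l2_1 : ∀ s : ℝ, (x + s • EuclideanSpace.single (2 : Fin 3) (1 : ℝ)) 1 = 0 :=
    fun s => by rw [line_single_apply, hx1]; simp
  /- (1) the line through `x` along `e₀`: `(x₀ + s) ρ = u₀` -/
  have hgU : (fun s : ℝ => (x 0 + s) * radVelQuot u (x + s • EuclideanSpace.single 0 1)) =
      fun s => u (x + s • EuclideanSpace.single 0 1) 0 := funext fun s => by
    have h := hax.mul_radVelQuot_of_meridian hu2 (l0_1 s)
    rwa [l0_0] at h
  -- first derivatives along the line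
  have hg1 : ∀ s : ℝ, HasDerivAt (fun s : ℝ => radVelQuot u (x + s • EuclideanSpace.single 0 1))
      (fderiv ℝ (radVelQuot u) (x + s • EuclideanSpace.single 0 1) (EuclideanSpace.single 0 1)) s :=
    fun s => hasDerivAt_along_line (hρd _)
  have hU1 : ∀ s : ℝ, HasDerivAt (fun s : ℝ => u (x + s • EuclideanSpace.single 0 1) 0)
      (fderiv ℝ (fun y => u y 0) (x + s • EuclideanSpace.single 0 1) (EuclideanSpace.single 0 1))
      s := fun s => hasDerivAt_along_line (f := fun y => u y 0) (hdu0 0 _)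
  have hprod : ∀ s : ℝ, HasDerivAt (fun s : ℝ => u (x + s • EuclideanSpace.single 0 1) 0)
      (1 * radVelQuot u (x + s • EuclideanSpace.single 0 1) + (x 0 + s) *
        fderiv ℝ (radVelQuot u) (x + s • EuclideanSpace.single 0 1) (EuclideanSpace.single 0 1))
      s := fun s => by
    rw [← hgU]
    exact ((hasDerivAt_id s).const_add (x 0)).mul (hg1 s)
  have hR1fun : (fun s : ℝ => fderiv ℝ (fun y => u y 0) (x + s • EuclideanSpace.single 0 1)
      (EuclideanSpace.single 0 1)) = fun s => 1 * radVelQuot u (x + s • EuclideanSpace.single 0 1) +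
      (x 0 + s) * fderiv ℝ (radVelQuot u) (x + s • EuclideanSpace.single 0 1)
        (EuclideanSpace.single 0 1) := funext fun s => (hU1 s).unique (hprod s)
  -- second derivatives along the line
  have hG1 : ∀ s : ℝ, HasDerivAt (fun s : ℝ => fderiv ℝ (radVelQuot u)
      (x + s • EuclideanSpace.single 0 1) (EuclideanSpace.single 0 1))
      (fderiv ℝ (fun y => fderiv ℝ (radVelQuot u) y (EuclideanSpace.single 0 1))
        (x + s • EuclideanSpace.single 0 1) (EuclideanSpace.single 0 1)) s := fun s =>
    hasDerivAt_along_line (f := fun y => fderiv ℝ (radVelQuot u) y (EuclideanSpace.single 0 1))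
      (hdρ0 _)
  have hV1 : ∀ s : ℝ, HasDerivAt (fun s : ℝ => fderiv ℝ (fun y => u y 0)
      (x + s • EuclideanSpace.single 0 1) (EuclideanSpace.single 0 1))
      (fderiv ℝ (fun y => fderiv ℝ (fun y => u y 0) y (EuclideanSpace.single 0 1))
        (x + s • EuclideanSpace.single 0 1) (EuclideanSpace.single 0 1)) s := fun s => by
    refine hasDerivAt_along_line (f := fun y => fderiv ℝ (fun y => u y 0) y
      (EuclideanSpace.single 0 1)) ?_
    have hfun : (fun y => fderiv ℝ (fun y => u y 0) y (EuclideanSpace.single 0 1)) =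
        fun y => fderiv ℝ u y (EuclideanSpace.single 0 1) 0 :=
      funext fun y => fderiv_apply_coord_vec3 (hud y) 0 _
    rw [hfun]
    exact hdu _ 0 _
  have hprod2 : HasDerivAt (fun s : ℝ => fderiv ℝ (fun y => u y 0)
      (x + s • EuclideanSpace.single 0 1) (EuclideanSpace.single 0 1))
      (1 * fderiv ℝ (radVelQuot u) (x + (0 : ℝ) • EuclideanSpace.single 0 1)
          (EuclideanSpace.single 0 1) +
        (1 * fderiv ℝ (radVelQuot u) (x + (0 : ℝ) • EuclideanSpace.single 0 1)
          (EuclideanSpace.single 0 1) + (x 0 + id (0 : ℝ)) *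
          fderiv ℝ (fun y => fderiv ℝ (radVelQuot u) y (EuclideanSpace.single 0 1))
            (x + (0 : ℝ) • EuclideanSpace.single 0 1) (EuclideanSpace.single 0 1))) 0 := by
    rw [hR1fun]
    exact ((hg1 0).const_mul 1).add (((hasDerivAt_id (0 : ℝ)).const_add (x 0)).mul (hG1 0))
  have hR2 := (hV1 0).unique hprod2
  have hR1 := congrFun hR1fun 0
  simp only [zero_smul, add_zero, one_mul, id_eq] at hR1 hR2
  -- rewrite the `u₀`-derivatives as components of derivatives of `u`
  have hcoord1 : fderiv ℝ (fun y => u y 0) x (EuclideanSpace.single 0 1) =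
      fderiv ℝ u x (EuclideanSpace.single 0 1) 0 := fderiv_apply_coord_vec3 (hud x) 0 _
  have hcoord2 : fderiv ℝ (fun y => fderiv ℝ (fun y => u y 0) y (EuclideanSpace.single 0 1)) x
      (EuclideanSpace.single 0 1) =
      fderiv ℝ (fun y => fderiv ℝ u y (EuclideanSpace.single 0 1) 0) x
        (EuclideanSpace.single 0 1) := by
    have hfun : (fun y => fderiv ℝ (fun y => u y 0) y (EuclideanSpace.single 0 1)) =
        fun y => fderiv ℝ u y (EuclideanSpace.single 0 1) 0 :=
      funext fun y => fderiv_apply_coord_vec3 (hud y) 0 _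
    rw [hfun]
  rw [hcoord1] at hR1
  rw [hcoord2] at hR2
  /- (2) the line through `x` along `e₂`: `x₀ ρ = u₀` -/
  have hhW : (fun s : ℝ => x 0 * radVelQuot u (x + s • EuclideanSpace.single 2 1)) =
      fun s => u (x + s • EuclideanSpace.single 2 1) 0 := funext fun s => by
    have h := hax.mul_radVelQuot_of_meridian hu2 (l2_1 s)
    rwa [l2_0] at h
  have hh1 : ∀ s : ℝ, HasDerivAt (fun s : ℝ => radVelQuot u (x + s • EuclideanSpace.single 2 1))
      (fderiv ℝ (radVelQuot u) (x + s • EuclideanSpace.single 2 1) (EuclideanSpace.single 2 1)) s :=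
    fun s => hasDerivAt_along_line (hρd _)
  have hW1 : ∀ s : ℝ, HasDerivAt (fun s : ℝ => u (x + s • EuclideanSpace.single 2 1) 0)
      (fderiv ℝ (fun y => u y 0) (x + s • EuclideanSpace.single 2 1) (EuclideanSpace.single 2 1))
      s := fun s => hasDerivAt_along_line (f := fun y => u y 0) (hdu0 0 _)
  have hS1fun : (fun s : ℝ => fderiv ℝ (fun y => u y 0) (x + s • EuclideanSpace.single 2 1)
      (EuclideanSpace.single 2 1)) = fun s => x 0 * fderiv ℝ (radVelQuot u)
      (x + s • EuclideanSpace.single 2 1) (EuclideanSpace.single 2 1) := funext fun s => by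
    refine (hW1 s).unique ?_
    rw [← hhW]
    exact (hh1 s).const_mul (x 0)
  have hH1 : HasDerivAt (fun s : ℝ => fderiv ℝ (radVelQuot u)
      (x + s • EuclideanSpace.single 2 1) (EuclideanSpace.single 2 1))
      (fderiv ℝ (fun y => fderiv ℝ (radVelQuot u) y (EuclideanSpace.single 2 1))
        (x + (0 : ℝ) • EuclideanSpace.single 2 1) (EuclideanSpace.single 2 1)) 0 :=
    hasDerivAt_along_line (f := fun y => fderiv ℝ (radVelQuot u) y (EuclideanSpace.single 2 1))
      (hdρ2 _)
  have hX1 : HasDerivAt (fun s : ℝ => fderiv ℝ (fun y => u y 0)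
      (x + s • EuclideanSpace.single 2 1) (EuclideanSpace.single 2 1))
      (fderiv ℝ (fun y => fderiv ℝ (fun y => u y 0) y (EuclideanSpace.single 2 1))
        (x + (0 : ℝ) • EuclideanSpace.single 2 1) (EuclideanSpace.single 2 1)) 0 := by
    refine hasDerivAt_along_line (f := fun y => fderiv ℝ (fun y => u y 0) y
      (EuclideanSpace.single 2 1)) ?_
    have hfun : (fun y => fderiv ℝ (fun y => u y 0) y (EuclideanSpace.single 2 1)) =
        fun y => fderiv ℝ u y (EuclideanSpace.single 2 1) 0 :=
      funext fun y => fderiv_apply_coord_vec3 (hud y) 0 _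
    rw [hfun]
    exact hdu _ 0 _
  have hprod3 : HasDerivAt (fun s : ℝ => fderiv ℝ (fun y => u y 0)
      (x + s • EuclideanSpace.single 2 1) (EuclideanSpace.single 2 1))
      (x 0 * fderiv ℝ (fun y => fderiv ℝ (radVelQuot u) y (EuclideanSpace.single 2 1))
        (x + (0 : ℝ) • EuclideanSpace.single 2 1) (EuclideanSpace.single 2 1)) 0 := by
    rw [hS1fun]
    exact hH1.const_mul (x 0)
  have hR3 := hX1.unique hprod3
  have hcoord3 : fderiv ℝ (fun y => fderiv ℝ (fun y => u y 0) y (EuclideanSpace.single 2 1)) x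
      (EuclideanSpace.single 2 1) =
      fderiv ℝ (fun y => fderiv ℝ u y (EuclideanSpace.single 2 1) 0) x
        (EuclideanSpace.single 2 1) := by
    have hfun : (fun y => fderiv ℝ (fun y => u y 0) y (EuclideanSpace.single 2 1)) =
        fun y => fderiv ℝ u y (EuclideanSpace.single 2 1) 0 :=
      funext fun y => fderiv_apply_coord_vec3 (hud y) 0 _
    rw [hfun]
  simp only [zero_smul, add_zero] at hR3
  rw [hcoord3] at hR3
  /- (3) the line through `x` along `e₂` for `ω^θ/r`: `x₀ ω₁ = ∂₂u₀ − ∂₀u₂` -/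
  have hkC : (fun s : ℝ => x 0 * angVortQuot u (x + s • EuclideanSpace.single 2 1)) =
      fun s => fderiv ℝ u (x + s • EuclideanSpace.single 2 1) (EuclideanSpace.single 2 1) 0 -
        fderiv ℝ u (x + s • EuclideanSpace.single 2 1) (EuclideanSpace.single 0 1) 2 :=
    funext fun s => by
      have h := hax.mul_angVortQuot_of_meridian hu3 (l2_1 s)
      rwa [l2_0, curl_apply_one_eq_sub] at h
  have hk1 : HasDerivAt (fun s : ℝ => x 0 * angVortQuot u (x + s • EuclideanSpace.single 2 1))
      (x 0 * fderiv ℝ (angVortQuot u) (x + (0 : ℝ) • EuclideanSpace.single 2 1)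
        (EuclideanSpace.single 2 1)) 0 :=
    (hasDerivAt_along_line (hωd _)).const_mul (x 0)
  have hC1 : HasDerivAt (fun s : ℝ =>
      fderiv ℝ u (x + s • EuclideanSpace.single 2 1) (EuclideanSpace.single 2 1) 0 -
        fderiv ℝ u (x + s • EuclideanSpace.single 2 1) (EuclideanSpace.single 0 1) 2)
      (fderiv ℝ (fun y => fderiv ℝ u y (EuclideanSpace.single 2 1) 0)
          (x + (0 : ℝ) • EuclideanSpace.single 2 1) (EuclideanSpace.single 2 1) -
        fderiv ℝ (fun y => fderiv ℝ u y (EuclideanSpace.single 0 1) 2)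
          (x + (0 : ℝ) • EuclideanSpace.single 2 1) (EuclideanSpace.single 2 1)) 0 :=
    (hasDerivAt_along_line (f := fun y => fderiv ℝ u y (EuclideanSpace.single 2 1) 0)
      (hdu _ 0 _)).sub
      (hasDerivAt_along_line (f := fun y => fderiv ℝ u y (EuclideanSpace.single 0 1) 2) (hdu _ 2 _))
  rw [hkC] at hk1
  have hR4 := hk1.unique hC1
  simp only [zero_smul, add_zero] at hR4
  /- (4) the remaining pointwise relations at `x` -/
  have hR5 := hρax.mul_fderiv_fderiv_single_one hρ2 hx1
  have hR6 := mul_radDerivQuot_eq_fderiv_zero hρ2 hρax x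
  have hLB := hax.mul_fderiv_fderiv_one_one hu2 hx1
  have hLA := hax.mul_fderiv_single_one_apply_one hud hx1
  have hLE := hax.mul_radVelQuot_of_meridian hu2 hx1
  have hLD := fderiv_divergence_components hu2 x (EuclideanSpace.single 0 1)
  -- `x₀ · q_{div u} = ∂₀ (div u)` (the source term kept: `u` is not divergence free)
  have hQ := mul_radDerivQuot_eq_fderiv_zero (contDiff_divergence (n := 2) (by exact_mod_cast hu3))
    (isAxisymmetricScalar_divergence hax) x
  have hSYM : fderiv ℝ (fun y => fderiv ℝ u y (EuclideanSpace.single 2 1) 2) x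
      (EuclideanSpace.single 0 1) =
      fderiv ℝ (fun y => fderiv ℝ u y (EuclideanSpace.single 0 1) 2) x
        (EuclideanSpace.single 2 1) := by
    have hw2 : DifferentiableAt ℝ (fun y => fderiv ℝ u y (EuclideanSpace.single 2 1)) x :=
      (contDiff_fderiv_apply_const_succ (n := 1) (by exact_mod_cast hu2) _).differentiable
        one_ne_zero x
    have hw0 : DifferentiableAt ℝ (fun y => fderiv ℝ u y (EuclideanSpace.single 0 1)) x :=
      (contDiff_fderiv_apply_const_succ (n := 1) (by exact_mod_cast hu2) _).differentiable
        one_ne_zero x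
    rw [fderiv_apply_coord_vec3 hw2, fderiv_apply_coord_vec3 hw0, fderiv_fderiv_apply_comm_vec hu2]
  have hLap : (Δ (radVelQuot u)) x =
      fderiv ℝ (fun y => fderiv ℝ (radVelQuot u) y (EuclideanSpace.single 0 1)) x
          (EuclideanSpace.single 0 1) +
        fderiv ℝ (fun y => fderiv ℝ (radVelQuot u) y (EuclideanSpace.single 1 1)) x
          (EuclideanSpace.single 1 1) +
        fderiv ℝ (fun y => fderiv ℝ (radVelQuot u) y (EuclideanSpace.single 2 1)) x
          (EuclideanSpace.single 2 1) := by
    rw [laplacian_eq_sum_fderiv_fderiv (EuclideanSpace.basisFun (Fin 3) ℝ) hρ2 x]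
    simp only [EuclideanSpace.basisFun_apply, Fin.sum_univ_three]
  -- `∂₁u₁ = ρ` at `x`
  have hd1u1 : fderiv ℝ u x (EuclideanSpace.single 1 1) 1 = radVelQuot u x :=
    mul_left_cancel₀ hx0 (hLA.trans hLE.symm)
  -- `∂₀∂₁u₁ = ∂₀ρ` at `x`
  have hN : x 0 * fderiv ℝ (fun y => fderiv ℝ u y (EuclideanSpace.single 1 1) 1) x
      (EuclideanSpace.single 0 1) =
      x 0 * fderiv ℝ (radVelQuot u) x (EuclideanSpace.single 0 1) := by
    linear_combination hLB + hR1 - hd1u1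
  have hN' := mul_left_cancel₀ hx0 hN
  -- conclude: multiply the goal by `x₀`
  apply mul_left_cancel₀ hx0
  rw [hLap]
  linear_combination -hR2 + hR5 - hR3 + 2 * hR6 - hR4 + hLD - hSYM - hN' - hQ

/-! ### The identity everywhere -/

/-- **`Δ(u_r/r) + (2/r)∂ᵣ(u_r/r) = ∂₃(ω_θ/r) + (1/r)∂ᵣ(div u)` on all of `ℝ³`** for every
axisymmetric `u ∈ C⁴(ℝ³; ℝ³)`, divergence free or not:
`Δ(radVelQuot u) x + 2 radDerivQuot (radVelQuot u) x = ∂₂(angVortQuot u) x + radDerivQuot (div u) x`.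
Both sides are continuous axisymmetric scalars agreeing at meridian points off the axis
(`laplacian_radVelQuot_add_eq_of_meridian`), hence off `{x₀ = 0}` by rotation to the meridian
half-plane, hence everywhere by density. For `div u = 0` this is the tree's
`IsAxisymmetric.laplacian_radVelQuot_add` (Lei–Zhang 2017, Lemma 2.1); the source
`radDerivQuot (div u)` is what Seregin's localisation `u = ζv̄` (`div u = v̄·∇ζ`) produces.
Registered sub-goal toward `stub_sereginLogSwirlOrigin`. [cite: Seregin2022LocalAxisym, §2 Lemma 2.1, proof (arXiv:2201.00153 p. 5: div(ζv̄) = v̄·∇ζ)] [cite: LeiZhang2017, Lemma 2.1 (the relation between v^r/r and Ω)] -/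
theorem laplacian_radVelQuot_add_eq : ∀ u : EuclideanSpace ℝ (Fin 3) → EuclideanSpace ℝ (Fin 3), IsAxisymmetric u → ContDiff ℝ 4 u → ∀ x : EuclideanSpace ℝ (Fin 3), (Δ (radVelQuot u)) x + 2 * radDerivQuot (radVelQuot u) x = fderiv ℝ (angVortQuot u) x (EuclideanSpace.single 2 1) + radDerivQuot (VectorCalculus.divergence u) x := by
  intro u hax hu x
  have hu2 : ContDiff ℝ 2 u := hu.of_le (by norm_num)
  have hu3 : ContDiff ℝ 3 u := hu.of_le (by norm_num)
  have hρ2 : ContDiff ℝ 2 (radVelQuot u) := contDiff_radVelQuot (n := 2) (by exact_mod_cast hu)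
  have hρax : IsAxisymmetricScalar (radVelQuot u) := hax.isAxisymmetricScalar_radVelQuot hu2
  have hω1 : ContDiff ℝ 1 (angVortQuot u) := contDiff_angVortQuot (n := 1) (by exact_mod_cast hu)
  have hωax : IsAxisymmetricScalar (angVortQuot u) := hax.isAxisymmetricScalar_angVortQuot hu3
  have hD2 : ContDiff ℝ 2 (VectorCalculus.divergence u) :=
    contDiff_divergence (n := 2) (by exact_mod_cast hu3)
  have hDax : IsAxisymmetricScalar (VectorCalculus.divergence u) := isAxisymmetricScalar_divergence hax
  -- the two sides as axisymmetric scalars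
  set L : EuclideanSpace ℝ (Fin 3) → ℝ := fun y =>
    (Δ (radVelQuot u)) y + 2 * radDerivQuot (radVelQuot u) y with hL
  set R : EuclideanSpace ℝ (Fin 3) → ℝ := fun y =>
    fderiv ℝ (angVortQuot u) y (EuclideanSpace.single 2 1) +
      radDerivQuot (VectorCalculus.divergence u) y with hR
  have hLax : IsAxisymmetricScalar L := fun θ y => by
    simp only [hL]
    rw [hρax.laplacian θ y, isAxisymmetricScalar_radDerivQuot hρ2 hρax θ y]
  have hRax : IsAxisymmetricScalar R := fun θ y => by
    have h1 : fderiv ℝ (angVortQuot u) (rotZ θ y) (EuclideanSpace.single 2 1) =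
        fderiv ℝ (angVortQuot u) y (EuclideanSpace.single 2 1) :=
      hωax.fderiv_apply_single_two (hω1.differentiable one_ne_zero) θ y
    simp only [hR]
    rw [h1, isAxisymmetricScalar_radDerivQuot hD2 hDax θ y]
  have hLc : Continuous L :=
    (continuous_laplacian hρ2).add (continuous_const.mul (continuous_radDerivQuot hρ2))
  have hRc : Continuous R :=
    (contDiff_fderiv_apply_const_succ (n := 0) (by exact_mod_cast hω1) _).continuous.add
      (continuous_radDerivQuot hD2)
  show L x = R x
  refine eq_of_eq_off_ker (EuclideanSpace.proj (0 : Fin 3)) ⟨EuclideanSpace.single 0 1, by simp⟩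
    hLc hRc (fun z hz => ?_) x
  have hz0 : z 0 ≠ 0 := by simpa using hz
  have hr : cylRadius z ≠ 0 := fun h => hz0 ((cylRadius_eq_zero_iff z).1 h).1
  -- rotate to the meridian half-plane
  rw [hLax.eq_comp_meridian z, hRax.eq_comp_meridian z]
  have hm1 : meridianPoint (meridian z) 1 = 0 := rfl
  have hm0 : meridianPoint (meridian z) 0 ≠ 0 := by
    rw [meridianPoint_apply_zero, meridian_apply]; exact hr
  exact laplacian_radVelQuot_add_eq_of_meridian hax hu hm1 hm0

end Literature.Analysis.SereginLogSwirlOrigin.EulerScaling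

end Part3

/-!
## Part 4 — port of `Summits/NavierStokesRegularity/NavierStokesRegularity/Theorems/AxisymmetricExtremalityAxisymmetricKatoGlobalStubSereginLogSwirlOriginLemma21Local.lean` (1 declarations kept)

# Seregin 2022, Lemma 2.1, localised: `∫|∇(u_r/r)|² ≤ ∫(ω_θ/r)² − 2∫(u_r/r)·(1/r)∂ᵣ(div u)` and
# `∫|∇²(u_r/r)|² ≤ ∫(∂₃(ω_θ/r) + (1/r)∂ᵣ(div u))²` for compactly supported axisymmetric fields
# that are NOT divergence free — crux stmt-NavierStokesRegularity-15453
# (`AxisymmetricExtremality.AxisymmetricKatoGlobal`), line registered, support for stub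
# `stub_sereginLogSwirlOrigin`

Support file (`--supports stmt-NavierStokesRegularity-15453`; theorems only, everything proved)
toward the registered stub `stub_sereginLogSwirlOrigin` = the named fact
`Literature.Analysis.FluidPDE.seregin2022_logSwirl_regularAtOrigin` (G. Seregin, J. Math. Fluid
Mech. 24 (2022), Paper 27 = arXiv:2201.00153, §2). Step 2 there is

> **Lemma 2.1.** Let `v̄ = v_re_r + v₃e₃` … and `Γ = ω_θ/r`. Then, for all `t ∈ ]-1,0[`,
> `‖∇(η³v_r/r)(·,t)‖_{2,𝒞} ≤ c‖η³Γ(·,t)‖_{2,𝒞} + C(v,η)`,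
> `‖∇̄²(η³v_r/r)(·,t)‖_{2,𝒞} ≤ c‖η³Γ,₃(·,t)‖_{2,𝒞} + C(v,η)`,

proved by localising the div–curl system to `ζv̄`, `ζ = η³`: "`div(ζv̄) = v̄·∇ζ`,
`curl(ζv̄) = ζω_θe_θ + ∇ζ × v̄`" (arXiv p. 5), the source `v̄·∇ζ` living on `supp |∇η|` where
`v, ∇v, ∇²v` are bounded, whence `C(v,η)`. The tree route to the global (divergence-free) core
avoids the Biot–Savart / Calderón–Zygmund passage of the paper: `Δρ + 2q_ρ = ∂₂Γ`
(`ρ = radVelQuot u = u_r/r`, `Γ = angVortQuot u = ω_θ/r`, `q_F = radDerivQuot F = (∂ᵣF)/r`) and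
two whole-space integrations by parts (`HouLeiLiEstimate`, sibling `…CFZBounds`). This file runs
the same two integrations by parts on the identity WITH the divergence source,
`Δρ + 2q_ρ = ∂₂Γ + q_{div u}` (sibling `…Lemma21LocalIdentity`, `laplacian_radVelQuot_add_eq`),
for every axisymmetric `u : ℝ³ → ℝ³` with compact support (the localised field `ζv̄` is of this
kind), and obtains Lemma 2.1 in the form with explicit error terms:

* `integral_gradSq_radVelQuot_le_sub_of_hasCompactSupport` (registered sub-goal; `u ∈ C⁴`) —
  `∫ Σᵢ(∂ᵢρ)² ≤ ∫ Γ² − 2 ∫ ρ · q_{div u}`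
  (pair the identity with `ρ`: `∫|∇ρ|² − 2∫ρq_ρ = ∫Γ∂₂ρ − ∫ρ q_{div u}`, `∫ρq_ρ ≤ 0` is the axis
  term, `∫Γ∂₂ρ ≤ ½∫Γ² + ½∫(∂₂ρ)²`);
* `integral_hessianSq_radVelQuot_le_of_hasCompactSupport'` (registered sub-goal; `u ∈ C⁵`) —
  `∫ Σᵢⱼ(∂ⱼ∂ᵢρ)² ≤ ∫ (∂₂Γ + q_{div u})²`
  (`∫Σᵢⱼ(∂ⱼ∂ᵢρ)² = ∫(Δρ)² ≤ ∫(Δρ + 2q_ρ)²`, `integral_laplacian_sq_le`), and the split form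
  `integral_hessianSq_radVelQuot_le_two_mul_add` — `≤ 2∫(∂₂Γ)² + 2∫q_{div u}²`.

For `div u = 0` these are the tree's Chen–Fang–Zhang / Lei–Zhang bounds with constant `1`
(`integral_gradSq_radVelQuot_le_of_hasCompactSupport`,
`integral_hessianSq_radVelQuot_le_of_hasCompactSupport`). For `u = ζv` (`v` smooth, axisymmetric
and divergence free near `tsupport ζ`): `div u = v·∇ζ`, so `q_{div u}` is supported in
`tsupport ζ ∩ supp |∇ζ|` and the two error terms are the printed `C(v,η)` (sibling file
`…Lemma21LocalCutoff`, the product rules for `radVelQuot (ζ • v)`, `angVortQuot (ζ • v)`).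

## Mathlib / tree search

Tree inputs: `laplacian_radVelQuot_add_eq`, `isAxisymmetricScalar_divergence`
(`…Lemma21LocalIdentity`); `hasCompactSupport_radVelQuot/angVortQuot/radDerivQuot`,
`memLp_fderiv_apply_of_hasCompactSupport`, `memLp_fderiv_fderiv_apply_of_hasCompactSupport`
(`…CFZBounds`); `IsAxisymmetricScalar.integral_mul_radDerivQuot_nonpos`,
`integral_mul_fderiv_fderiv_eq_neg_sq`, `integral_mul_fderiv_eq_neg_of_differentiable`,
`integral_laplacian_sq_le` (`HouLeiLiEstimate`, model `IsAxisymmetric.integral_gradSq_radVelQuot_le`);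
`memLp_coord_mul_fderiv_radDerivQuot`, `integral_sum_sq_fderiv_fderiv_eq_integral_laplacian_sq_of_memLp`
(`AxisymGradientField`); `contDiff_divergence`, `divergence_eq_sum_three`. Mathlib:
`Continuous.memLp_of_hasCompactSupport`, `HasCompactSupport.mono'`, `fderiv_of_notMem_tsupport`.
`lean search 'integral_gradSq_radVelQuot_le_sub|integral_hessianSq_radVelQuot_le_of_hasCompactSupport.|hasCompactSupport_divergence_of'`:
no matches (2026-08-17; `hasCompactSupport_divergence` exists in `CalderonSplittingLp`, outside
this import cone).

## References

* G. Seregin, J. Math. Fluid Mech. 24 (2022), Paper No. 27 = arXiv:2201.00153, §2, Lemma 2.1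
  and its proof (arXiv p. 5). [`Seregin2022LocalAxisym`]
* Z. Lei, Q. S. Zhang, Pacific J. Math. 289 (2017) 169–187 = arXiv:1505.02628, Lemma 2.1;
  H. Chen, D. Fang, T. Zhang, Discrete Contin. Dyn. Syst. 37 (2017) 1923–1939, Lemma 2.3.
  [`LeiZhang2017`, `ChenFangZhang2017`]

Not carried from this source module (not needed by the declarations re-homed here; their consumers are Summits-side): `hasCompactSupport_divergence_of_hasCompactSupport`, `memLp_radDerivQuot_divergence`, `integral_gradSq_radVelQuot_le_sub_of_hasCompactSupport`, `integral_hessianSq_radVelQuot_le_two_mul_add`.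
-/

section Part4

open _root_.MeasureTheory _root_.Set _root_.Filter _root_.Topology _root_.Function
open scoped _root_.ENNReal _root_.ContDiff Laplacian
open Literature.Analysis.FluidPDE

namespace Literature.Analysis.SereginLogSwirlOrigin.EulerScaling

variable {u : EuclideanSpace ℝ (Fin 3) → EuclideanSpace ℝ (Fin 3)}

/-! ### Compact support of the divergence and of its radial derivative quotient -/

/-- **Seregin 2022, Lemma 2.1, second estimate, localised form with explicit error term**:
for every axisymmetric `u ∈ C⁵(ℝ³; ℝ³)` with compact support (divergence free or not),
`∫ Σᵢⱼ (∂ⱼ∂ᵢ(u_r/r))² ≤ ∫ (∂₃(ω_θ/r) + (1/r)∂ᵣ(div u))²`, i.e.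
`∫|∇²ρ|² ≤ ∫(∂₂Γ + q_{div u})²`. Proof: `∫Σᵢⱼ(∂ⱼ∂ᵢρ)² = ∫(Δρ)²` (Hessian–Laplacian identity in
`L²`), `∫(Δρ)² ≤ ∫(Δρ + 2q_ρ)²` (`integral_laplacian_sq_le`: the cross term is
`8∫q_ρ² + 4∫∂₂∂₂ρ q_ρ ≥ 0`), and `Δρ + 2q_ρ = ∂₂Γ + q_{div u}` (`laplacian_radVelQuot_add_eq`).
For `div u = 0` this is Chen–Fang–Zhang's `‖∇̄²W‖₂ ≤ c‖Γ,₃‖₂` with `c = 1` and the full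
Cartesian Hessian; for `u = ζv̄` the extra `q_{div u}` is Seregin's `C(v,η)`. Registered
sub-goal toward `stub_sereginLogSwirlOrigin`. [cite: Seregin2022LocalAxisym, §2 Lemma 2.1, second estimate (arXiv:2201.00153 p. 5)] [cite: LeiZhang2017, Lemma 2.1 (second estimate)] -/
theorem integral_hessianSq_radVelQuot_le_of_hasCompactSupport' : ∀ u : EuclideanSpace ℝ (Fin 3) → EuclideanSpace ℝ (Fin 3), ContDiff ℝ 5 u → HasCompactSupport u → IsAxisymmetric u → ∫ x, ∑ i : Fin 3, ∑ j : Fin 3, (fderiv ℝ (fun y => fderiv ℝ (radVelQuot u) y (EuclideanSpace.single i 1)) x (EuclideanSpace.single j 1)) ^ 2 ≤ ∫ x, (fderiv ℝ (angVortQuot u) x (EuclideanSpace.single 2 1) + radDerivQuot (VectorCalculus.divergence u) x) ^ 2 := by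
  intro u hu hc hax
  have hu2 : ContDiff ℝ 2 u := hu.of_le (by norm_num)
  have hu4 : ContDiff ℝ 4 u := hu.of_le (by norm_num)
  have hρ3 : ContDiff ℝ 3 (radVelQuot u) := contDiff_radVelQuot (n := 3) (by exact_mod_cast hu)
  have hρ2 : ContDiff ℝ 2 (radVelQuot u) := hρ3.of_le (by norm_num)
  have hρ1 : ContDiff ℝ 1 (radVelQuot u) := hρ3.of_le (by norm_num)
  have hρax : IsAxisymmetricScalar (radVelQuot u) := hax.isAxisymmetricScalar_radVelQuot hu2
  have hρc : HasCompactSupport (radVelQuot u) := hasCompactSupport_radVelQuot hu2 hax hc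
  have hq : MemLp (radDerivQuot (radVelQuot u)) 2 volume :=
    (continuous_radDerivQuot hρ2).memLp_of_hasCompactSupport
      (hasCompactSupport_radDerivQuot hρ2 hρax hρc)
  have hG := memLp_fderiv_apply_of_hasCompactSupport hρ1 hρc
  have hGG := memLp_fderiv_fderiv_apply_of_hasCompactSupport hρ2 hρc
  -- the partial derivatives `∂ᵢρ ∈ C²` are compactly supported
  have hGi2 : ∀ v : EuclideanSpace ℝ (Fin 3), ContDiff ℝ 2 fun y => fderiv ℝ (radVelQuot u) y v :=
    fun v => contDiff_fderiv_apply_const_succ (n := 2) (by exact_mod_cast hρ3) v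
  have hGic : ∀ v : EuclideanSpace ℝ (Fin 3),
      HasCompactSupport fun y => fderiv ℝ (radVelQuot u) y v := fun v => hρc.fderiv_apply ℝ v
  have hGGG : ∀ i j : Fin 3, MemLp (fun x => fderiv ℝ (fun y => fderiv ℝ (fun z =>
      fderiv ℝ (radVelQuot u) z (EuclideanSpace.single i 1)) y (EuclideanSpace.single j 1)) x
      (EuclideanSpace.single j 1)) 2 volume := fun i j =>
    memLp_fderiv_fderiv_apply_of_hasCompactSupport (hGi2 _) (hGic _) _ _
  have hqH : MemLp (radDerivQuot fun y => fderiv ℝ (radVelQuot u) y (EuclideanSpace.single 2 1))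
      2 volume :=
    (continuous_radDerivQuot (hGi2 _)).memLp_of_hasCompactSupport
      (hasCompactSupport_radDerivQuot (hGi2 _)
        (hρax.fderiv_apply_single_two (hρ2.differentiable two_ne_zero)) (hGic _))
  have hx0 := memLp_coord_mul_fderiv_radDerivQuot hρ3 hρax (Or.inl rfl) hq (hGG _ _)
  have hx1 := memLp_coord_mul_fderiv_radDerivQuot hρ3 hρax (Or.inr rfl) hq (hGG _ _)
  rw [integral_sum_sq_fderiv_fderiv_eq_integral_laplacian_sq_of_memLp hρ3 (fun i => hG _)
    (fun i j => hGG _ _) hGGG]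
  have h := integral_laplacian_sq_le hρ3 hρax hq (hG _) (hG _) (hG _) (hGG _ _) (hGG _ _)
    (hGG _ _) hx0 hx1 hqH
  refine h.trans_eq (integral_congr_ae (Eventually.of_forall fun x => ?_))
  simp only
  rw [laplacian_radVelQuot_add_eq u hax hu4 x]

end Literature.Analysis.SereginLogSwirlOrigin.EulerScaling

end Part4

/-!
## Part 5 — port of `Summits/NavierStokesRegularity/NavierStokesRegularity/Theorems/AxisymmetricExtremalityAxisymmetricKatoGlobalStubSereginLogSwirlOriginLemma21LocalCutoff.lean` (8 declarations kept)

# Seregin 2022, Lemma 2.1 for the cut-off field `ζv`: `∇(ζv_r/r)` and `∇²(ζv_r/r)` against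
# `ζΓ`, `∂₃(ζΓ)` plus explicit error terms living on `supp |∇ζ|` — crux
# stmt-NavierStokesRegularity-15453 (`AxisymmetricExtremality.AxisymmetricKatoGlobal`), line
# registered, support for stub `stub_sereginLogSwirlOrigin`

Support file (`--supports stmt-NavierStokesRegularity-15453`; theorems only, everything proved)
toward the registered stub `stub_sereginLogSwirlOrigin` = the named fact
`Literature.Analysis.FluidPDE.seregin2022_logSwirl_regularAtOrigin` (G. Seregin, J. Math. Fluid
Mech. 24 (2022), Paper 27 = arXiv:2201.00153, §2). Lemma 2.1 there (arXiv p. 5):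

> `‖∇(η³v_r/r)(·,t)‖_{2,𝒞} ≤ c‖η³Γ(·,t)‖_{2,𝒞} + C(v,η)`,
> `‖∇̄²(η³v_r/r)(·,t)‖_{2,𝒞} ≤ c‖η³Γ,₃(·,t)‖_{2,𝒞} + C(v,η)` (`Γ = ω_θ/r`),

"`f ≠ 0` only if `|∇η| > 0`. In the set `supp |∇η|`, functions `v`, `∇v`, and `∇²v` are
bounded … These terms contain `v₃, v_{r,3}, v_{3,r}, v_{3,rr}, v_{3,r}/r, v_{r,3r}, v_{r,3}/r`."

This file specialises the localised bounds of the sibling file `…Lemma21Local`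
(`∫|∇ρ_U|² ≤ ∫Γ_U² − 2∫ρ_U q_{div U}`, `∫|∇²ρ_U|² ≤ ∫(∂₂Γ_U + q_{div U})²`, `U` axisymmetric
with compact support) to the cut-off field `U = ζv` (`ζ = η³` an axisymmetric compactly
supported scalar, `v` axisymmetric and divergence free on `tsupport ζ`; the swirl component of
`v` enters none of the quantities below, so no poloidal projection `v̄` is needed), through the
three product rules

* `radVelQuot_smul` — `(ζv)_r/r = ζ · (v_r/r)`, i.e. `radVelQuot (ζ • v) = ζ ρ` (`ρ = radVelQuot v`);
* `angVortQuot_smul` — `ω_θ(ζv)/r = ζΓ + ∂₃ζ · (v_r/r) − (∂ᵣζ/r) · v₃`, i.e.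
  `angVortQuot (ζ • v) = ζΓ + (∂₂ζ) ρ − q_ζ v₂` (`Γ = angVortQuot v`, `q_ζ = radDerivQuot ζ`;
  this is `curl(ζv̄) = ζω_θe_θ + ∇ζ × v̄` of the paper, `θ`-component, divided by `r`);
* `divergence_smul_eq_fderiv_apply` — `div (ζv) = ∇ζ · v` (`div v = 0` on `tsupport ζ`),

obtaining (registered sub-goals toward `stub_sereginLogSwirlOrigin`)

* `integral_gradSq_cutoff_radVelQuot_le` —
  `∫|∇(ζρ)|² ≤ ∫(ζΓ + ∂₂ζ ρ − q_ζ v₂)² − 2∫ ζρ · q_{∇ζ·v}` (`ζ, v ∈ C⁴`);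
* `integral_hessianSq_cutoff_radVelQuot_le` —
  `∫|∇²(ζρ)|² ≤ ∫(∂₂(ζΓ + ∂₂ζ ρ − q_ζ v₂) + q_{∇ζ·v})²` (`ζ, v ∈ C⁵`),

with the full Cartesian Hessian on the left, and the split forms
`integral_gradSq_cutoff_radVelQuot_le_two_mul` (`≤ 2∫(ζΓ)² + C²`),
`integral_hessianSq_cutoff_radVelQuot_le_three_mul` (`≤ 3∫(∂₂(ζΓ))² + C²`) with `C²` an explicit
sum of integrals of the error functions. The error functions `∂₂ζ ρ − q_ζ v₂`,
`ζρ · q_{∇ζ·v}` and `q_{∇ζ·v}` vanish off `supp |∇ζ|` and are the paper's `C(v,η)`: they are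
polynomial in `ζ`-derivatives and in `ρ = v_r/r`, `v₃`, `(1/r)∂ᵣ(∇ζ·v)` — the listed
`v₃, v_{r,3}/r, v_{3,r}/r, …` — hence bounded by `sup_{supp ∇ζ} (|v| + |∇v| + |∇²v|)` times
constants of `ζ`.

## Mathlib / tree search

Tree inputs: `integral_gradSq_radVelQuot_le_sub_of_hasCompactSupport`,
`integral_hessianSq_radVelQuot_le_of_hasCompactSupport'` (`…Lemma21Local`);
`IsAxisymmetric.cylRadius_sq_mul_radVelQuot/angVortQuot` (`AxisymHouLiVariables`),
`mul_radDerivQuot_eq_fderiv_zero/one` (`AxisymRadialQuotient`), `eq_of_eq_off_ker`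
(`AxisymmetricLiftR5`), `divergence_smul_apply` (`VectorCalculus`), `curl` (definition).
Mathlib: `fderiv_fun_smul`, `HasCompactSupport.smul_right`, `InnerProductSpace.toDual_symm_apply`.
`lean search 'radVelQuot_smul|angVortQuot_smul|cutoff_radVelQuot'`: no matches (2026-08-17).

## References

* G. Seregin, J. Math. Fluid Mech. 24 (2022), Paper No. 27 = arXiv:2201.00153, §2, Lemma 2.1
  and its proof (arXiv p. 5). [`Seregin2022LocalAxisym`]
* H. Chen, D. Fang, T. Zhang, Discrete Contin. Dyn. Syst. 37 (2017) 1923–1939, Lemma 2.3.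
  [`ChenFangZhang2017`]

Not carried from this source module (not needed by the declarations re-homed here; their consumers are Summits-side): `integral_gradSq_cutoff_radVelQuot_le`, `integral_gradSq_cutoff_radVelQuot_le_two_mul`.
-/

section Part5

open _root_.MeasureTheory _root_.Set _root_.Filter _root_.Topology _root_.Function _root_.InnerProductSpace
open scoped _root_.ENNReal _root_.ContDiff
open Literature.Analysis.FluidPDE

namespace Literature.Analysis.SereginLogSwirlOrigin.EulerScaling

variable {ζ : EuclideanSpace ℝ (Fin 3) → ℝ} {v : EuclideanSpace ℝ (Fin 3) → EuclideanSpace ℝ (Fin 3)}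

/-! ### The cut-off field `ζv` and its Hou–Li quotients -/

/-- `ζv` is axisymmetric for an axisymmetric scalar `ζ` and an axisymmetric field `v`
(`R_θ` is linear). [folklore]
[cite: Seregin2022LocalAxisym, Lemma 2.1 (arXiv:2201.00153 pp. 4–7) (source of the ARGUMENT this module implements; this declaration is the cell’s own lemma or plumbing, NOT a printed statement)] -/
theorem isAxisymmetric_smul_of_isAxisymmetricScalar (hζax : IsAxisymmetricScalar ζ)
    (hvax : IsAxisymmetric v) : IsAxisymmetric fun y => ζ y • v y := fun θ x => by
  simp only [hζax θ x, hvax θ x]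
  exact (map_smul (rotZLIE θ) (ζ x) (v x)).symm

/-- **The swirl of `curl (ζv)`**: `swirl (curl (ζv)) = ζ swirl (curl v) + ∂₂ζ (x₀v₀ + x₁v₁)
− v₂ (x₀∂₀ζ + x₁∂₁ζ)` at every point of differentiability (the `θ`-component of
`curl(ζv) = ζ curl v + ∇ζ × v`, times `r`). [folklore]
[cite: Seregin2022LocalAxisym, Lemma 2.1 (arXiv:2201.00153 pp. 4–7) (source of the ARGUMENT this module implements; this declaration is the cell’s own lemma or plumbing, NOT a printed statement)] -/
theorem swirl_curl_smul {x : EuclideanSpace ℝ (Fin 3)} (hζ : DifferentiableAt ℝ ζ x)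
    (hv : DifferentiableAt ℝ v x) :
    swirl (Literature.Analysis.FluidPDE.curl fun y => ζ y • v y) x =
      ζ x * swirl (Literature.Analysis.FluidPDE.curl v) x +
        fderiv ℝ ζ x (EuclideanSpace.single 2 1) * (x 0 * v x 0 + x 1 * v x 1) -
        v x 2 * (x 0 * fderiv ℝ ζ x (EuclideanSpace.single 0 1) +
          x 1 * fderiv ℝ ζ x (EuclideanSpace.single 1 1)) := by
  simp only [swirl, Literature.Analysis.FluidPDE.curl, fderiv_fun_smul hζ hv]
  simp
  ring

/-- **`(ζv)_r/r = ζ · v_r/r`**: `radVelQuot (ζ • v) = ζ · radVelQuot v` for an axisymmetric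
scalar `ζ ∈ C²` and an axisymmetric `v ∈ C²` (off the axis both are `(x₀ζv₀ + x₁ζv₁)/r²`; both
are continuous). [folklore]
[cite: Seregin2022LocalAxisym, Lemma 2.1 (arXiv:2201.00153 pp. 4–7) (source of the ARGUMENT this module implements; this declaration is the cell’s own lemma or plumbing, NOT a printed statement)] -/
theorem radVelQuot_smul (hζ : ContDiff ℝ 2 ζ) (hζax : IsAxisymmetricScalar ζ) (hv : ContDiff ℝ 2 v)
    (hvax : IsAxisymmetric v) :
    radVelQuot (fun y => ζ y • v y) = fun x => ζ x * radVelQuot v x := by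
  have hw2 : ContDiff ℝ 2 fun y => ζ y • v y := hζ.smul hv
  have hwax : IsAxisymmetric fun y => ζ y • v y := isAxisymmetric_smul_of_isAxisymmetricScalar hζax hvax
  have hc1 : Continuous (radVelQuot fun y => ζ y • v y) :=
    (contDiff_radVelQuot (n := 0) (by exact_mod_cast hw2)).continuous
  have hc2 : Continuous fun x => ζ x * radVelQuot v x :=
    hζ.continuous.mul (contDiff_radVelQuot (n := 0) (by exact_mod_cast hv)).continuous
  funext x
  refine eq_of_eq_off_ker (EuclideanSpace.proj (0 : Fin 3)) ⟨EuclideanSpace.single 0 1, by simp⟩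
    hc1 hc2 (fun z hz => ?_) x
  have hz0 : z 0 ≠ 0 := by simpa using hz
  have hr : cylRadius z ≠ 0 := fun h => hz0 ((cylRadius_eq_zero_iff z).1 h).1
  have h1 := hwax.cylRadius_sq_mul_radVelQuot hw2 z
  have h2 := hvax.cylRadius_sq_mul_radVelQuot hv z
  simp only [PiLp.smul_apply, smul_eq_mul] at h1
  apply mul_left_cancel₀ (pow_ne_zero 2 hr)
  rw [h1]
  linear_combination -(ζ z) * h2

/-- **`ω_θ(ζv)/r = ζΓ + ∂₃ζ · v_r/r − (∂ᵣζ/r) v₃`**: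
`angVortQuot (ζ • v) = ζ · angVortQuot v + (∂₂ζ · radVelQuot v − radDerivQuot ζ · v₂)` for an
axisymmetric scalar `ζ ∈ C³` and an axisymmetric `v ∈ C³` — the `θ`-component of Seregin's
`curl(ζv̄) = ζω_θe_θ + ∇ζ × v̄` divided by `r` (`swirl_curl_smul`, `x₀∂₀ζ + x₁∂₁ζ = r² q_ζ`,
`x₀v₀ + x₁v₁ = r² ρ`; continuity across the axis). The second summand is supported in
`supp |∇ζ|` and involves only `v_r/r` and `v₃` ("`|v_r/r| ≤ |∇v|`"). [cite: Seregin2022LocalAxisym, §2 Lemma 2.1, proof (arXiv:2201.00153 p. 5: curl(ζv̄) = ζω_θ e_θ + ∇ζ × v̄)] -/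
theorem angVortQuot_smul (hζ : ContDiff ℝ 3 ζ) (hζax : IsAxisymmetricScalar ζ) (hv : ContDiff ℝ 3 v)
    (hvax : IsAxisymmetric v) :
    angVortQuot (fun y => ζ y • v y) = fun x => ζ x * angVortQuot v x +
      (fderiv ℝ ζ x (EuclideanSpace.single 2 1) * radVelQuot v x - radDerivQuot ζ x * v x 2) := by
  have hζ2 : ContDiff ℝ 2 ζ := hζ.of_le (by norm_num)
  have hv2 : ContDiff ℝ 2 v := hv.of_le (by norm_num)
  have hw3 : ContDiff ℝ 3 fun y => ζ y • v y := hζ.smul hv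
  have hwax : IsAxisymmetric fun y => ζ y • v y := isAxisymmetric_smul_of_isAxisymmetricScalar hζax hvax
  have hc1 : Continuous (angVortQuot fun y => ζ y • v y) :=
    (contDiff_angVortQuot (n := 0) (by exact_mod_cast hw3)).continuous
  have hc2 : Continuous fun x => ζ x * angVortQuot v x +
      (fderiv ℝ ζ x (EuclideanSpace.single 2 1) * radVelQuot v x - radDerivQuot ζ x * v x 2) :=
    (hζ.continuous.mul (contDiff_angVortQuot (n := 0) (by exact_mod_cast hv)).continuous).add
      ((((hζ.continuous_fderiv (by norm_num)).clm_apply continuous_const).mul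
        (contDiff_radVelQuot (n := 0) (by exact_mod_cast hv2)).continuous).sub
        ((continuous_radDerivQuot hζ2).mul
          ((contDiff_piLp_apply (𝕜 := ℝ) (p := 2) (n := 0) (i := (2 : Fin 3))).continuous.comp
            hv.continuous)))
  funext x
  refine eq_of_eq_off_ker (EuclideanSpace.proj (0 : Fin 3)) ⟨EuclideanSpace.single 0 1, by simp⟩
    hc1 hc2 (fun z hz => ?_) x
  have hz0 : z 0 ≠ 0 := by simpa using hz
  have hr : cylRadius z ≠ 0 := fun h => hz0 ((cylRadius_eq_zero_iff z).1 h).1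
  have h1 := hwax.cylRadius_sq_mul_angVortQuot hw3 z
  rw [swirl_curl_smul ((hζ.differentiable (by norm_num)) z) ((hv.differentiable (by norm_num)) z)]
    at h1
  have h2 := hvax.cylRadius_sq_mul_angVortQuot hv z
  have h3 := hvax.cylRadius_sq_mul_radVelQuot hv2 z
  have h4 := mul_radDerivQuot_eq_fderiv_zero hζ2 hζax z
  have h5 := mul_radDerivQuot_eq_fderiv_one hζ2 hζax z
  have h6 := cylRadius_sq z
  apply mul_left_cancel₀ (pow_ne_zero 2 hr)
  rw [h1]
  linear_combination (-(ζ z)) * h2 - fderiv ℝ ζ z (EuclideanSpace.single 2 1) * h3 +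
    (v z 2 * z 0) * h4 + (v z 2 * z 1) * h5 + (radDerivQuot ζ z * v z 2) * h6

/-- **`div (ζv) = ∇ζ · v`** when `div v = 0` on `tsupport ζ` (`div(ζv) = ζ div v + ∇ζ·v`;
Seregin: "`div(ζv̄) = v̄·∇ζ`"). [cite: Seregin2022LocalAxisym, §2 Lemma 2.1, proof (arXiv:2201.00153 p. 5: div(ζv̄) = v̄·∇ζ)] -/
theorem divergence_smul_eq_fderiv_apply (hζ : Differentiable ℝ ζ) (hv : Differentiable ℝ v)
    (hdiv : ∀ y ∈ tsupport ζ, VectorCalculus.divergence v y = 0) :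
    VectorCalculus.divergence (fun y => ζ y • v y) = fun x => fderiv ℝ ζ x (v x) := by
  funext x
  rw [divergence_smul_apply (hζ x) (hv x)]
  have h0 : ζ x * VectorCalculus.divergence v x = 0 := by
    by_cases hx : x ∈ tsupport ζ
    · rw [hdiv x hx, mul_zero]
    · rw [image_eq_zero_of_notMem_tsupport hx, zero_mul]
  rw [h0, zero_add, gradient, real_inner_comm, InnerProductSpace.toDual_symm_apply]

/-! ### Lemma 2.1 for `ζv` -/

/-- **Seregin 2022, Lemma 2.1, second estimate, for the cut-off field `ζv`**: for an
axisymmetric scalar `ζ ∈ C⁵` with compact support and an axisymmetric `v ∈ C⁵(ℝ³; ℝ³)` with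
`div v = 0` on `tsupport ζ`:
`∫ Σᵢⱼ(∂ⱼ∂ᵢ(ζρ))² ≤ ∫ (∂₂(ζΓ + ∂₂ζ ρ − q_ζ v₂) + q_{∇ζ·v})²` (full Cartesian Hessian on the
left; the leading term on the right is `∂₂(ζΓ) = (ζΓ),₃`, `c = 1`, and `∂₂(∂₂ζ ρ − q_ζ v₂)`,
`q_{∇ζ·v}` vanish off `supp |∇ζ|` and make up the printed `C(v,η)`). This is
`integral_hessianSq_radVelQuot_le_of_hasCompactSupport'` for `U = ζ • v` rewritten through the
product rules. Registered sub-goal toward `stub_sereginLogSwirlOrigin`. [cite: Seregin2022LocalAxisym, §2 Lemma 2.1, second estimate (arXiv:2201.00153 p. 5)] -/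
theorem integral_hessianSq_cutoff_radVelQuot_le : ∀ (ζ : EuclideanSpace ℝ (Fin 3) → ℝ) (v : EuclideanSpace ℝ (Fin 3) → EuclideanSpace ℝ (Fin 3)), ContDiff ℝ 5 ζ → HasCompactSupport ζ → IsAxisymmetricScalar ζ → ContDiff ℝ 5 v → IsAxisymmetric v → (∀ y ∈ tsupport ζ, VectorCalculus.divergence v y = 0) → ∫ x, ∑ i : Fin 3, ∑ j : Fin 3, (fderiv ℝ (fun y => fderiv ℝ (fun z => ζ z * radVelQuot v z) y (EuclideanSpace.single i 1)) x (EuclideanSpace.single j 1)) ^ 2 ≤ ∫ x, (fderiv ℝ (fun y => ζ y * angVortQuot v y + (fderiv ℝ ζ y (EuclideanSpace.single 2 1) * radVelQuot v y - radDerivQuot ζ y * v y 2)) x (EuclideanSpace.single 2 1) + radDerivQuot (fun y => fderiv ℝ ζ y (v y)) x) ^ 2 := by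
  intro ζ v hζ hζc hζax hv hvax hdiv
  have h := integral_hessianSq_radVelQuot_le_of_hasCompactSupport' (fun y => ζ y • v y)
    (hζ.smul hv) hζc.smul_right (isAxisymmetric_smul_of_isAxisymmetricScalar hζax hvax)
  rw [radVelQuot_smul (hζ.of_le (by norm_num)) hζax (hv.of_le (by norm_num)) hvax,
    angVortQuot_smul (hζ.of_le (by norm_num)) hζax (hv.of_le (by norm_num)) hvax,
    divergence_smul_eq_fderiv_apply (hζ.differentiable (by norm_num))
      (hv.differentiable (by norm_num)) hdiv] at h
  exact h

/-! ### Split forms: `c = 2, 3` times the leading term plus `C(v,η)²` -/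

/-- The error function `∂₂ζ ρ − q_ζ v₂` and everything built from `ζ` vanish off `tsupport ζ`:
a continuous real function vanishing off `tsupport ζ`, `ζ` compactly supported, is integrable.
[folklore]
[cite: Seregin2022LocalAxisym, Lemma 2.1 (arXiv:2201.00153 pp. 4–7) (source of the ARGUMENT this module implements; this declaration is the cell’s own lemma or plumbing, NOT a printed statement)] -/
theorem integrable_of_eq_zero_off_tsupport (hζc : HasCompactSupport ζ)
    {f : EuclideanSpace ℝ (Fin 3) → ℝ} (hf : Continuous f) (h0 : ∀ x ∉ tsupport ζ, f x = 0) :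
    Integrable f :=
  integrable_of_continuous_of_forall_notMem hζc hf h0

/-- **Second estimate, split form**: under the hypotheses of
`integral_hessianSq_cutoff_radVelQuot_le`,
`∫|∇²(ζρ)|² ≤ 3∫(∂₂(ζΓ))² + (3∫(∂₂(∂₂ζ ρ − q_ζ v₂))² + 3∫q_{∇ζ·v}²)` — Seregin's
`‖∇̄²(ζv_r/r)‖₂ ≤ c‖(ζΓ),₃‖₂ + C(v,η)` with `c² = 3`, the full Cartesian Hessian, and
`C(v,η)²` the bracket (integrals over `tsupport ζ ∩ supp |∇ζ|`). [cite: Seregin2022LocalAxisym, §2 Lemma 2.1, second estimate (arXiv:2201.00153 p. 5)] -/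
theorem integral_hessianSq_cutoff_radVelQuot_le_three_mul (hζ : ContDiff ℝ 5 ζ)
    (hζc : HasCompactSupport ζ) (hζax : IsAxisymmetricScalar ζ) (hv : ContDiff ℝ 5 v)
    (hvax : IsAxisymmetric v) (hdiv : ∀ y ∈ tsupport ζ, VectorCalculus.divergence v y = 0) :
    ∫ x, ∑ i : Fin 3, ∑ j : Fin 3, (fderiv ℝ (fun y =>
        fderiv ℝ (fun z => ζ z * radVelQuot v z) y (EuclideanSpace.single i 1)) x
          (EuclideanSpace.single j 1)) ^ 2 ≤
      3 * (∫ x, fderiv ℝ (fun y => ζ y * angVortQuot v y) x (EuclideanSpace.single 2 1) ^ 2) +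
        (3 * (∫ x, fderiv ℝ (fun y => fderiv ℝ ζ y (EuclideanSpace.single 2 1) * radVelQuot v y -
            radDerivQuot ζ y * v y 2) x (EuclideanSpace.single 2 1) ^ 2) +
          3 * ∫ x, radDerivQuot (fun y => fderiv ℝ ζ y (v y)) x ^ 2) := by
  have h := integral_hessianSq_cutoff_radVelQuot_le ζ v hζ hζc hζax hv hvax hdiv
  have hζ2 : ContDiff ℝ 2 ζ := hζ.of_le (by norm_num)
  -- the three functions `A = ζΓ`, `B = ∂₂ζ ρ − q_ζ v₂`, `D = ∇ζ·v` are `C¹` and vanish off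
  -- `tsupport ζ`
  have hA1 : ContDiff ℝ 1 fun y => ζ y * angVortQuot v y := (hζ.of_le (by norm_num)).mul
    (contDiff_angVortQuot (n := 1) (by exact_mod_cast hv.of_le (by norm_num)))
  have hB1 : ContDiff ℝ 1 fun y => fderiv ℝ ζ y (EuclideanSpace.single 2 1) * radVelQuot v y -
      radDerivQuot ζ y * v y 2 :=
    (((hζ.fderiv_right (m := 1) (by norm_num)).clm_apply contDiff_const).mul
      (contDiff_radVelQuot (n := 1) (by exact_mod_cast hv.of_le (by norm_num)))).sub
      ((contDiff_radDerivQuot (n := 1) (by exact_mod_cast hζ.of_le (by norm_num))).mul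
        ((contDiff_piLp_apply (𝕜 := ℝ) (p := 2) (n := 1) (i := (2 : Fin 3))).comp
          (hv.of_le (by norm_num))))
  have hD2 : ContDiff ℝ 2 fun y => fderiv ℝ ζ y (v y) :=
    (hζ.fderiv_right (m := 2) (by norm_num)).clm_apply (hv.of_le (by norm_num))
  have hDax : IsAxisymmetricScalar fun y => fderiv ℝ ζ y (v y) := fun θ y => by
    simp only [hvax θ y]
    exact hζax.fderiv_rotZ_apply_rotZ (hζ.differentiable (by norm_num)) θ y (v y)
  have h0A : ∀ x ∉ tsupport ζ, ζ x * angVortQuot v x = 0 := fun x hx => by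
    rw [image_eq_zero_of_notMem_tsupport hx, zero_mul]
  have h0B : ∀ x ∉ tsupport ζ, fderiv ℝ ζ x (EuclideanSpace.single 2 1) * radVelQuot v x -
      radDerivQuot ζ x * v x 2 = 0 := fun x hx => by
    rw [fderiv_of_notMem_tsupport ℝ hx, radDerivQuot_eq_zero_of_notMem_tsupport hζ2 hζax hx]
    simp
  have h0D : ∀ x ∉ tsupport ζ, fderiv ℝ ζ x (v x) = 0 := fun x hx => by
    rw [fderiv_of_notMem_tsupport ℝ hx]; rfl
  have hDsub : tsupport (fun y => fderiv ℝ ζ y (v y)) ⊆ tsupport ζ :=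
    closure_minimal (fun y hy => by_contra fun h' => hy (h0D y h')) (isClosed_tsupport ζ)
  -- so `∂₂A`, `∂₂B`, `q_D` are continuous, vanish off `tsupport ζ`, and are square integrable
  have hcA : Continuous fun x => fderiv ℝ (fun y => ζ y * angVortQuot v y) x
      (EuclideanSpace.single 2 1) := (hA1.continuous_fderiv one_ne_zero).clm_apply continuous_const
  have hcB : Continuous fun x => fderiv ℝ (fun y => fderiv ℝ ζ y (EuclideanSpace.single 2 1) *
      radVelQuot v y - radDerivQuot ζ y * v y 2) x (EuclideanSpace.single 2 1) :=
    (hB1.continuous_fderiv one_ne_zero).clm_apply continuous_const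
  have hcD : Continuous (radDerivQuot fun y => fderiv ℝ ζ y (v y)) := continuous_radDerivQuot hD2
  have hIA : Integrable fun x => fderiv ℝ (fun y => ζ y * angVortQuot v y) x
      (EuclideanSpace.single 2 1) ^ 2 :=
    integrable_of_eq_zero_off_tsupport hζc (hcA.pow 2) fun x hx => by
      simp [fderiv_eq_zero_of_forall_notMem (isClosed_tsupport ζ) h0A hx]
  have hIB : Integrable fun x => fderiv ℝ (fun y => fderiv ℝ ζ y (EuclideanSpace.single 2 1) *
      radVelQuot v y - radDerivQuot ζ y * v y 2) x (EuclideanSpace.single 2 1) ^ 2 :=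
    integrable_of_eq_zero_off_tsupport hζc (hcB.pow 2) fun x hx => by
      simp [fderiv_eq_zero_of_forall_notMem (isClosed_tsupport ζ) h0B hx]
  have hID : Integrable fun x => radDerivQuot (fun y => fderiv ℝ ζ y (v y)) x ^ 2 :=
    integrable_of_eq_zero_off_tsupport hζc (hcD.pow 2) fun x hx => by
      simp [radDerivQuot_eq_zero_of_notMem_tsupport hD2 hDax fun h' => hx (hDsub h')]
  -- `∂₂(A + B) = ∂₂A + ∂₂B` and `(a + b + c)² ≤ 3a² + 3b² + 3c²`
  have hsplit : ∀ x, fderiv ℝ (fun y => ζ y * angVortQuot v y +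
      (fderiv ℝ ζ y (EuclideanSpace.single 2 1) * radVelQuot v y - radDerivQuot ζ y * v y 2)) x
      (EuclideanSpace.single 2 1) =
      fderiv ℝ (fun y => ζ y * angVortQuot v y) x (EuclideanSpace.single 2 1) +
        fderiv ℝ (fun y => fderiv ℝ ζ y (EuclideanSpace.single 2 1) * radVelQuot v y -
          radDerivQuot ζ y * v y 2) x (EuclideanSpace.single 2 1) := fun x => by
    rw [fderiv_fun_add ((hA1.differentiable one_ne_zero) x) ((hB1.differentiable one_ne_zero) x)]
    rfl
  have hIBD : Integrable fun x => 3 * fderiv ℝ (fun y => fderiv ℝ ζ y (EuclideanSpace.single 2 1) *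
      radVelQuot v y - radDerivQuot ζ y * v y 2) x (EuclideanSpace.single 2 1) ^ 2 +
      3 * radDerivQuot (fun y => fderiv ℝ ζ y (v y)) x ^ 2 := (hIB.const_mul 3).add (hID.const_mul 3)
  have hIABD : Integrable fun x => 3 * fderiv ℝ (fun y => ζ y * angVortQuot v y) x
      (EuclideanSpace.single 2 1) ^ 2 + (3 * fderiv ℝ (fun y =>
        fderiv ℝ ζ y (EuclideanSpace.single 2 1) * radVelQuot v y - radDerivQuot ζ y * v y 2) x
        (EuclideanSpace.single 2 1) ^ 2 + 3 * radDerivQuot (fun y => fderiv ℝ ζ y (v y)) x ^ 2) :=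
    (hIA.const_mul 3).add hIBD
  refine h.trans ?_
  rw [← integral_const_mul, ← integral_const_mul, ← integral_const_mul,
    ← integral_add (hIB.const_mul _) (hID.const_mul _), ← integral_add (hIA.const_mul _) hIBD]
  refine integral_mono_of_nonneg (Eventually.of_forall fun x => sq_nonneg _) hIABD
    (Eventually.of_forall fun x => ?_)
  beta_reduce
  rw [hsplit x]
  nlinarith [sq_nonneg (fderiv ℝ (fun y => ζ y * angVortQuot v y) x (EuclideanSpace.single 2 1) -
      fderiv ℝ (fun y => fderiv ℝ ζ y (EuclideanSpace.single 2 1) * radVelQuot v y -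
        radDerivQuot ζ y * v y 2) x (EuclideanSpace.single 2 1)),
    sq_nonneg (fderiv ℝ (fun y => ζ y * angVortQuot v y) x (EuclideanSpace.single 2 1) -
      radDerivQuot (fun y => fderiv ℝ ζ y (v y)) x),
    sq_nonneg (fderiv ℝ (fun y => fderiv ℝ ζ y (EuclideanSpace.single 2 1) * radVelQuot v y -
        radDerivQuot ζ y * v y 2) x (EuclideanSpace.single 2 1) -
      radDerivQuot (fun y => fderiv ℝ ζ y (v y)) x)]

end Literature.Analysis.SereginLogSwirlOrigin.EulerScaling

end Part5

/-!
## Part 6 — port of `Summits/NavierStokesRegularity/NavierStokesRegularity/Theorems/AxisymmetricExtremalityAxisymmetricKatoGlobalStubSereginLogSwirlOriginStep3KeyUnconditional.lean` (4 declarations kept)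

# Seregin 2022, §2 Step 3: the key estimate with Lemma 2.1 (ii) discharged — the Step-3 output
# `sup_t ∫(ζΓ)² + (ζΦ)²`, `∫∫|∇(ζΓ)|² + |∇(ζΦ)|²` bounded by data of `v` on `supp ∇ζ ∪ {r ≥ r₁}`
# and the swirl constant `C₁` only — crux stmt-NavierStokesRegularity-15453
# (`AxisymmetricExtremality.AxisymmetricKatoGlobal`), line registered, support for stub `stub_sereginLogSwirlOrigin`

Support file (`--supports stmt-NavierStokesRegularity-15453`; theorems only, everything proved)
toward the registered stub `stub_sereginLogSwirlOrigin` = the named fact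
`Literature.Analysis.FluidPDE.seregin2022_logSwirl_regularAtOrigin` (G. Seregin, J. Math. Fluid
Mech. 24 (2022), Paper 27 = arXiv:2201.00153, §2). The sibling file `…Step3KeyEstimate`
(`cutoff_energy_keyEstimate_of_lemma21`) proves the key estimate of Step 3 (arXiv p. 7,
"`sup_{-1<t<0}∫_𝒞 η⁶(|Γ|² + |Φ|²)dx + ∫_Q (η³|∇Φ|)² + (η³|∇Γ|)² dxdt ≤ C(v,η,r₁)`") for a
classical axisymmetric solution on a slab, taking Lemma 2.1 (ii) as the numeric hypothesis
`∫|∇²(ζv_r/r)|² ≤ c_L ∫|∇(ζΓ)|² + C_L` at every `t ∈ [t₁, t₂]` (full Cartesian Hessian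
`Σᵢⱼ(∂ⱼ∂ᵢ(ζ v_r/r))²`, real integrals, `ζ = η³`). The sibling file `…Lemma21LocalCutoff`
(`integral_hessianSq_cutoff_radVelQuot_le_three_mul`) proves Lemma 2.1 (ii) in the localised
split form `∫|∇²(ζρ)|² ≤ 3∫(∂₂(ζΓ))² + (3∫(∂₂E₁)² + 3∫q_D²)` with the two error functions
`E₁ = ∂₂ζ ρ − q_ζ v₂`, `q_D = radDerivQuot (∇ζ·v)` (`ρ = radVelQuot v = v_r/r`,
`q_ζ = radDerivQuot ζ = (∂ᵣζ)/r`), which live on `supp |∇ζ|` ("`f ≠ 0` only if `|∇η| > 0`. In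
the set `supp |∇η|`, functions `v`, `∇v`, and `∇²v` are bounded", arXiv p. 5). This file puts the
two together:

* `radDerivQuot_eq_zero_of_notMem_tsupport_fderiv` — `q_ζ = 0` off `tsupport (∇ζ)` (so the error
  functions vanish off `supp |∇ζ|`, not only off `supp ζ`);
* `integral_sq_le_of_abs_le_of_ne_zero` — `∫ f² ≤ P²|B(0,2)|` for a continuous `f` vanishing off
  `tsupport g ⊆ B(0,2)` with `|f| ≤ P` wherever `g ≠ 0`;
* `integral_fderiv_sq_le_integral_gradSq` — `∫(∂₂G)² ≤ ∫|∇G|²`;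
* `integral_hessianSq_cutoff_radVelQuot_le_of_pointwise` — **Lemma 2.1 (ii) in the numeric form
  consumed by Step 3**, at a fixed time: `∫|∇²(ζρ)|² ≤ 3∫|∇(ζΓ)|² + 3(P₃² + P₄²)V` from the
  pointwise bounds `|∂₂E₁| ≤ P₃`, `|q_D| ≤ P₄` on `{∇ζ ≠ 0}` and `|B(0,2)| ≤ V`
  (i.e. `c_L = 3`, `C_L = 3(P₃² + P₄²)V`);
* `cutoff_energy_keyEstimate_unconditional` (registered sub-goal) — **the key estimate of Step 3
  with Lemma 2.1 (ii) discharged**: `cutoff_energy_keyEstimate_of_lemma21` with its hypothesis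
  `∫|∇²(ζv_r/r)|² ≤ c_L∫|∇(ζΓ)|² + C_L` (and the constants `c_L, C_L`) removed, replaced by the
  two pointwise constants `P₃ ≥ |∂₂(∂₂ζ ρ − q_ζ v₂)|`, `P₄ ≥ |q_{∇ζ·v}|` on `{∇ζ(t,·) ≠ 0}`,
  `t ∈ [t₁, t₂]` — bounds of `v, ∇v, ∇²v` on `supp ∇η` of the same kind as the existing
  `P₀, P₁, P₂` (the paper's `C(v,η)` of Lemma 2.1: "these terms contain `v₃, v_{r,3}, v_{3,r},
  v_{3,rr}, v_{3,r}/r, v_{r,3r}, v_{r,3}/r`"). The inputs are now exactly: a classical axisymmetric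
  solution on the slab `(a, b) ⊇ [t₁, t₂]`, the cut-off `ζ` (jointly smooth, axisymmetric,
  supported in `𝒞`), the swirl bound (2.2) with constant `C₁` on `r < r₁`, pointwise bounds on
  `supp ∇ζ ∪ {r ≥ r₁}` (`M, Bcut, P₀, …, P₄`) and the smallness of `r₁`
  (`8C₁/ln(e/r₁) + 13C₁/ln²(e/r₁) + 4ε < 2ν`, the case `c_L = 3` of the sibling's
  `8C₁/ln(e/r₁) + C₁(1 + 4c_L)/ln²(e/r₁) + 4ε < 2ν`); nothing about second derivatives of
  `ζv_r/r` remains. Conclusion: with `E(t) = ∫(ζΓ)² + ∫(ζΦ)²`, `L = ln(e/r₁)`,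
  `K = E(t₁) + (Bcut + (12C₁(P₃² + P₄²)V/L² + ((P₀² + P₁²)/(2ε) + 2P₂)V) + 4MV)(t₂ − t₁)`:
  `sup_{[t₁,t₂]} E ≤ K` and `∫_{t₁}^{t₂}(∫|∇(ζΓ)|² + ∫|∇(ζΦ)|²) ≤ K/(2ν − 8C₁/L − (13C₁/L² + 4ε))`.

Regularity bookkeeping: `IsClassicalNSSolutionOn (Ioo a b)` makes every slice `v t` globally
`C^∞` and divergence free and `IsSmoothSpaceTimeOn (Ioo a b) ζ` makes `ζ t` globally `C^∞`, so
the Lemma's hypotheses (`ζ, v ∈ C⁵` globally, `div v = 0` on `tsupport ζ`, `ζ` compactly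
supported — `tsupport ζ ⊆ 𝒞 ⊆ B̄(0,2)`) hold at every `t ∈ [t₁, t₂] ⊆ (a, b)`; no bump
globalisation is needed at this level (it belongs to Step 1, with the cut-off).

What then remains of the named fact: the derivation of `M, Bcut, P₀, …, P₄` from sup-norm bounds
of `v, ∇v, ∇²v, ∇ω` on `supp ∇η ∪ {r ≥ r₁}` for the specific product cut-off of Step 1, Step 1
itself (first singular time, cut-off adapted to partial regularity, suitable weak → classical on
the clean slab) and the Step-4 assembly `C(R) → 0` (`…Step4AssemblyPoloidal`, `…VThetaPassage`,
`…Step4Endgame`).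

## Mathlib / tree search

Tree: `cutoff_energy_keyEstimate_of_lemma21` (`…Step3KeyEstimate`),
`integral_hessianSq_cutoff_radVelQuot_le_three_mul` (`…Lemma21LocalCutoff`),
`radDerivQuot_eq_zero_of_notMem_tsupport`, `eq_zero_of_forall_apply_zero_ne` (`…CFZBounds`),
`fderiv_eq_zero_of_forall_notMem` (`…CutoffDivCurl`), `hasCompactSupport_of_eq_zero`,
`continuous_fderiv_apply_of_contDiff` (`…Step3CutoffCalculus`), `spaceCyl_subset_closedBall`
(`…LerayLogHardy`), `mul_radDerivQuot_eq_fderiv_zero`, `continuous_radDerivQuot`,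
`IsAxisymmetricScalar.fderiv_rotZ_apply_rotZ` (`AxisymRadialQuotient`). Mathlib:
`norm_setIntegral_le_of_norm_le_const`, `setIntegral_eq_integral_of_forall_compl_eq_zero`,
`tsupport_fderiv_subset`, `closure_minimal`, `isClosed_le`, `sq_le_sq'`.
`lean search 'keyEstimate' --decl`: only `cutoff_energy_keyEstimate(_of_lemma21)` in this
namespace; `lean search 'notMem_tsupport_fderiv|keyEstimate_unconditional'`: no matches
(2026-08-17).

## References

* G. Seregin, J. Math. Fluid Mech. 24 (2022), Paper No. 27 = arXiv:2201.00153, §2, Lemma 2.1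
  (arXiv p. 5) and Step 3 (arXiv pp. 6–7, the key estimate). [`Seregin2022LocalAxisym`]

Not carried from this source module (not needed by the declarations re-homed here; their consumers are Summits-side): `cutoff_energy_keyEstimate_unconditional`.
-/

section Part6

open _root_.MeasureTheory _root_.Set _root_.Filter _root_.Topology _root_.Function _root_.Metric intervalIntegral
open scoped _root_.ENNReal _root_.ContDiff
open Literature.Analysis.FluidPDE

namespace Literature.Analysis.SereginLogSwirlOrigin.EulerScaling

/-! ### Error functions vanish off `supp |∇ζ|`; pointwise bounds integrate over `B̄(0,2)` -/

section Tools

variable {S : EuclideanSpace ℝ (Fin 3) → ℝ}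

/-- **`(∂ᵣS)/r` vanishes off the support of `∇S`**: for an axisymmetric scalar `S ∈ C²` and
`y ∉ tsupport (∇S)`, `radDerivQuot S y = 0` (off `{x₀ = 0}` it is `∂₀S/x₀` with `∂₀S = DS e₀ = 0`
there, and density; `S` itself need not vanish near `y`). [folklore]
[cite: Seregin2022LocalAxisym, Lemma 2.1 (arXiv:2201.00153 pp. 4–7) (source of the ARGUMENT this module implements; this declaration is the cell’s own lemma or plumbing, NOT a printed statement)] -/
theorem radDerivQuot_eq_zero_of_notMem_tsupport_fderiv (hS : ContDiff ℝ 2 S)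
    (hax : IsAxisymmetricScalar S) {y : EuclideanSpace ℝ (Fin 3)}
    (hy : y ∉ tsupport (fderiv ℝ S)) : radDerivQuot S y = 0 := by
  refine eq_zero_of_forall_apply_zero_ne (continuous_radDerivQuot hS)
    (isClosed_tsupport (fderiv ℝ S)).isOpen_compl (fun z hz hz0 => ?_) hy
  have h := mul_radDerivQuot_eq_fderiv_zero hS hax z
  rw [image_eq_zero_of_notMem_tsupport hz] at h
  simpa [hz0] using h

/-- **A pointwise bound on `{g ≠ 0}` integrates over `B̄(0,2)`**: if `f` is continuous, vanishes
off `tsupport g ⊆ B̄(0,2)` and `|f| ≤ P` wherever `g ≠ 0`, then `|f| ≤ P` on `tsupport g` by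
continuity and `∫ f² ≤ P² |B̄(0,2)|`. [folklore]
[cite: Seregin2022LocalAxisym, Lemma 2.1 (arXiv:2201.00153 pp. 4–7) (source of the ARGUMENT this module implements; this declaration is the cell’s own lemma or plumbing, NOT a printed statement)] -/
theorem integral_sq_le_of_abs_le_of_ne_zero {F : Type*} [Zero F]
    {g : EuclideanSpace ℝ (Fin 3) → F} {f : EuclideanSpace ℝ (Fin 3) → ℝ} {P : ℝ}
    (hf : Continuous f) (hg : tsupport g ⊆ closedBall (0 : EuclideanSpace ℝ (Fin 3)) 2)
    (h0 : ∀ x ∉ tsupport g, f x = 0) (hP : ∀ x, g x ≠ 0 → |f x| ≤ P) :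
    ∫ x, f x ^ 2 ≤ P ^ 2 * volume.real (closedBall (0 : EuclideanSpace ℝ (Fin 3)) 2) := by
  have hcl : IsClosed {y | |f y| ≤ P} := isClosed_le (continuous_abs.comp hf) continuous_const
  have h1 : ∀ x ∈ tsupport g, |f x| ≤ P := fun x hx =>
    (closure_minimal (t := {y | |f y| ≤ P}) (fun y hy => hP y (mem_support.1 hy)) hcl) hx
  have h2 : ∀ x, f x ^ 2 ≤ P ^ 2 := fun x => by
    by_cases hx : x ∈ tsupport g
    · obtain ⟨hl, hr⟩ := abs_le.1 (h1 x hx)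
      exact sq_le_sq' hl hr
    · rw [h0 x hx]
      simpa using sq_nonneg P
  have h3 : ∫ x in closedBall (0 : EuclideanSpace ℝ (Fin 3)) 2, f x ^ 2 = ∫ x, f x ^ 2 :=
    setIntegral_eq_integral_of_forall_compl_eq_zero fun x hx => by
      rw [h0 x fun h => hx (hg h)]
      simp
  have h4 := norm_setIntegral_le_of_norm_le_const (μ := volume) (s := closedBall (0 : EuclideanSpace ℝ (Fin 3)) 2)
    (f := fun x => f x ^ 2) measure_closedBall_lt_top fun x _ => (show ‖f x ^ 2‖ ≤ P ^ 2 by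
      rw [Real.norm_eq_abs, abs_of_nonneg (sq_nonneg _)]; exact h2 x)
  rw [← h3]
  rw [Real.norm_eq_abs] at h4
  exact (le_abs_self _).trans h4

/-- `∫(∂₂G)² ≤ ∫|∇G|²` for `G ∈ C¹` with compact support (all three squares are integrable).
[folklore]
[cite: Seregin2022LocalAxisym, Lemma 2.1 (arXiv:2201.00153 pp. 4–7) (source of the ARGUMENT this module implements; this declaration is the cell’s own lemma or plumbing, NOT a printed statement)] -/
theorem integral_fderiv_sq_le_integral_gradSq {G : EuclideanSpace ℝ (Fin 3) → ℝ}
    (hG : ContDiff ℝ 1 G) (hGc : HasCompactSupport G) :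
    ∫ x, fderiv ℝ G x (EuclideanSpace.single 2 1) ^ 2 ≤
      ∫ x, (fderiv ℝ G x (EuclideanSpace.single 0 1) ^ 2 + fderiv ℝ G x (EuclideanSpace.single 1 1) ^ 2 +
        fderiv ℝ G x (EuclideanSpace.single 2 1) ^ 2) := by
  have hi : ∀ i : Fin 3, Integrable fun x => fderiv ℝ G x (EuclideanSpace.single i 1) ^ 2 := fun i =>
    ((continuous_fderiv_apply_of_contDiff hG _).pow 2).integrable_of_hasCompactSupport
      (hasCompactSupport_of_eq_zero (hGc.fderiv_apply ℝ (EuclideanSpace.single i 1))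
        fun x hx => by simp [hx])
  refine integral_mono (hi 2) (((hi 0).add (hi 1)).add (hi 2)) fun x => ?_
  dsimp only
  nlinarith [sq_nonneg (fderiv ℝ G x (EuclideanSpace.single 0 1)),
    sq_nonneg (fderiv ℝ G x (EuclideanSpace.single 1 1))]

end Tools

/-! ### Lemma 2.1 (ii) in the numeric form consumed by Step 3 -/

section Lemma21Numeric

variable {ζ : EuclideanSpace ℝ (Fin 3) → ℝ} {v : EuclideanSpace ℝ (Fin 3) → EuclideanSpace ℝ (Fin 3)}

/-- **Seregin 2022, Lemma 2.1 (ii), numeric form `∫|∇²(ζv_r/r)|² ≤ c_L∫|∇(ζΓ)|² + C_L` with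
`c_L = 3`, `C_L = 3(P₃² + P₄²)V`.** For an axisymmetric scalar `ζ ∈ C⁵` supported in `𝒞`, an
axisymmetric `v ∈ C⁵` with `div v = 0` on `tsupport ζ`, pointwise bounds
`|∂₂(∂₂ζ ρ − q_ζ v₂)| ≤ P₃`, `|q_{∇ζ·v}| ≤ P₄` on `{∇ζ ≠ 0}` (`ρ = v_r/r`, `q = (∂ᵣ·)/r`; the
paper's `C(v,η)`: "`f ≠ 0` only if `|∇η| > 0` … `v, ∇v, ∇²v` are bounded") and `|B̄(0,2)| ≤ V`:
`∫ Σᵢⱼ(∂ⱼ∂ᵢ(ζρ))² ≤ 3∫|∇(ζΓ)|² + 3(P₃² + P₄²)V` (`Γ = ω_θ/r = angVortQuot v`). From the split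
form `integral_hessianSq_cutoff_radVelQuot_le_three_mul`, `(∂₂(ζΓ))² ≤ |∇(ζΓ)|²`, and the
vanishing of both error functions off `tsupport (∇ζ) ⊆ B̄(0,2)`. [cite: Seregin2022LocalAxisym, §2 Lemma 2.1, second estimate (arXiv:2201.00153 p. 5)] -/
theorem integral_hessianSq_cutoff_radVelQuot_le_of_pointwise (hζ : ContDiff ℝ 5 ζ)
    (hζax : IsAxisymmetricScalar ζ) (hζs : tsupport ζ ⊆ SereginSverak2009.spaceCyl 0 1)
    (hv : ContDiff ℝ 5 v) (hvax : IsAxisymmetric v)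
    (hdiv : ∀ y ∈ tsupport ζ, VectorCalculus.divergence v y = 0) {P₃ P₄ V : ℝ}
    (hV : volume.real (closedBall (0 : EuclideanSpace ℝ (Fin 3)) 2) ≤ V)
    (hP3 : ∀ x, fderiv ℝ ζ x ≠ 0 → |fderiv ℝ (fun y => fderiv ℝ ζ y (EuclideanSpace.single 2 1) *
      radVelQuot v y - radDerivQuot ζ y * v y 2) x (EuclideanSpace.single 2 1)| ≤ P₃)
    (hP4 : ∀ x, fderiv ℝ ζ x ≠ 0 → |radDerivQuot (fun y => fderiv ℝ ζ y (v y)) x| ≤ P₄) :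
    ∫ x, ∑ i : Fin 3, ∑ j : Fin 3, (fderiv ℝ (fun y =>
        fderiv ℝ (fun y => ζ y * radVelQuot v y) y (EuclideanSpace.single i 1)) x
          (EuclideanSpace.single j 1)) ^ 2 ≤
      3 * (∫ x, (fderiv ℝ (fun y => ζ y * angVortQuot v y) x (EuclideanSpace.single 0 1) ^ 2 +
          fderiv ℝ (fun y => ζ y * angVortQuot v y) x (EuclideanSpace.single 1 1) ^ 2 +
          fderiv ℝ (fun y => ζ y * angVortQuot v y) x (EuclideanSpace.single 2 1) ^ 2)) +
        3 * (P₃ ^ 2 + P₄ ^ 2) * V := by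
  have hB : tsupport ζ ⊆ closedBall (0 : EuclideanSpace ℝ (Fin 3)) 2 :=
    hζs.trans spaceCyl_subset_closedBall
  have hζc : HasCompactSupport ζ :=
    IsCompact.of_isClosed_subset (isCompact_closedBall _ _) (isClosed_tsupport ζ) hB
  have hζ2 : ContDiff ℝ 2 ζ := hζ.of_le (by norm_num)
  have h := integral_hessianSq_cutoff_radVelQuot_le_three_mul hζ hζc hζax hv hvax hdiv
  -- (a) the leading term: `∫(∂₂(ζΓ))² ≤ ∫|∇(ζΓ)|²`
  have hG1 : ContDiff ℝ 1 fun y => ζ y * angVortQuot v y := (hζ.of_le (by norm_num)).mul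
    (contDiff_angVortQuot (n := 1) (by exact_mod_cast hv.of_le (by norm_num)))
  have hGc : HasCompactSupport fun y => ζ y * angVortQuot v y := hζc.mul_right
  have ha := integral_fderiv_sq_le_integral_gradSq hG1 hGc
  -- (b) the two error functions are continuous and vanish off `T = tsupport (∇ζ) ⊆ B̄(0,2)`
  have hT : tsupport (fderiv ℝ ζ) ⊆ closedBall (0 : EuclideanSpace ℝ (Fin 3)) 2 :=
    (tsupport_fderiv_subset ℝ).trans hB
  have hB1 : ContDiff ℝ 1 fun y => fderiv ℝ ζ y (EuclideanSpace.single 2 1) * radVelQuot v y -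
      radDerivQuot ζ y * v y 2 :=
    (((hζ.fderiv_right (m := 1) (by norm_num)).clm_apply contDiff_const).mul
      (contDiff_radVelQuot (n := 1) (by exact_mod_cast hv.of_le (by norm_num)))).sub
      ((contDiff_radDerivQuot (n := 1) (by exact_mod_cast hζ.of_le (by norm_num))).mul
        ((contDiff_piLp_apply (𝕜 := ℝ) (p := 2) (n := 1) (i := (2 : Fin 3))).comp
          (hv.of_le (by norm_num))))
  have hD2 : ContDiff ℝ 2 fun y => fderiv ℝ ζ y (v y) :=
    (hζ.fderiv_right (m := 2) (by norm_num)).clm_apply (hv.of_le (by norm_num))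
  have hDax : IsAxisymmetricScalar fun y => fderiv ℝ ζ y (v y) := fun θ y => by
    simp only [hvax θ y]
    exact hζax.fderiv_rotZ_apply_rotZ (hζ.differentiable (by norm_num)) θ y (v y)
  have hcB : Continuous fun x => fderiv ℝ (fun y => fderiv ℝ ζ y (EuclideanSpace.single 2 1) *
      radVelQuot v y - radDerivQuot ζ y * v y 2) x (EuclideanSpace.single 2 1) :=
    (hB1.continuous_fderiv one_ne_zero).clm_apply continuous_const
  have hcD : Continuous (radDerivQuot fun y => fderiv ℝ ζ y (v y)) := continuous_radDerivQuot hD2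
  have h0E : ∀ y ∉ tsupport (fderiv ℝ ζ), fderiv ℝ ζ y (EuclideanSpace.single 2 1) *
      radVelQuot v y - radDerivQuot ζ y * v y 2 = 0 := fun y hy => by
    rw [image_eq_zero_of_notMem_tsupport hy,
      radDerivQuot_eq_zero_of_notMem_tsupport_fderiv hζ2 hζax hy]
    simp
  have h0B : ∀ x ∉ tsupport (fderiv ℝ ζ), fderiv ℝ (fun y =>
      fderiv ℝ ζ y (EuclideanSpace.single 2 1) * radVelQuot v y - radDerivQuot ζ y * v y 2) x
      (EuclideanSpace.single 2 1) = 0 := fun x hx => by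
    rw [fderiv_eq_zero_of_forall_notMem (isClosed_tsupport _) h0E hx]
    rfl
  have h0D' : ∀ y ∉ tsupport (fderiv ℝ ζ), fderiv ℝ ζ y (v y) = 0 := fun y hy => by
    rw [image_eq_zero_of_notMem_tsupport hy]
    rfl
  have hDsub : tsupport (fun y => fderiv ℝ ζ y (v y)) ⊆ tsupport (fderiv ℝ ζ) :=
    closure_minimal (fun y hy => by_contra fun h' => hy (h0D' y h')) (isClosed_tsupport _)
  have h0D : ∀ x ∉ tsupport (fderiv ℝ ζ), radDerivQuot (fun y => fderiv ℝ ζ y (v y)) x = 0 :=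
    fun x hx => radDerivQuot_eq_zero_of_notMem_tsupport hD2 hDax fun h' => hx (hDsub h')
  have hb := integral_sq_le_of_abs_le_of_ne_zero hcB hT h0B hP3
  have hc := integral_sq_le_of_abs_le_of_ne_zero hcD hT h0D hP4
  -- (c) assemble
  have hPV : (P₃ ^ 2 + P₄ ^ 2) * volume.real (closedBall (0 : EuclideanSpace ℝ (Fin 3)) 2) ≤
      (P₃ ^ 2 + P₄ ^ 2) * V := mul_le_mul_of_nonneg_left hV (by positivity)
  linarith

end Lemma21Numeric

/-! ### The key estimate of Step 3, unconditional -/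

end Literature.Analysis.SereginLogSwirlOrigin.EulerScaling

end Part6

/-!
## Part 7 — port of `Summits/NavierStokesRegularity/NavierStokesRegularity/Theorems/AxisymmetricExtremalityAxisymmetricKatoGlobalStubSereginLogSwirlOriginStep1CutoffPointwise.lean` (7 declarations kept)

# Seregin 2022, §2 Step 1: the pointwise estimates behind "`v`, `∇v`, `∇²v` are bounded on
# `supp |∇η|`" — infinitesimal bounds for `v_θ`, `∇(v_r/r)`, `∂₃(v_r/r)`, `(∂ᵣT)/r` —
# crux stmt-NavierStokesRegularity-15453 (`AxisymmetricExtremality.AxisymmetricKatoGlobal`), line registered, support for stub `stub_sereginLogSwirlOrigin`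

Support file (`--supports stmt-NavierStokesRegularity-15453`; theorems only, everything proved)
toward the registered stub `stub_sereginLogSwirlOrigin` = the named fact
`Literature.Analysis.FluidPDE.seregin2022_logSwirl_regularAtOrigin` (G. Seregin, J. Math. Fluid
Mech. 24 (2022), Paper 27 = arXiv:2201.00153, §2).  The Step-3 key estimate
(`cutoff_energy_keyEstimate_unconditional`, `…Step3KeyUnconditional.lean`) and the Step-4
assembly (`isRegularAtOrigin_of_step3Bounds`, `…Step4Assembly.lean`) consume numeric constants
`M, Bcut, P₀, …, P₄, L` bounding, on `supp ∇ζ ∪ {ϱ ≥ r₁}`, products of the cut-off `ζ = η³`,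
the velocity `v`, `v_θ`, `v_r/r`, `∇(v_r/r)`, `∂₃(v_r/r)`, `Γ = ω_θ/r`, `Φ = ω_r/r`, `(∂ᵣ·)/r`;
the paper (arXiv p. 5, Step 1 and proof of Lemma 2.1) takes them from "In the set `supp |∇η|`,
functions `v`, `∇v`, and `∇²v` are bounded … These terms contain `v₃`, `v_{r,3}`, `v_{3,r}`,
`v_{3,rr}`, `v_{3,r}/r`, `v_{r,3r}`, and `v_{r,3}/r`. All of them are bounded by either `|v|`, or
`|∇v|`, or `|∇²v|`."  This file proves the POINTWISE form of that remark for the quantities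
with a `1/r`: each is bounded at `x` by the derivatives of `v` AT `x` (infinitesimal
axisymmetry), so that sup-norm bounds of `v, Dv, D²v` on a set transfer verbatim:

* `norm_fderiv_fderiv_apply_le` — `‖D(y ↦ Df(y)v)(x)‖ ≤ ‖v‖ ‖D²f(x)‖`;
* `abs_swirlVelocity_le_cylRadius_mul` — **`|v_θ(x)| ≤ ϱ ‖Dv(x)‖`**;
* `norm_fderiv_radVelQuot_le_four_mul_div` — **`‖∇(v_r/r)(x)‖ ≤ 4‖Dv(x)‖/ϱ`**
  off the axis (sharper than the tree's `3‖v‖/ϱ² + ‖Dv‖/ϱ`: the horizontal velocity is itself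
  `≤ ϱ‖Dv‖`), whence
* `abs_swirlVelocity_mul_norm_fderiv_radVelQuot_le` —
  **`|v_θ(x)| ‖∇(v_r/r)(x)‖ ≤ 4‖Dv(x)‖²` at every `x`** (the `1/ϱ` cancels; the product entering
  `P₀` and `P₂`);
* `fderiv_radVelQuot_single_two`, `abs_fderiv_radVelQuot_single_two_le` —
  **`∂₃(v_r/r) = (∂₃v)_r/r`** and **`|∂₃(v_r/r)(x)| ≤ ‖D²v(x)‖`** (the paper's `v_{r,3}/r`);
* `abs_radDerivQuot_le_norm_iteratedFDeriv_two` — **`|(∂ᵣT)/r (x)| ≤ ‖D²T(x)‖`** for an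
  axisymmetric scalar `T ∈ C³` (the identity `(∂ᵣT)/ϱ = D²T(x)[e_θ, e_θ]`; the paper's
  `v_{3,r}/r` for `T = v₃`, and `q_{∇ζ·v}` of `P₄`).

## Mathlib / tree search

Tree: `IsAxisymmetric.abs_swirl_le_mul_norm_fderiv`, `…sqrt_sq_add_sq_le_mul_norm_fderiv`,
`…abs_radVelQuot_le_norm_fderiv`, `…fderiv_angVelQuot_single_two` (pattern), `le_of_le_off_axis`,
`eq_of_eq_off_axis` (`AxisymQuotientBounds`); `IsAxisymmetric.norm_fderiv_radVelQuot_le`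
(`AxisymOuterBounds`, the cruder off-axis bound); `fderiv_horizontal_inner_apply`
(`AxisymQuotientEquationsJ`); `fderiv_rho_apply`, `contDiff_horizSq`; `mul_radDerivQuot_eq_fderiv_zero/one`,
`contDiff_radDerivQuot` (`AxisymRadialQuotient`); `fderiv_fderiv_apply_eq_fderiv_fderiv`
(`AxisymGradientField`). Mathlib: `norm_iteratedFDeriv_clm_apply_const`, `norm_iteratedFDeriv_one`,
`norm_iteratedFDeriv_fderiv`, `iteratedFDeriv_two_apply`, `ContinuousMultilinearMap.le_opNorm`;
tree `abs_horizontal_inner_le_cylRadius_mul` (`AxisymPoloidalMoments`), `abs_swirlVelocity_le`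
(`AxisymPoloidalCutoff`). `lean search 'radVelQuot_single_two|le_cylRadius_mul|iteratedFDeriv_two' --decl`
in this namespace: no matches (2026-08-17).

## References

* G. Seregin, J. Math. Fluid Mech. 24 (2022), Paper No. 27 = arXiv:2201.00153, §2 Step 1 and
  proof of Lemma 2.1 (arXiv p. 5: boundedness of `v, ∇v, ∇²v` on `supp |∇η|`). [`Seregin2022LocalAxisym`]
-/

section Part7

open _root_.Set _root_.Filter _root_.Topology _root_.Function _root_.Metric
open scoped _root_.ContDiff
open Literature.Analysis.FluidPDE

namespace Literature.Analysis.SereginLogSwirlOrigin.EulerScaling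

/-! ### A general tool -/

section General

variable {F' : Type*} [NormedAddCommGroup F'] [NormedSpace ℝ F']

/-- **`‖D(y ↦ Df(y) v)(x)‖ ≤ ‖v‖ ‖D²f(x)‖`** for `f ∈ C²` (the directional derivative `y ↦ Df(y)v`
is `Df` paired with a constant vector). [folklore]
[cite: Seregin2022LocalAxisym, §2 proof of Thm. 1.2, Step 1 (arXiv:2201.00153 pp. 4–7) (source of the ARGUMENT this module implements; this declaration is the cell’s own lemma or plumbing, NOT a printed statement)] -/
theorem norm_fderiv_fderiv_apply_le {f : EuclideanSpace ℝ (Fin 3) → F'} (hf : ContDiff ℝ 2 f)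
    (x v : EuclideanSpace ℝ (Fin 3)) :
    ‖fderiv ℝ (fun y => fderiv ℝ f y v) x‖ ≤ ‖v‖ * ‖iteratedFDeriv ℝ 2 f x‖ := by
  have h := norm_iteratedFDeriv_clm_apply_const (𝕜 := ℝ) (f := fderiv ℝ f) (c := v) (x := x)
    (N := 1) (n := 1) ((hf.fderiv_right (m := 1) (by norm_num)).contDiffAt) le_rfl
  rw [norm_iteratedFDeriv_one, norm_iteratedFDeriv_fderiv] at h
  exact h

end General

/-! ### The swirl velocity -/

section Velocity

variable {u : EuclideanSpace ℝ (Fin 3) → EuclideanSpace ℝ (Fin 3)} {x : EuclideanSpace ℝ (Fin 3)}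

/-- **`|v_θ(x)| ≤ ϱ(x) ‖Dv(x)‖`** for an axisymmetric field differentiable at `x`: off the axis
`v_θ = σ/ϱ` with `|σ| ≤ ϱ²‖Dv‖` (`IsAxisymmetric.abs_swirl_le_mul_norm_fderiv`); on the axis both
sides vanish (`e_θ = 0` there). In particular `v_θ` vanishes on the axis to first order, which is
what cancels the `1/ϱ` of `∇(v_r/r)` in the Step-3 constants. [folklore]
[cite: Seregin2022LocalAxisym, §2 proof of Thm. 1.2, Step 1 (arXiv:2201.00153 pp. 4–7) (source of the ARGUMENT this module implements; this declaration is the cell’s own lemma or plumbing, NOT a printed statement)] -/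
theorem abs_swirlVelocity_le_cylRadius_mul (hax : IsAxisymmetric u)
    (hd : DifferentiableAt ℝ u x) : |swirlVelocity u x| ≤ cylRadius x * ‖fderiv ℝ u x‖ := by
  by_cases hx : cylRadius x = 0
  · have h1 : swirlVelocity u x = 0 := by simp [swirlVelocity, eTheta, hx]
    rw [h1, hx, abs_zero, zero_mul]
  · have hr : 0 < cylRadius x := lt_of_le_of_ne (cylRadius_nonneg x) (Ne.symm hx)
    have h := hax.abs_swirl_le_mul_norm_fderiv hd
    rw [swirl_eq_cylRadius_mul_swirlVelocity u hx, abs_mul, abs_of_pos hr, pow_two, mul_assoc] at h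
    exact le_of_mul_le_mul_left h hr

end Velocity

/-! ### The gradient of `v_r/r` -/

section RadVel

variable {u : EuclideanSpace ℝ (Fin 3) → EuclideanSpace ℝ (Fin 3)} {x : EuclideanSpace ℝ (Fin 3)}

/-- **`‖∇(v_r/r)(x)‖ ≤ 4‖Dv(x)‖/ϱ` off the axis**, for an axisymmetric `v ∈ C³`: differentiate
`ϱ² · (v_r/r) = x₀v₀ + x₁v₁` (`D(v_r/r)[h] = (D⟪x_h, v⟫[h] − 2⟪x_h, h_h⟩(v_r/r))/ϱ²`) and use the
infinitesimal bounds `|v_h| ≤ ϱ‖Dv‖`, `|v_r/r| ≤ ‖Dv‖`, so that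
`|D⟪x_h,v⟫[h]| ≤ ‖h‖(|v_h| + ϱ‖Dv‖) ≤ 2ϱ‖Dv‖‖h‖` and `|2⟪x_h,h_h⟩(v_r/r)| ≤ 2ϱ‖Dv‖‖h‖`.
(Lei–Zhang's "`∇(vʳ/r) = ∇vʳ/r − e_r vʳ/r²`"; compare `IsAxisymmetric.norm_fderiv_radVelQuot_le`.)
[folklore]
[cite: Seregin2022LocalAxisym, §2 proof of Thm. 1.2, Step 1 (arXiv:2201.00153 pp. 4–7) (source of the ARGUMENT this module implements; this declaration is the cell’s own lemma or plumbing, NOT a printed statement)] -/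
theorem norm_fderiv_radVelQuot_le_four_mul_div (hax : IsAxisymmetric u)
    (hu : ContDiff ℝ 3 u) (hx : cylRadius x ≠ 0) :
    ‖fderiv ℝ (radVelQuot u) x‖ ≤ 4 * ‖fderiv ℝ u x‖ / cylRadius x := by
  have hr : 0 < cylRadius x := lt_of_le_of_ne (cylRadius_nonneg x) (Ne.symm hx)
  have hu2 : ContDiff ℝ 2 u := hu.of_le (by norm_num)
  have hud : Differentiable ℝ u := hu.differentiable (by norm_num)
  have hW1 : ContDiff ℝ 1 (radVelQuot u) := contDiff_radVelQuot (n := 1) (by exact_mod_cast hu)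
  have hWd : Differentiable ℝ (radVelQuot u) := hW1.differentiable one_ne_zero
  have hρd : Differentiable ℝ (fun y : EuclideanSpace ℝ (Fin 3) => y 0 ^ 2 + y 1 ^ 2) :=
    contDiff_horizSq.differentiable two_ne_zero
  -- `ϱ² W = ⟪x_h, v⟫` as functions
  have hprod : (fun y : EuclideanSpace ℝ (Fin 3) => (y 0 ^ 2 + y 1 ^ 2) * radVelQuot u y) =
      fun y => y 0 * u y 0 + y 1 * u y 1 := by
    funext y
    rw [← cylRadius_sq, hax.cylRadius_sq_mul_radVelQuot hu2 y]
  -- the derivative identity applied to `h`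
  have hid : ∀ h : EuclideanSpace ℝ (Fin 3), 2 * (x 0 * h 0 + x 1 * h 1) * radVelQuot u x +
      cylRadius x ^ 2 * fderiv ℝ (radVelQuot u) x h =
      h 0 * u x 0 + h 1 * u x 1 + (x 0 * fderiv ℝ u x h 0 + x 1 * fderiv ℝ u x h 1) := by
    intro h
    have e := congrArg (fun f : EuclideanSpace ℝ (Fin 3) → ℝ => fderiv ℝ f x h) hprod
    simp only at e
    rw [fderiv_fun_mul (hρd x) (hWd x), fderiv_horizontal_inner_apply (hud x)] at e
    simp only [_root_.add_apply, _root_.FunLike.coe_smul, Pi.smul_apply, smul_eq_mul,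
      fderiv_rho_apply] at e
    rw [cylRadius_sq]
    linarith
  -- the infinitesimal bounds at `x`
  have hWb : |radVelQuot u x| ≤ ‖fderiv ℝ u x‖ := hax.abs_radVelQuot_le_norm_fderiv hu2 x
  have hvh : cylRadius (u x) ≤ cylRadius x * ‖fderiv ℝ u x‖ :=
    hax.sqrt_sq_add_sq_le_mul_norm_fderiv (hud x)
  have hbound : ∀ h : EuclideanSpace ℝ (Fin 3), ‖fderiv ℝ (radVelQuot u) x h‖ ≤
      4 * ‖fderiv ℝ u x‖ / cylRadius x * ‖h‖ := by
    intro h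
    have hD0 : 0 ≤ ‖fderiv ℝ u x‖ := norm_nonneg _
    have hh : |x 0 * h 0 + x 1 * h 1| ≤ cylRadius x * ‖h‖ := abs_horizontal_inner_le_cylRadius_mul x h
    have h1 : |h 0 * u x 0 + h 1 * u x 1| ≤ cylRadius x * ‖fderiv ℝ u x‖ * ‖h‖ := by
      have e1 : h 0 * u x 0 + h 1 * u x 1 = u x 0 * h 0 + u x 1 * h 1 := by ring
      rw [e1]
      exact (abs_horizontal_inner_le_cylRadius_mul (u x) h).trans
        (mul_le_mul_of_nonneg_right hvh (norm_nonneg _))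
    have h2 : |x 0 * fderiv ℝ u x h 0 + x 1 * fderiv ℝ u x h 1| ≤ cylRadius x * (‖fderiv ℝ u x‖ * ‖h‖) :=
      (abs_horizontal_inner_le_cylRadius_mul x (fderiv ℝ u x h)).trans
        (mul_le_mul_of_nonneg_left ((fderiv ℝ u x).le_opNorm h) (cylRadius_nonneg x))
    have h3 : |2 * (x 0 * h 0 + x 1 * h 1) * radVelQuot u x| ≤ 2 * (cylRadius x * ‖h‖) * ‖fderiv ℝ u x‖ := by
      rw [abs_mul, abs_mul, abs_two]
      gcongr
    -- from `hid`: `ϱ² D W h = RHS − 2⟪x_h,h_h⟩ W`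
    have e : fderiv ℝ (radVelQuot u) x h = (h 0 * u x 0 + h 1 * u x 1 +
        (x 0 * fderiv ℝ u x h 0 + x 1 * fderiv ℝ u x h 1) -
        2 * (x 0 * h 0 + x 1 * h 1) * radVelQuot u x) / cylRadius x ^ 2 := by
      have := hid h
      field_simp
      linarith
    rw [e, Real.norm_eq_abs, abs_div, abs_of_pos (pow_pos hr 2), div_le_iff₀ (pow_pos hr 2)]
    calc |h 0 * u x 0 + h 1 * u x 1 + (x 0 * fderiv ℝ u x h 0 + x 1 * fderiv ℝ u x h 1) -
          2 * (x 0 * h 0 + x 1 * h 1) * radVelQuot u x|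
        ≤ |h 0 * u x 0 + h 1 * u x 1| + |x 0 * fderiv ℝ u x h 0 + x 1 * fderiv ℝ u x h 1| +
          |2 * (x 0 * h 0 + x 1 * h 1) * radVelQuot u x| := by
            refine (abs_sub _ _).trans ?_
            gcongr
            exact abs_add_le _ _
      _ ≤ cylRadius x * ‖fderiv ℝ u x‖ * ‖h‖ + cylRadius x * (‖fderiv ℝ u x‖ * ‖h‖) +
          2 * (cylRadius x * ‖h‖) * ‖fderiv ℝ u x‖ := by gcongr
      _ = 4 * ‖fderiv ℝ u x‖ / cylRadius x * ‖h‖ * cylRadius x ^ 2 := by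
            field_simp
            ring
  exact ContinuousLinearMap.opNorm_le_bound _ (by positivity) hbound

/-- **`|v_θ(x)| ‖∇(v_r/r)(x)‖ ≤ 4‖Dv(x)‖²` at every point**, for an axisymmetric `v ∈ C³`: off
the axis by `|v_θ| ≤ ϱ‖Dv‖` and `‖∇(v_r/r)‖ ≤ 4‖Dv‖/ϱ`; on the axis `v_θ = 0`. This is the
pointwise content of the Step-3 constants `P₀` (far field) and `P₂` (on `supp ∇ζ`, which crosses
the axis near the two heights). [cite: Seregin2022LocalAxisym, §2 Step 1 (arXiv:2201.00153 p. 5), boundedness of v, ∇v, ∇²v on supp|∇η|] -/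
theorem abs_swirlVelocity_mul_norm_fderiv_radVelQuot_le : ∀ (u : EuclideanSpace ℝ (Fin 3) → EuclideanSpace ℝ (Fin 3)), IsAxisymmetric u → ContDiff ℝ 3 u → ∀ x : EuclideanSpace ℝ (Fin 3), |swirlVelocity u x| * ‖fderiv ℝ (radVelQuot u) x‖ ≤ 4 * ‖fderiv ℝ u x‖ ^ 2 := by
  intro u hax hu x
  have hud : Differentiable ℝ u := hu.differentiable (by norm_num)
  by_cases hx : cylRadius x = 0
  · have h1 : swirlVelocity u x = 0 := by simp [swirlVelocity, eTheta, hx]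
    rw [h1, abs_zero, zero_mul]
    positivity
  · have hr : 0 < cylRadius x := lt_of_le_of_ne (cylRadius_nonneg x) (Ne.symm hx)
    calc |swirlVelocity u x| * ‖fderiv ℝ (radVelQuot u) x‖
        ≤ (cylRadius x * ‖fderiv ℝ u x‖) * (4 * ‖fderiv ℝ u x‖ / cylRadius x) :=
          mul_le_mul (abs_swirlVelocity_le_cylRadius_mul hax (hud x))
            (norm_fderiv_radVelQuot_le_four_mul_div hax hu hx) (norm_nonneg _) (by positivity)
      _ = 4 * ‖fderiv ℝ u x‖ ^ 2 := by
          field_simp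

/-- **`∂₃(v_r/r) = (∂₃v)_r/r`**: the axial derivative commutes with the quotient `radVelQuot`,
for an axisymmetric `v ∈ C³`, at every point (off the axis differentiate
`ϱ² · (v_r/r) = x₀v₀ + x₁v₁` along `e₃`, across the axis by continuity; compare
`IsAxisymmetric.fderiv_angVelQuot_single_two`). [folklore]
[cite: Seregin2022LocalAxisym, §2 proof of Thm. 1.2, Step 1 (arXiv:2201.00153 pp. 4–7) (source of the ARGUMENT this module implements; this declaration is the cell’s own lemma or plumbing, NOT a printed statement)] -/
theorem fderiv_radVelQuot_single_two (hax : IsAxisymmetric u) (hu : ContDiff ℝ 3 u)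
    (x : EuclideanSpace ℝ (Fin 3)) :
    fderiv ℝ (radVelQuot u) x (EuclideanSpace.single 2 1) =
      radVelQuot (fun y => fderiv ℝ u y (EuclideanSpace.single 2 1)) x := by
  have hu2 : ContDiff ℝ 2 u := hu.of_le (by norm_num)
  have hud : Differentiable ℝ u := hu.differentiable (by norm_num)
  have hW1 : ContDiff ℝ 1 (radVelQuot u) := contDiff_radVelQuot (n := 1) (by exact_mod_cast hu)
  have hWd : Differentiable ℝ (radVelQuot u) := hW1.differentiable one_ne_zero
  have huz : ContDiff ℝ 2 (fun y => fderiv ℝ u y (EuclideanSpace.single 2 1)) :=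
    contDiff_fderiv_apply_const_succ (n := 2) (by exact_mod_cast hu) _
  have haxz : IsAxisymmetric (fun y => fderiv ℝ u y (EuclideanSpace.single 2 1)) :=
    hax.fderiv_apply_single_two hud
  have hL : Continuous fun y => fderiv ℝ (radVelQuot u) y (EuclideanSpace.single 2 1) :=
    (hW1.continuous_fderiv one_ne_zero).clm_apply continuous_const
  have hR : Continuous (radVelQuot fun y => fderiv ℝ u y (EuclideanSpace.single 2 1)) :=
    (contDiff_radVelQuot (n := 0) (by exact_mod_cast huz)).continuous
  refine eq_of_eq_off_axis hL hR (fun z hz => ?_) x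
  have hr2 : cylRadius z ^ 2 ≠ 0 := pow_ne_zero 2 hz
  apply mul_left_cancel₀ hr2
  rw [haxz.cylRadius_sq_mul_radVelQuot huz z]
  have hprod : (fun y : EuclideanSpace ℝ (Fin 3) => y 0 * u y 0 + y 1 * u y 1) =
      fun y => (y 0 ^ 2 + y 1 ^ 2) * radVelQuot u y := by
    funext y
    rw [← cylRadius_sq, hax.cylRadius_sq_mul_radVelQuot hu2 y]
  have hρd : DifferentiableAt ℝ (fun y : EuclideanSpace ℝ (Fin 3) => y 0 ^ 2 + y 1 ^ 2) z :=
    contDiff_horizSq.differentiable two_ne_zero z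
  have e := congrArg (fun f : EuclideanSpace ℝ (Fin 3) → ℝ => fderiv ℝ f z (EuclideanSpace.single 2 1)) hprod
  simp only at e
  rw [fderiv_horizontal_inner_apply (hud z), fderiv_fun_mul hρd (hWd z)] at e
  simp only [_root_.add_apply, _root_.FunLike.coe_smul, Pi.smul_apply, smul_eq_mul,
    fderiv_rho_apply, cylRadius_sq] at e ⊢
  simp at e
  linarith

/-- **`|∂₃(v_r/r)(x)| ≤ ‖D²v(x)‖`** for an axisymmetric `v ∈ C³` (the paper's `v_{r,3}/r`):
`∂₃(v_r/r) = (∂₃v)_r/r` and `|w_r/r| ≤ ‖Dw‖` for the axisymmetric field `w = ∂₃v`. [cite: Seregin2022LocalAxisym, §2 proof of Lemma 2.1 (arXiv:2201.00153 p. 5), the term v_{r,3}/r] -/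
theorem abs_fderiv_radVelQuot_single_two_le (hax : IsAxisymmetric u)
    (hu : ContDiff ℝ 3 u) (x : EuclideanSpace ℝ (Fin 3)) :
    |fderiv ℝ (radVelQuot u) x (EuclideanSpace.single 2 1)| ≤ ‖iteratedFDeriv ℝ 2 u x‖ := by
  have hu2 : ContDiff ℝ 2 u := hu.of_le (by norm_num)
  have hud : Differentiable ℝ u := hu.differentiable (by norm_num)
  have huz : ContDiff ℝ 2 (fun y => fderiv ℝ u y (EuclideanSpace.single 2 1)) :=
    contDiff_fderiv_apply_const_succ (n := 2) (by exact_mod_cast hu) _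
  have haxz : IsAxisymmetric (fun y => fderiv ℝ u y (EuclideanSpace.single 2 1)) :=
    hax.fderiv_apply_single_two hud
  rw [fderiv_radVelQuot_single_two hax hu x]
  calc |radVelQuot (fun y => fderiv ℝ u y (EuclideanSpace.single 2 1)) x|
      ≤ ‖fderiv ℝ (fun y => fderiv ℝ u y (EuclideanSpace.single 2 1)) x‖ :=
        haxz.abs_radVelQuot_le_norm_fderiv huz x
    _ ≤ ‖(EuclideanSpace.single 2 1 : EuclideanSpace ℝ (Fin 3))‖ * ‖iteratedFDeriv ℝ 2 u x‖ :=
        norm_fderiv_fderiv_apply_le hu2 x _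
    _ = ‖iteratedFDeriv ℝ 2 u x‖ := by simp

end RadVel

/-! ### The radial derivative quotient of an axisymmetric scalar -/

section RadDeriv

/-- **`|(∂ᵣT)/ϱ (x)| ≤ ‖D²T(x)‖`** for an axisymmetric scalar `T ∈ C³`, at every point (the
paper's `v_{3,r}/r`, and the quotient `q_{∇ζ·v}` of `P₄`). Off the axis, with
`h₀ = (-x₁, x₀, 0)` (`= ϱ e_θ`): `DT(y)[h₀] = (x₀y₁ − x₁y₀) q(y)` by `xᵢ q = ∂ᵢT`
(`q = radDerivQuot T`), so `D²T(x)[h₀, h₀] = ϱ² q(x)`, i.e. `q = D²T[e_θ, e_θ]` — the angular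
eigenvalue of the horizontal Hessian; across the axis by continuity. [folklore]
[cite: Seregin2022LocalAxisym, §2 proof of Thm. 1.2, Step 1 (arXiv:2201.00153 pp. 4–7) (source of the ARGUMENT this module implements; this declaration is the cell’s own lemma or plumbing, NOT a printed statement)] -/
theorem abs_radDerivQuot_le_norm_iteratedFDeriv_two : ∀ (T : EuclideanSpace ℝ (Fin 3) → ℝ), ContDiff ℝ 3 T → IsAxisymmetricScalar T → ∀ x : EuclideanSpace ℝ (Fin 3), |radDerivQuot T x| ≤ ‖iteratedFDeriv ℝ 2 T x‖ := by
  intro T hT hax x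
  have hT2 : ContDiff ℝ 2 T := hT.of_le (by norm_num)
  have hq1 : ContDiff ℝ 1 (radDerivQuot T) := contDiff_radDerivQuot (n := 1) (by exact_mod_cast hT)
  have hqd : Differentiable ℝ (radDerivQuot T) := hq1.differentiable one_ne_zero
  have hqc : Continuous (radDerivQuot T) := hq1.continuous
  have hc2 : Continuous fun y => ‖iteratedFDeriv ℝ 2 T y‖ :=
    (hT2.continuous_iteratedFDeriv le_rfl).norm
  refine le_of_le_off_axis (continuous_abs.comp hqc) hc2 (fun z hz => ?_) x
  have hr : 0 < cylRadius z := lt_of_le_of_ne (cylRadius_nonneg z) (Ne.symm hz)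
  -- the fixed horizontal vector `h₀ = (-z₁, z₀, 0)`
  set h₀ : EuclideanSpace ℝ (Fin 3) :=
    (-z 1) • EuclideanSpace.single 0 1 + (z 0) • EuclideanSpace.single 1 1 with hh₀
  have h₀0 : h₀ 0 = -z 1 := by simp [hh₀]
  have h₀1 : h₀ 1 = z 0 := by simp [hh₀]
  have hnorm : ‖h₀‖ ^ 2 = cylRadius z ^ 2 := by
    rw [EuclideanSpace.norm_sq_eq, cylRadius_sq]
    simp [hh₀, Fin.sum_univ_three]
    ring
  -- `DT(y)[h₀] = (z₀y₁ − z₁y₀) q(y)`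
  have hg : ∀ y, fderiv ℝ T y h₀ = (z 0 * y 1 - z 1 * y 0) * radDerivQuot T y := by
    intro y
    rw [hh₀, map_add, map_smul, map_smul, smul_eq_mul, smul_eq_mul,
      ← mul_radDerivQuot_eq_fderiv_zero hT2 hax y, ← mul_radDerivQuot_eq_fderiv_one hT2 hax y]
    ring
  have hgfun : (fun y => fderiv ℝ T y h₀) = fun y => (z 0 * y 1 - z 1 * y 0) * radDerivQuot T y :=
    funext hg
  -- differentiate at `z` along `h₀`
  have hlin : DifferentiableAt ℝ (fun y : EuclideanSpace ℝ (Fin 3) => z 0 * y 1 - z 1 * y 0) z :=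
    (((EuclideanSpace.proj (𝕜 := ℝ) (1 : Fin 3)).differentiableAt).const_mul _).sub
      (((EuclideanSpace.proj (𝕜 := ℝ) (0 : Fin 3)).differentiableAt).const_mul _)
  have hlin' : fderiv ℝ (fun y : EuclideanSpace ℝ (Fin 3) => z 0 * y 1 - z 1 * y 0) z h₀ =
      z 0 * h₀ 1 - z 1 * h₀ 0 := by
    have hc : ∀ i : Fin 3, DifferentiableAt ℝ (fun y : EuclideanSpace ℝ (Fin 3) => y i) z := fun i =>
      (EuclideanSpace.proj (𝕜 := ℝ) i).differentiableAt
    have hcf : ∀ (i : Fin 3) (h : EuclideanSpace ℝ (Fin 3)),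
        fderiv ℝ (fun y : EuclideanSpace ℝ (Fin 3) => y i) z h = h i := fun i h => by
      have : (fun y : EuclideanSpace ℝ (Fin 3) => y i) = ⇑(EuclideanSpace.proj (𝕜 := ℝ) i) := rfl
      rw [this, ContinuousLinearMap.fderiv]; rfl
    rw [fderiv_fun_sub ((hc 1).const_mul _) ((hc 0).const_mul _), fderiv_const_mul (hc 1),
      fderiv_const_mul (hc 0)]
    simp [hcf]
  have hD2 : fderiv ℝ (fun y => fderiv ℝ T y h₀) z h₀ = cylRadius z ^ 2 * radDerivQuot T z := by
    rw [hgfun, fderiv_fun_mul hlin (hqd z)]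
    simp only [_root_.add_apply, _root_.FunLike.coe_smul, Pi.smul_apply, smul_eq_mul, hlin', h₀0, h₀1,
      cylRadius_sq]
    ring
  -- `D²T(z)[h₀, h₀]` against the operator norm
  have hiter : iteratedFDeriv ℝ 2 T z ![h₀, h₀] = cylRadius z ^ 2 * radDerivQuot T z := by
    rw [iteratedFDeriv_two_apply]
    simp only [Matrix.cons_val_zero, Matrix.cons_val_one]
    rw [← fderiv_fderiv_apply_eq_fderiv_fderiv hT2 z h₀ h₀]
    exact hD2
  have hle : ‖iteratedFDeriv ℝ 2 T z ![h₀, h₀]‖ ≤ ‖iteratedFDeriv ℝ 2 T z‖ * cylRadius z ^ 2 := by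
    refine ((iteratedFDeriv ℝ 2 T z).le_opNorm ![h₀, h₀]).trans (le_of_eq ?_)
    rw [Fin.prod_univ_two]
    simp only [Matrix.cons_val_zero, Matrix.cons_val_one]
    rw [← pow_two, hnorm]
  rw [hiter, Real.norm_eq_abs, abs_mul, abs_of_pos (pow_pos hr 2), mul_comm] at hle
  exact le_of_mul_le_mul_right hle (pow_pos hr 2)

end RadDeriv

end Literature.Analysis.SereginLogSwirlOrigin.EulerScaling

end Part7

/-!
## Part 8 — port of `Summits/NavierStokesRegularity/NavierStokesRegularity/Theorems/AxisymmetricExtremalityAxisymmetricKatoGlobalStubSereginLogSwirlOriginStep1CutoffConstants.lean` (10 declarations kept)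

# Seregin 2022, §2 Step 1 ⇒ Step 3: the pointwise constants `M, P₀, …, P₄, L` of the key
# estimate from sup-norm bounds of `v, Dv, D²v` on `supp ∇ζ ∪ (supp ζ ∩ {ϱ ≥ r₁})` —
# crux stmt-NavierStokesRegularity-15453 (`AxisymmetricExtremality.AxisymmetricKatoGlobal`), line registered, support for stub `stub_sereginLogSwirlOrigin`

Support file (`--supports stmt-NavierStokesRegularity-15453`; theorems only, everything proved)
toward the registered stub `stub_sereginLogSwirlOrigin` = the named fact
`Literature.Analysis.FluidPDE.seregin2022_logSwirl_regularAtOrigin` (G. Seregin, J. Math. Fluid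
Mech. 24 (2022), Paper 27 = arXiv:2201.00153, §2).  The landed key estimate of Step 3
(`cutoff_energy_keyEstimate_unconditional`, `…Step3KeyUnconditional.lean`) takes, at every time
of the slab, the pointwise hypotheses

* `hfar`: `|(v_θ/r)(ζΓ)(ζΦ)| ≤ M` on `{ϱ ≥ r₁}`,
* `hP0`: `|v_θ| ‖∇(ζ v_r/r)‖ ≤ P₀` on `{ϱ ≥ r₁}`,
* `hP1`: `|v_r/r| |v_θ| ‖∇ζ‖ ≤ P₁`, `hP2`: `|ζΦ| |v_θ| ‖∇ζ‖ ‖∇(v_r/r)‖ ≤ P₂` everywhere,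
* `hP3`: `|∂₃(∂₃ζ v_r/r − q_ζ v₃)| ≤ P₃`, `hP4`: `|q_{∇ζ·v}| ≤ P₄` on `{∇ζ ≠ 0}`

(`Γ = angVortQuot`, `Φ = radVelQuot ∘ curl`, `v_r/r = radVelQuot`, `v_θ = swirlVelocity`,
`v_θ/r = angVelQuot`, `q = radDerivQuot = (∂ᵣ·)/r`), and the Step-4 assembly
(`isRegularAtOrigin_of_step3Bounds`) takes `|v| ≤ L`, `|Φ| ≤ L` on `{∇ζ ≠ 0}`.  The paper
(Step 1, arXiv p. 5; proof of Lemma 2.1; Step 3 "`C(v, η)`", "`(1/r₁)C(v, η)`") obtains all of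
them from: "In the set `supp |∇η|`, functions `v`, `∇v`, and `∇²v` are bounded".  This file
proves exactly that derivation, for one time slice: if `‖v‖ ≤ D₀`, `‖Dv‖ ≤ D₁`, `‖D²v‖ ≤ D₂`
on a set `K ⊇ tsupport (∇ζ) ∪ (tsupport ζ ∩ {ϱ ≥ r₁})` (the regular region of the Step-1
cut-off, `exists_step1_cutoff`), and `‖∇ζ‖ ≤ Z₁`, `‖D²ζ‖ ≤ Z₂`, `‖D³ζ‖ ≤ Z₃`, `|q_ζ| ≤ Q₀`,
`‖∇q_ζ‖ ≤ Q₁` (`exists_cutoff_derivBounds`), then the six hypotheses hold with the explicit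
polynomial constants

* `M = D₁ (κD₂)²`, `P₀ = D₀D₁Z₁ + 4D₁²`, `P₁ = D₁D₀Z₁`, `P₂ = κD₂ Z₁ (4D₁²)`,
  `P₃ = Z₁D₂ + Z₂D₁ + Q₀D₁ + Q₁D₀`, `P₄ = Z₁D₂ + 2Z₂D₁ + Z₃D₀`, `L = D₀`, `L_Φ = κD₂`

(`κ = ‖curlCLM‖`, `‖D(curl v)‖ ≤ κ‖D²v‖`), by the infinitesimal bounds of the sibling
`…Step1CutoffPointwise` (`|v_θ| ‖∇(v_r/r)‖ ≤ 4‖Dv‖²`, `|∂₃(v_r/r)| ≤ ‖D²v‖`, `|q_T| ≤ ‖D²T‖`)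
and of `AxisymQuotientBounds` (`|v_r/r|, |v_θ/r| ≤ ‖Dv‖`, `|Γ|, |Φ| ≤ ‖Dω‖`).  Registered
sub-goal: `step3_pointwiseConstants` (the six bounds bundled).  The integrated hypothesis `hcut`
(`Bcut`) and the energy/measurability inputs of Step 4 are in sibling files.

## Mathlib / tree search

Tree (besides the above): `norm_fderiv_curl_le` (`TaoEnstrophyLocalisation`),
`radDerivQuot_eq_zero_of_notMem_tsupport_fderiv` (`…Step3KeyUnconditional`),
`fderiv_eq_zero_of_forall_notMem` (`…CutoffDivCurl`), `IsAxisymmetricScalar.fderiv_rotZ_apply_rotZ`,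
`contDiff_radDerivQuot`, `continuous_radDerivQuot`. Mathlib: `norm_iteratedFDeriv_clm_apply`,
`Continuous.bounded_above_of_compact_support`, `HasCompactSupport.iteratedFDeriv/.fderiv`,
`image_eq_zero_of_notMem_tsupport`, `PiLp.norm_apply_le` (`|w₂| ≤ ‖w‖`, cf. the Barriers-side
`abs_apply_two_le_norm`).

## References

* G. Seregin, J. Math. Fluid Mech. 24 (2022), Paper No. 27 = arXiv:2201.00153, §2 Step 1
  (arXiv p. 5), Lemma 2.1 (p. 5, `C(v, η)`), Step 3 (pp. 6–7, `C(v, η)`, `C(v, η, r₁)`). [`Seregin2022LocalAxisym`]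
-/

section Part8

open _root_.Set _root_.Filter _root_.Topology _root_.Function _root_.Metric _root_.MeasureTheory
open scoped _root_.ContDiff
open Literature.Analysis.FluidPDE

namespace Literature.Analysis.SereginLogSwirlOrigin.EulerScaling

/-! ### The derivative bounds of the cut-off -/

section CutoffBounds

variable {ζ : EuclideanSpace ℝ (Fin 3) → ℝ}

/-- **The cut-off constants exist**: for `ζ ∈ C⁴` axisymmetric with compact support there are
`Z₁, Z₂, Z₃, Q₀, Q₁ ≥ 0` with `‖∇ζ‖ ≤ Z₁`, `‖D²ζ‖ ≤ Z₂`, `‖D³ζ‖ ≤ Z₃`, `|q_ζ| ≤ Q₀`,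
`‖∇q_ζ‖ ≤ Q₁` everywhere (`q_ζ = radDerivQuot ζ = (∂ᵣζ)/r`, continuous and vanishing off
`tsupport ∇ζ`). For the Step-1 cut-off these are the paper's `c/r₀ᵏ`, `c/δᵏ`. [folklore]
[cite: Seregin2022LocalAxisym, §2 proof of Thm. 1.2, Step 1 (arXiv:2201.00153 pp. 4–7) (source of the ARGUMENT this module implements; this declaration is the cell’s own lemma or plumbing, NOT a printed statement)] -/
theorem exists_cutoff_derivBounds (hζ : ContDiff ℝ 4 ζ) (hζc : HasCompactSupport ζ)
    (hζax : IsAxisymmetricScalar ζ) :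
    ∃ Z₁ Z₂ Z₃ Q₀ Q₁ : ℝ, 0 ≤ Z₁ ∧ 0 ≤ Z₂ ∧ 0 ≤ Z₃ ∧ 0 ≤ Q₀ ∧ 0 ≤ Q₁ ∧
      (∀ x, ‖fderiv ℝ ζ x‖ ≤ Z₁) ∧ (∀ x, ‖iteratedFDeriv ℝ 2 ζ x‖ ≤ Z₂) ∧
      (∀ x, ‖iteratedFDeriv ℝ 3 ζ x‖ ≤ Z₃) ∧ (∀ x, |radDerivQuot ζ x| ≤ Q₀) ∧
      (∀ x, ‖fderiv ℝ (radDerivQuot ζ) x‖ ≤ Q₁) := by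
  have hζ2 : ContDiff ℝ 2 ζ := hζ.of_le (by norm_num)
  obtain ⟨Z₁, hZ₁⟩ := (hζ.continuous_fderiv (by norm_num)).bounded_above_of_compact_support (hζc.fderiv ℝ)
  obtain ⟨Z₂, hZ₂⟩ := (hζ.continuous_iteratedFDeriv (m := 2) (by norm_num)).bounded_above_of_compact_support
    (hζc.iteratedFDeriv (𝕜 := ℝ) 2)
  obtain ⟨Z₃, hZ₃⟩ := (hζ.continuous_iteratedFDeriv (m := 3) (by norm_num)).bounded_above_of_compact_support
    (hζc.iteratedFDeriv (𝕜 := ℝ) 3)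
  have hq2 : ContDiff ℝ 2 (radDerivQuot ζ) := contDiff_radDerivQuot (n := 2) (by exact_mod_cast hζ)
  have hqc : HasCompactSupport (radDerivQuot ζ) :=
    IsCompact.of_isClosed_subset (hζc.fderiv ℝ) (isClosed_tsupport _)
      (closure_minimal (fun x hx => by_contra fun h' =>
        hx (radDerivQuot_eq_zero_of_notMem_tsupport_fderiv hζ2 hζax h')) (isClosed_tsupport _))
  obtain ⟨Q₀, hQ₀⟩ := hq2.continuous.bounded_above_of_compact_support hqc
  obtain ⟨Q₁, hQ₁⟩ := (hq2.continuous_fderiv (by norm_num)).bounded_above_of_compact_support (hqc.fderiv ℝ)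
  refine ⟨Z₁, Z₂, Z₃, Q₀, Q₁, (norm_nonneg _).trans (hZ₁ 0), (norm_nonneg _).trans (hZ₂ 0),
    (norm_nonneg _).trans (hZ₃ 0), (norm_nonneg _).trans (hQ₀ 0), (norm_nonneg _).trans (hQ₁ 0),
    hZ₁, hZ₂, hZ₃, fun x => ?_, hQ₁⟩
  rw [← Real.norm_eq_abs]
  exact hQ₀ x

end CutoffBounds

/-! ### The six pointwise hypotheses of the key estimate -/

section Pointwise

variable {u : EuclideanSpace ℝ (Fin 3) → EuclideanSpace ℝ (Fin 3)} {ζ : EuclideanSpace ℝ (Fin 3) → ℝ}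
  {K : Set (EuclideanSpace ℝ (Fin 3))} {r₁ D₀ D₁ D₂ Z₁ Z₂ Z₃ Q₀ Q₁ : ℝ}

/-- Points where `∇ζ ≠ 0` lie in every `K ⊇ tsupport ∇ζ`. [folklore]
[cite: Seregin2022LocalAxisym, §2 proof of Thm. 1.2, Step 1 (arXiv:2201.00153 pp. 4–7) (source of the ARGUMENT this module implements; this declaration is the cell’s own lemma or plumbing, NOT a printed statement)] -/
theorem mem_of_fderiv_ne_zero (hK : tsupport (fderiv ℝ ζ) ⊆ K) {x : EuclideanSpace ℝ (Fin 3)}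
    (hx : fderiv ℝ ζ x ≠ 0) : x ∈ K :=
  hK (subset_tsupport _ (mem_support.2 hx))

/-- **`hfar` (far-field `M`)**: on `{ϱ ≥ r₁}`, `|(v_θ/r)(ζΓ)(ζΦ)| ≤ D₁(κD₂)²` when `‖Dv‖ ≤ D₁`,
`‖D²v‖ ≤ D₂` on `K ⊇ tsupport ζ ∩ {ϱ ≥ r₁}` and `0 ≤ ζ ≤ 1` (`|v_θ/r| ≤ ‖Dv‖`,
`|Γ|, |Φ| ≤ ‖Dω‖ ≤ κ‖D²v‖`; off `tsupport ζ` the product vanishes). Seregin's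
"`(1/r₁)C(v, η)`" term of `B₃`. [cite: Seregin2022LocalAxisym, §2 Step 3, estimate of B₃ (arXiv:2201.00153 p. 6)] -/
theorem far_bound (hu : ContDiff ℝ 3 u) (hax : IsAxisymmetric u) (hζ01 : ∀ x, 0 ≤ ζ x ∧ ζ x ≤ 1)
    (hKfar : ∀ x ∈ tsupport ζ, r₁ ≤ cylRadius x → x ∈ K) (hD₁ : 0 ≤ D₁) (hD₂ : 0 ≤ D₂)
    (h1 : ∀ x ∈ K, ‖fderiv ℝ u x‖ ≤ D₁) (h2 : ∀ x ∈ K, ‖iteratedFDeriv ℝ 2 u x‖ ≤ D₂)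
    (x : EuclideanSpace ℝ (Fin 3)) (hx : r₁ ≤ cylRadius x) :
    |angVelQuot u x * (ζ x * angVortQuot u x) * (ζ x * radVelQuot (curl u) x)| ≤
      D₁ * (‖curlCLM‖ * D₂) ^ 2 := by
  have hu2 : ContDiff ℝ 2 u := hu.of_le (by norm_num)
  by_cases hxs : x ∈ tsupport ζ
  · have hxK : x ∈ K := hKfar x hxs hx
    have ha : |angVelQuot u x| ≤ D₁ := (hax.abs_angVelQuot_le_norm_fderiv hu2 x).trans (h1 x hxK)
    have hω : ‖fderiv ℝ (curl u) x‖ ≤ ‖curlCLM‖ * D₂ :=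
      (norm_fderiv_curl_le hu2 x).trans (mul_le_mul_of_nonneg_left (h2 x hxK) (norm_nonneg curlCLM))
    have hΓ : |angVortQuot u x| ≤ ‖curlCLM‖ * D₂ := (hax.abs_angVortQuot_le_norm_fderiv_curl hu x).trans hω
    have hΦ : |radVelQuot (curl u) x| ≤ ‖curlCLM‖ * D₂ :=
      (hax.abs_radVelQuot_curl_le_norm_fderiv_curl hu x).trans hω
    have hζ : |ζ x| ≤ 1 := by rw [abs_of_nonneg (hζ01 x).1]; exact (hζ01 x).2
    rw [abs_mul, abs_mul, abs_mul, abs_mul]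
    have hκ : 0 ≤ ‖curlCLM‖ * D₂ := by positivity
    calc |angVelQuot u x| * (|ζ x| * |angVortQuot u x|) * (|ζ x| * |radVelQuot (curl u) x|)
        ≤ D₁ * (1 * (‖curlCLM‖ * D₂)) * (1 * (‖curlCLM‖ * D₂)) := by
          gcongr
      _ = D₁ * (‖curlCLM‖ * D₂) ^ 2 := by ring
  · rw [image_eq_zero_of_notMem_tsupport hxs]
    simp only [zero_mul, mul_zero, abs_zero]
    positivity

/-- **`hP0`**: on `{ϱ ≥ r₁}`, `|v_θ| ‖∇(ζ v_r/r)‖ ≤ D₀D₁Z₁ + 4D₁²`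
(`∇(ζρ) = ρ∇ζ + ζ∇ρ`, `|v_θ||ρ|‖∇ζ‖ ≤ ‖v‖‖Dv‖Z₁`, `|v_θ|ζ‖∇ρ‖ ≤ 4‖Dv‖²` by
`abs_swirlVelocity_mul_norm_fderiv_radVelQuot_le`; off `tsupport ζ` the gradient vanishes).
[cite: Seregin2022LocalAxisym, §2 Step 3, estimate of A₀/A'₃₁ (arXiv:2201.00153 pp. 6–7)] -/
theorem P0_bound (hu : ContDiff ℝ 3 u) (hax : IsAxisymmetric u) (hζ : ContDiff ℝ 1 ζ)
    (hζ01 : ∀ x, 0 ≤ ζ x ∧ ζ x ≤ 1) (hZ₁ : ∀ x, ‖fderiv ℝ ζ x‖ ≤ Z₁)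
    (hKfar : ∀ x ∈ tsupport ζ, r₁ ≤ cylRadius x → x ∈ K) (hD₀ : 0 ≤ D₀) (hD₁ : 0 ≤ D₁)
    (hZ₁0 : 0 ≤ Z₁) (h0 : ∀ x ∈ K, ‖u x‖ ≤ D₀) (h1 : ∀ x ∈ K, ‖fderiv ℝ u x‖ ≤ D₁)
    (x : EuclideanSpace ℝ (Fin 3)) (hx : r₁ ≤ cylRadius x) :
    |swirlVelocity u x| * ‖fderiv ℝ (fun y => ζ y * radVelQuot u y) x‖ ≤ D₀ * D₁ * Z₁ + 4 * D₁ ^ 2 := by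
  have hu2 : ContDiff ℝ 2 u := hu.of_le (by norm_num)
  have hρ1 : ContDiff ℝ 1 (radVelQuot u) := contDiff_radVelQuot (n := 1) (by exact_mod_cast hu)
  by_cases hxs : x ∈ tsupport ζ
  · have hxK : x ∈ K := hKfar x hxs hx
    have hθ : |swirlVelocity u x| ≤ D₀ := (abs_swirlVelocity_le u x).trans (h0 x hxK)
    have hρ : |radVelQuot u x| ≤ D₁ := (hax.abs_radVelQuot_le_norm_fderiv hu2 x).trans (h1 x hxK)
    have hkey : |swirlVelocity u x| * ‖fderiv ℝ (radVelQuot u) x‖ ≤ 4 * D₁ ^ 2 :=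
      (abs_swirlVelocity_mul_norm_fderiv_radVelQuot_le u hax hu x).trans (by nlinarith [h1 x hxK, norm_nonneg (fderiv ℝ u x)])
    rw [fderiv_fun_mul (hζ.differentiable one_ne_zero x) (hρ1.differentiable one_ne_zero x)]
    calc |swirlVelocity u x| * ‖ζ x • fderiv ℝ (radVelQuot u) x + radVelQuot u x • fderiv ℝ ζ x‖
        ≤ |swirlVelocity u x| * (|ζ x| * ‖fderiv ℝ (radVelQuot u) x‖ + |radVelQuot u x| * ‖fderiv ℝ ζ x‖) := by
          refine mul_le_mul_of_nonneg_left ((norm_add_le _ _).trans ?_) (abs_nonneg _)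
          rw [norm_smul, norm_smul, Real.norm_eq_abs, Real.norm_eq_abs]
      _ = |ζ x| * (|swirlVelocity u x| * ‖fderiv ℝ (radVelQuot u) x‖) +
          |swirlVelocity u x| * |radVelQuot u x| * ‖fderiv ℝ ζ x‖ := by ring
      _ ≤ 1 * (4 * D₁ ^ 2) + D₀ * D₁ * Z₁ := by
          have hζle : |ζ x| ≤ 1 := by rw [abs_of_nonneg (hζ01 x).1]; exact (hζ01 x).2
          gcongr
          · exact hZ₁ x
      _ = D₀ * D₁ * Z₁ + 4 * D₁ ^ 2 := by ring
  · have h0f : ∀ y ∉ tsupport ζ, ζ y * radVelQuot u y = 0 := fun y hy => by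
      rw [image_eq_zero_of_notMem_tsupport hy, zero_mul]
    rw [fderiv_eq_zero_of_forall_notMem (isClosed_tsupport ζ) h0f hxs, norm_zero, mul_zero]
    positivity

/-- **`hP1`**: `|v_r/r| |v_θ| ‖∇ζ‖ ≤ D₁D₀Z₁` everywhere (zero where `∇ζ = 0`).
[cite: Seregin2022LocalAxisym, §2 Step 3, estimate of A'₃₁ (arXiv:2201.00153 p. 7)] -/
theorem P1_bound (hu : ContDiff ℝ 2 u) (hax : IsAxisymmetric u) (hZ₁ : ∀ x, ‖fderiv ℝ ζ x‖ ≤ Z₁)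
    (hK : tsupport (fderiv ℝ ζ) ⊆ K) (hD₀ : 0 ≤ D₀) (hD₁ : 0 ≤ D₁) (hZ₁0 : 0 ≤ Z₁)
    (h0 : ∀ x ∈ K, ‖u x‖ ≤ D₀) (h1 : ∀ x ∈ K, ‖fderiv ℝ u x‖ ≤ D₁) (x : EuclideanSpace ℝ (Fin 3)) :
    |radVelQuot u x| * |swirlVelocity u x| * ‖fderiv ℝ ζ x‖ ≤ D₁ * D₀ * Z₁ := by
  by_cases hx : fderiv ℝ ζ x = 0
  · rw [hx, norm_zero, mul_zero]; positivity
  · have hxK : x ∈ K := mem_of_fderiv_ne_zero hK hx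
    have hρ : |radVelQuot u x| ≤ D₁ := (hax.abs_radVelQuot_le_norm_fderiv hu x).trans (h1 x hxK)
    have hθ : |swirlVelocity u x| ≤ D₀ := (abs_swirlVelocity_le u x).trans (h0 x hxK)
    gcongr
    exact hZ₁ x

/-- **`hP2`**: `|ζΦ| |v_θ| (‖∇ζ‖ ‖∇(v_r/r)‖) ≤ κD₂ Z₁ (4D₁²)` everywhere (zero where `∇ζ = 0`;
`|v_θ|‖∇(v_r/r)‖ ≤ 4‖Dv‖²` absorbs the `1/ϱ` near the heights).
[cite: Seregin2022LocalAxisym, §2 Step 3, estimate of A₃₂ (arXiv:2201.00153 p. 7)] -/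
theorem P2_bound (hu : ContDiff ℝ 3 u) (hax : IsAxisymmetric u) (hζ01 : ∀ x, 0 ≤ ζ x ∧ ζ x ≤ 1)
    (hZ₁ : ∀ x, ‖fderiv ℝ ζ x‖ ≤ Z₁) (hK : tsupport (fderiv ℝ ζ) ⊆ K) (hD₁ : 0 ≤ D₁)
    (hD₂ : 0 ≤ D₂) (hZ₁0 : 0 ≤ Z₁) (h1 : ∀ x ∈ K, ‖fderiv ℝ u x‖ ≤ D₁)
    (h2 : ∀ x ∈ K, ‖iteratedFDeriv ℝ 2 u x‖ ≤ D₂) (x : EuclideanSpace ℝ (Fin 3)) :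
    |ζ x * radVelQuot (curl u) x| * |swirlVelocity u x| *
        (‖fderiv ℝ ζ x‖ * ‖fderiv ℝ (radVelQuot u) x‖) ≤ ‖curlCLM‖ * D₂ * Z₁ * (4 * D₁ ^ 2) := by
  have hu2 : ContDiff ℝ 2 u := hu.of_le (by norm_num)
  by_cases hx : fderiv ℝ ζ x = 0
  · rw [hx, norm_zero, zero_mul, mul_zero]; positivity
  · have hxK : x ∈ K := mem_of_fderiv_ne_zero hK hx
    have hΦ : |ζ x * radVelQuot (curl u) x| ≤ ‖curlCLM‖ * D₂ := by
      rw [abs_mul]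
      have hζle : |ζ x| ≤ 1 := by rw [abs_of_nonneg (hζ01 x).1]; exact (hζ01 x).2
      calc |ζ x| * |radVelQuot (curl u) x| ≤ 1 * (‖curlCLM‖ * D₂) := by
            refine mul_le_mul hζle ?_ (abs_nonneg _) zero_le_one
            exact (hax.abs_radVelQuot_curl_le_norm_fderiv_curl hu x).trans ((norm_fderiv_curl_le hu2 x).trans
              (mul_le_mul_of_nonneg_left (h2 x hxK) (norm_nonneg curlCLM)))
        _ = ‖curlCLM‖ * D₂ := one_mul _
    have hkey : |swirlVelocity u x| * ‖fderiv ℝ (radVelQuot u) x‖ ≤ 4 * D₁ ^ 2 :=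
      (abs_swirlVelocity_mul_norm_fderiv_radVelQuot_le u hax hu x).trans (by nlinarith [h1 x hxK, norm_nonneg (fderiv ℝ u x)])
    calc |ζ x * radVelQuot (curl u) x| * |swirlVelocity u x| * (‖fderiv ℝ ζ x‖ * ‖fderiv ℝ (radVelQuot u) x‖)
        = |ζ x * radVelQuot (curl u) x| * ‖fderiv ℝ ζ x‖ * (|swirlVelocity u x| * ‖fderiv ℝ (radVelQuot u) x‖) := by ring
      _ ≤ ‖curlCLM‖ * D₂ * Z₁ * (4 * D₁ ^ 2) :=
          mul_le_mul (mul_le_mul hΦ (hZ₁ x) (norm_nonneg _) (mul_nonneg (norm_nonneg curlCLM) hD₂)) hkey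
            (mul_nonneg (abs_nonneg _) (norm_nonneg _))
            (mul_nonneg (mul_nonneg (norm_nonneg curlCLM) hD₂) hZ₁0)

/-- **`hP3`**: on `{∇ζ ≠ 0}`, `|∂₃(∂₃ζ · v_r/r − q_ζ · v₃)| ≤ Z₁D₂ + Z₂D₁ + Q₀D₁ + Q₁D₀`
(product rule at `x`; `|∂₃(v_r/r)| ≤ ‖D²v‖`, `|∂₃∂₃ζ| ≤ ‖D²ζ‖`, `|∂₃v₃| ≤ ‖Dv‖`). The paper's
error term `C(v, η)` of Lemma 2.1 (ii) ("`v₃, v_{r,3}, …, v_{r,3}/r`").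
[cite: Seregin2022LocalAxisym, §2 proof of Lemma 2.1 (arXiv:2201.00153 p. 5), C(v,η)] -/
theorem P3_bound (hu : ContDiff ℝ 3 u) (hax : IsAxisymmetric u) (hζ : ContDiff ℝ 4 ζ)
    (hZ₁ : ∀ x, ‖fderiv ℝ ζ x‖ ≤ Z₁) (hZ₂ : ∀ x, ‖iteratedFDeriv ℝ 2 ζ x‖ ≤ Z₂)
    (hQ₀ : ∀ x, |radDerivQuot ζ x| ≤ Q₀) (hQ₁ : ∀ x, ‖fderiv ℝ (radDerivQuot ζ) x‖ ≤ Q₁)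
    (hK : tsupport (fderiv ℝ ζ) ⊆ K) (hD₀ : 0 ≤ D₀) (hD₁ : 0 ≤ D₁)
    (hZ₁0 : 0 ≤ Z₁) (hQ₀0 : 0 ≤ Q₀)
    (h0 : ∀ x ∈ K, ‖u x‖ ≤ D₀) (h1 : ∀ x ∈ K, ‖fderiv ℝ u x‖ ≤ D₁)
    (h2 : ∀ x ∈ K, ‖iteratedFDeriv ℝ 2 u x‖ ≤ D₂) (x : EuclideanSpace ℝ (Fin 3))
    (hx : fderiv ℝ ζ x ≠ 0) :
    |fderiv ℝ (fun y => fderiv ℝ ζ y (EuclideanSpace.single 2 1) * radVelQuot u y -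
        radDerivQuot ζ y * u y 2) x (EuclideanSpace.single 2 1)| ≤
      Z₁ * D₂ + Z₂ * D₁ + Q₀ * D₁ + Q₁ * D₀ := by
  have hxK : x ∈ K := mem_of_fderiv_ne_zero hK hx
  have hu2 : ContDiff ℝ 2 u := hu.of_le (by norm_num)
  have hζ2 : ContDiff ℝ 2 ζ := hζ.of_le (by norm_num)
  set e₂ : EuclideanSpace ℝ (Fin 3) := EuclideanSpace.single 2 1 with he₂
  have hne₂ : ‖e₂‖ = 1 := by simp [he₂]
  -- the four factors and their differentiability at `x`
  have hf1 : DifferentiableAt ℝ (fun y => fderiv ℝ ζ y e₂) x :=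
    ((contDiff_fderiv_apply_const_succ (n := 1) (by exact_mod_cast hζ2) e₂).differentiable one_ne_zero) x
  have hρd : DifferentiableAt ℝ (radVelQuot u) x :=
    ((contDiff_radVelQuot (n := 1) (by exact_mod_cast hu)).differentiable one_ne_zero) x
  have hq1 : ContDiff ℝ 1 (radDerivQuot ζ) := contDiff_radDerivQuot (n := 1) (by exact_mod_cast hζ.of_le (by norm_num))
  have hqd : DifferentiableAt ℝ (radDerivQuot ζ) x := (hq1.differentiable one_ne_zero) x
  have hud : DifferentiableAt ℝ u x := (hu.differentiable (by norm_num)) x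
  have hu2d : DifferentiableAt ℝ (fun y => u y 2) x := (EuclideanSpace.proj (𝕜 := ℝ) (2 : Fin 3)).differentiableAt.comp x hud
  have hu2f : fderiv ℝ (fun y => u y 2) x e₂ = fderiv ℝ u x e₂ 2 := by
    rw [show (fun y => u y 2) = (EuclideanSpace.proj (𝕜 := ℝ) (2 : Fin 3)) ∘ u from rfl,
      fderiv_comp x (EuclideanSpace.proj (𝕜 := ℝ) (2 : Fin 3)).differentiableAt hud,
      ContinuousLinearMap.fderiv]
    rfl
  rw [fderiv_fun_sub (hf1.fun_mul hρd) (hqd.fun_mul hu2d), fderiv_fun_mul hf1 hρd, fderiv_fun_mul hqd hu2d]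
  simp only [_root_.sub_apply, _root_.add_apply, _root_.FunLike.coe_smul, Pi.smul_apply, smul_eq_mul,
    hu2f]
  -- the eight pointwise bounds
  have b1 : |fderiv ℝ ζ x e₂| ≤ Z₁ := by
    rw [← Real.norm_eq_abs]
    exact ((fderiv ℝ ζ x).le_opNorm e₂).trans (by rw [hne₂, mul_one]; exact hZ₁ x)
  have b2 : |fderiv ℝ (radVelQuot u) x e₂| ≤ D₂ :=
    (abs_fderiv_radVelQuot_single_two_le hax hu x).trans (h2 x hxK)
  have b3 : |radVelQuot u x| ≤ D₁ := (hax.abs_radVelQuot_le_norm_fderiv hu2 x).trans (h1 x hxK)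
  have b4 : |fderiv ℝ (fun y => fderiv ℝ ζ y e₂) x e₂| ≤ Z₂ := by
    rw [← Real.norm_eq_abs]
    refine ((fderiv ℝ (fun y => fderiv ℝ ζ y e₂) x).le_opNorm e₂).trans ?_
    rw [hne₂, mul_one]
    exact (norm_fderiv_fderiv_apply_le hζ2 x e₂).trans (by rw [hne₂, one_mul]; exact hZ₂ x)
  have b5 : |radDerivQuot ζ x| ≤ Q₀ := hQ₀ x
  have b6 : |fderiv ℝ u x e₂ 2| ≤ D₁ := by
    refine (by simpa using PiLp.norm_apply_le (fderiv ℝ u x e₂) 2 : |fderiv ℝ u x e₂ 2| ≤ ‖fderiv ℝ u x e₂‖).trans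
      (((fderiv ℝ u x).le_opNorm e₂).trans ?_)
    rw [hne₂, mul_one]
    exact h1 x hxK
  have b7 : |u x 2| ≤ D₀ :=
    (by simpa using PiLp.norm_apply_le (u x) 2 : |u x 2| ≤ ‖u x‖).trans (h0 x hxK)
  have b8 : |fderiv ℝ (radDerivQuot ζ) x e₂| ≤ Q₁ := by
    rw [← Real.norm_eq_abs]
    exact ((fderiv ℝ (radDerivQuot ζ) x).le_opNorm e₂).trans (by rw [hne₂, mul_one]; exact hQ₁ x)
  calc |fderiv ℝ ζ x e₂ * fderiv ℝ (radVelQuot u) x e₂ + radVelQuot u x * fderiv ℝ (fun y => fderiv ℝ ζ y e₂) x e₂ -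
        (radDerivQuot ζ x * fderiv ℝ u x e₂ 2 + u x 2 * fderiv ℝ (radDerivQuot ζ) x e₂)|
      ≤ |fderiv ℝ ζ x e₂| * |fderiv ℝ (radVelQuot u) x e₂| + |radVelQuot u x| * |fderiv ℝ (fun y => fderiv ℝ ζ y e₂) x e₂| +
        (|radDerivQuot ζ x| * |fderiv ℝ u x e₂ 2| + |u x 2| * |fderiv ℝ (radDerivQuot ζ) x e₂|) := by
          rw [← abs_mul, ← abs_mul, ← abs_mul, ← abs_mul]
          exact (abs_sub _ _).trans (add_le_add (abs_add_le _ _) (abs_add_le _ _))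
    _ ≤ Z₁ * D₂ + D₁ * Z₂ + (Q₀ * D₁ + D₀ * Q₁) := by gcongr
    _ = Z₁ * D₂ + Z₂ * D₁ + Q₀ * D₁ + Q₁ * D₀ := by ring

/-- **`hP4`**: on `{∇ζ ≠ 0}`, `|q_{∇ζ·v}| ≤ Z₁D₂ + 2Z₂D₁ + Z₃D₀`: the scalar `T = Dζ(·)[v(·)]` is
axisymmetric of class `C³`, `|q_T(x)| ≤ ‖D²T(x)‖` (`abs_radDerivQuot_le_norm_iteratedFDeriv_two`), and
Leibniz (`norm_iteratedFDeriv_clm_apply`). The paper's `C(v, η)` of Lemma 2.1 ("`v_{3,r}/r`,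
`v_{3,rr}`"). [cite: Seregin2022LocalAxisym, §2 proof of Lemma 2.1 (arXiv:2201.00153 p. 5), C(v,η)] -/
theorem P4_bound (hu : ContDiff ℝ 3 u) (hax : IsAxisymmetric u) (hζ : ContDiff ℝ 4 ζ)
    (hζax : IsAxisymmetricScalar ζ) (hZ₁ : ∀ x, ‖fderiv ℝ ζ x‖ ≤ Z₁)
    (hZ₂ : ∀ x, ‖iteratedFDeriv ℝ 2 ζ x‖ ≤ Z₂) (hZ₃ : ∀ x, ‖iteratedFDeriv ℝ 3 ζ x‖ ≤ Z₃)
    (hK : tsupport (fderiv ℝ ζ) ⊆ K) (hZ₁0 : 0 ≤ Z₁) (hZ₂0 : 0 ≤ Z₂) (hZ₃0 : 0 ≤ Z₃)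
    (h0 : ∀ x ∈ K, ‖u x‖ ≤ D₀) (h1 : ∀ x ∈ K, ‖fderiv ℝ u x‖ ≤ D₁)
    (h2 : ∀ x ∈ K, ‖iteratedFDeriv ℝ 2 u x‖ ≤ D₂) (x : EuclideanSpace ℝ (Fin 3))
    (hx : fderiv ℝ ζ x ≠ 0) :
    |radDerivQuot (fun y => fderiv ℝ ζ y (u y)) x| ≤ Z₁ * D₂ + 2 * Z₂ * D₁ + Z₃ * D₀ := by
  have hxK : x ∈ K := mem_of_fderiv_ne_zero hK hx
  have hu2 : ContDiff ℝ 2 u := hu.of_le (by norm_num)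
  have hDζ3 : ContDiff ℝ 3 (fderiv ℝ ζ) := hζ.fderiv_right (m := 3) (by norm_num)
  have hDζ2 : ContDiff ℝ 2 (fderiv ℝ ζ) := hDζ3.of_le (by norm_num)
  have hT3 : ContDiff ℝ 3 fun y => fderiv ℝ ζ y (u y) := hDζ3.clm_apply hu
  have hTax : IsAxisymmetricScalar fun y => fderiv ℝ ζ y (u y) := fun θ y => by
    simp only [hax θ y]
    exact hζax.fderiv_rotZ_apply_rotZ (hζ.differentiable (by norm_num)) θ y (u y)
  have hL := norm_iteratedFDeriv_clm_apply (𝕜 := ℝ) (f := fderiv ℝ ζ) (g := u) (N := 2) (n := 2)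
    hDζ2 hu2 x le_rfl
  simp only [Finset.sum_range_succ, Finset.sum_range_zero, zero_add, norm_iteratedFDeriv_fderiv,
    Nat.choose_zero_right, Nat.choose_one_right, Nat.choose_self, Nat.cast_one, Nat.cast_ofNat,
    one_mul] at hL
  have e1 : ‖iteratedFDeriv ℝ (0 + 1) ζ x‖ = ‖fderiv ℝ ζ x‖ := norm_iteratedFDeriv_one ζ
  have e2 : ‖iteratedFDeriv ℝ (2 - 0) u x‖ = ‖iteratedFDeriv ℝ 2 u x‖ := rfl
  have e3 : ‖iteratedFDeriv ℝ (1 + 1) ζ x‖ = ‖iteratedFDeriv ℝ 2 ζ x‖ := rfl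
  have e4 : ‖iteratedFDeriv ℝ (2 - 1) u x‖ = ‖fderiv ℝ u x‖ := norm_iteratedFDeriv_one u
  have e5 : ‖iteratedFDeriv ℝ (2 + 1) ζ x‖ = ‖iteratedFDeriv ℝ 3 ζ x‖ := rfl
  have e6 : ‖iteratedFDeriv ℝ (2 - 2) u x‖ = ‖u x‖ := norm_iteratedFDeriv_zero
  rw [e1, e2, e3, e4, e5, e6] at hL
  calc |radDerivQuot (fun y => fderiv ℝ ζ y (u y)) x|
      ≤ ‖iteratedFDeriv ℝ 2 (fun y => fderiv ℝ ζ y (u y)) x‖ :=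
        abs_radDerivQuot_le_norm_iteratedFDeriv_two _ hT3 hTax x
    _ ≤ ‖fderiv ℝ ζ x‖ * ‖iteratedFDeriv ℝ 2 u x‖ + 2 * ‖iteratedFDeriv ℝ 2 ζ x‖ * ‖fderiv ℝ u x‖ +
        ‖iteratedFDeriv ℝ 3 ζ x‖ * ‖u x‖ := hL
    _ ≤ Z₁ * D₂ + 2 * Z₂ * D₁ + Z₃ * D₀ := by
        gcongr
        exacts [hZ₁ x, h2 x hxK, hZ₂ x, h1 x hxK, hZ₃ x, h0 x hxK]

/-- **Step 4's `L`**: on `{∇ζ ≠ 0}`, `‖v‖ ≤ D₀` and `|Φ| ≤ κD₂`. [cite: Seregin2022LocalAxisym, §2 Step 4 (arXiv:2201.00153 p. 7), boundedness of v and ∇ω on supp ∇η] -/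
theorem L_bound (hu : ContDiff ℝ 3 u) (hax : IsAxisymmetric u) (hK : tsupport (fderiv ℝ ζ) ⊆ K)
    (h0 : ∀ x ∈ K, ‖u x‖ ≤ D₀) (h2 : ∀ x ∈ K, ‖iteratedFDeriv ℝ 2 u x‖ ≤ D₂)
    (x : EuclideanSpace ℝ (Fin 3)) (hx : fderiv ℝ ζ x ≠ 0) :
    ‖u x‖ ≤ D₀ ∧ |radVelQuot (curl u) x| ≤ ‖curlCLM‖ * D₂ := by
  have hxK : x ∈ K := mem_of_fderiv_ne_zero hK hx
  refine ⟨h0 x hxK, (hax.abs_radVelQuot_curl_le_norm_fderiv_curl hu x).trans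
    ((norm_fderiv_curl_le (hu.of_le (by norm_num)) x).trans
      (mul_le_mul_of_nonneg_left (h2 x hxK) (norm_nonneg curlCLM)))⟩

/-! ### The six hypotheses bundled -/

/-- **Seregin 2022, §2 Step 1 ⇒ Step 3: the pointwise constants of the key estimate from
sup-norm bounds on the regular region.** For one time slice: an axisymmetric `v ∈ C³`, an
axisymmetric cut-off `ζ ∈ C⁴` with `0 ≤ ζ ≤ 1` and derivative bounds `Z₁, Z₂, Z₃, Q₀, Q₁`
(`exists_cutoff_derivBounds`), a set `K` containing `tsupport ∇ζ` and `tsupport ζ ∩ {ϱ ≥ r₁}`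
(for the Step-1 cut-off: a compact set of regular top-slice points, `exists_step1_cutoff`), and
`‖v‖ ≤ D₀`, `‖Dv‖ ≤ D₁`, `‖D²v‖ ≤ D₂` on `K` ("in the set `supp |∇η|`, functions `v`, `∇v`, and
`∇²v` are bounded"), the hypotheses `hfar`, `hP0`, `hP1`, `hP2`, `hP3`, `hP4` of
`cutoff_energy_keyEstimate_unconditional` and `|v| ≤ L`, `|Φ| ≤ L_Φ` of
`isRegularAtOrigin_of_step3Bounds` hold at this slice with
`M = D₁(κD₂)²`, `P₀ = D₀D₁Z₁ + 4D₁²`, `P₁ = D₁D₀Z₁`, `P₂ = κD₂Z₁(4D₁²)`,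
`P₃ = Z₁D₂ + Z₂D₁ + Q₀D₁ + Q₁D₀`, `P₄ = Z₁D₂ + 2Z₂D₁ + Z₃D₀`, `L = D₀`, `L_Φ = κD₂`
(`κ = ‖curlCLM‖`) — constants independent of the slice, hence uniform on the final slab once
`D₀, D₁, D₂` are. Registered sub-goal toward `stub_sereginLogSwirlOrigin`. [cite: Seregin2022LocalAxisym, §2 Step 1 (arXiv:2201.00153 p. 5), Lemma 2.1 C(v,η), Step 3 C(v,η), C(v,η,r₁) (pp. 5–7)] -/
theorem step3_pointwiseConstants : ∀ (u : EuclideanSpace ℝ (Fin 3) → EuclideanSpace ℝ (Fin 3)) (ζ : EuclideanSpace ℝ (Fin 3) → ℝ) (K : Set (EuclideanSpace ℝ (Fin 3))) (r₁ D₀ D₁ D₂ Z₁ Z₂ Z₃ Q₀ Q₁ : ℝ), ContDiff ℝ 3 u → IsAxisymmetric u → ContDiff ℝ 4 ζ → IsAxisymmetricScalar ζ → (∀ x, 0 ≤ ζ x ∧ ζ x ≤ 1) → tsupport (fderiv ℝ ζ) ⊆ K → (∀ x ∈ tsupport ζ, r₁ ≤ cylRadius x → x ∈ K) → 0 ≤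 D₀ → 0 ≤ D₁ → 0 ≤ D₂ → 0 ≤ Z₁ → 0 ≤ Z₂ → 0 ≤ Z₃ → 0 ≤ Q₀ → (∀ x, ‖fderiv ℝ ζ x‖ ≤ Z₁) → (∀ x, ‖iteratedFDeriv ℝ 2 ζ x‖ ≤ Z₂) → (∀ x, ‖iteratedFDeriv ℝ 3 ζ x‖ ≤ Z₃) → (∀ x, |radDerivQuot ζ x| ≤ Q₀) → (∀ x, ‖fderiv ℝ (radDerivQuot ζ) x‖ ≤ Q₁) → (∀ x ∈ K, ‖u x‖ ≤ D₀) → (∀ x ∈ K, ‖fderiv ℝ u x‖ ≤ D₁) → (∀ x ∈ K, ‖iteratedFDeriv ℝ 2 u x‖ ≤ D₂) → (∀ x, r₁ ≤ cylRadius x → |angVelQuot u x * (ζ x * angVortQuot u x) * (ζ x * radVelQuot (curl u) x)| ≤ D₁ * (‖curlCLM‖ * D₂) ^ 2) ∧ (∀ x, r₁ ≤ cylRadius x → |swirlVelocity u x| * ‖fderiv ℝ (fun y => ζ y * radVelQuot u y) x‖ ≤ D₀ * D₁ * Z₁ + 4 * D₁ ^ 2) ∧ (∀ x, |radVelQuot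 u x| * |swirlVelocity u x| * ‖fderiv ℝ ζ x‖ ≤ D₁ * D₀ * Z₁) ∧ (∀ x, |ζ x * radVelQuot (curl u) x| * |swirlVelocity u x| * (‖fderiv ℝ ζ x‖ * ‖fderiv ℝ (radVelQuot u) x‖) ≤ ‖curlCLM‖ * D₂ * Z₁ * (4 * D₁ ^ 2)) ∧ (∀ x, fderiv ℝ ζ x ≠ 0 → |fderiv ℝ (fun y => fderiv ℝ ζ y (EuclideanSpace.single 2 1) * radVelQuot u y - radDerivQuot ζ y * u y 2) x (EuclideanSpace.single 2 1)| ≤ Z₁ * D₂ + Z₂ * D₁ + Q₀ * D₁ + Q₁ * D₀) ∧ (∀ x, fderiv ℝ ζ x ≠ 0 → |radDerivQuot (fun y => fderiv ℝ ζ y (u y)) x| ≤ Z₁ * D₂ + 2 * Z₂ * D₁ + Z₃ * D₀) ∧ (∀ x, fderiv ℝ ζ x ≠ 0 → ‖u x‖ ≤ D₀) ∧ (∀ x, fderiv ℝ ζ x ≠ 0 → |radVelQuot (curl u) x| ≤ ‖curlCLM‖ * D₂) := by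
  intro u ζ K r₁ D₀ D₁ D₂ Z₁ Z₂ Z₃ Q₀ Q₁ hu hax hζ hζax hζ01 hK hKfar hD₀ hD₁ hD₂ hZ₁0 hZ₂0 hZ₃0 hQ₀0 hZ₁ hZ₂ hZ₃ hQ₀ hQ₁ h0 h1 h2
  exact ⟨far_bound hu hax hζ01 hKfar hD₁ hD₂ h1 h2,
    P0_bound hu hax (hζ.of_le (by norm_num)) hζ01 hZ₁ hKfar hD₀ hD₁ hZ₁0 h0 h1,
    P1_bound (hu.of_le (by norm_num)) hax hZ₁ hK hD₀ hD₁ hZ₁0 h0 h1,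
    P2_bound hu hax hζ01 hZ₁ hK hD₁ hD₂ hZ₁0 h1 h2,
    P3_bound hu hax hζ hZ₁ hZ₂ hQ₀ hQ₁ hK hD₀ hD₁ hZ₁0 hQ₀0 h0 h1 h2,
    P4_bound hu hax hζ hζax hZ₁ hZ₂ hZ₃ hK hZ₁0 hZ₂0 hZ₃0 h0 h1 h2,
    fun x hx => (L_bound hu hax hK h0 h2 x hx).1, fun x hx => (L_bound hu hax hK h0 h2 x hx).2⟩

end Pointwise

end Literature.Analysis.SereginLogSwirlOrigin.EulerScaling

end Part8

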